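import Summits.HodgeConjecture.HodgeConjecture.Cruxes.BlochSeedDiscOne.DiamondLevelLaws
import Summits.HodgeConjecture.HodgeConjecture.Cruxes.BlochSeedDiscOne.LinePhaseRigidity

/-!
# BlochSeedDiscOne ∕ ChargeInduction (v11) — THE CHARGE INDUCTION: the partial level laws (LVN_h), (LVP3_h) are RULE-D consequences of (CD_h) and two thin SEED laws

`plan-lens-HodgeAV-control` g13 (director-hodge req-36, LENSES-v3 «control»: find the CONTROLLING QUANTITY; crux of record H2 =
`stmt-HodgeConjecture-18881` `BlochSeedDiscOne`, skeleton `Lines/birth.lean` 814a6a70c14e831a, rung `stub_rung_pad4_seedAt` (T_h) =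
`SeedB1OddDiamondG1H1 h` at `h = 8, 10`; critic of record idea-crit-6).  Companion memo `CHARGE-INDUCTION-g13.md` (same crux directory).

HONEST STATUS.  Nothing in this file proves HC, HC_CM, HC_AV, H2 = `BlochSeedDiscOne`, `stmt-HodgeConjecture-18881`, (T₈), (T₁₀), (CD), (LVN), (LVP3),
(NS) or the two seed laws; HC_CM is not used (it is a displayed binder of the ladder route only and does not occur here).  (CD_h) `ChargeDepthLaw`,
(SN_h) `SeedNLaw`, (SP_h) `SeedPLaw`, (NS_h) `NestLaw` are CONJECTURES ∕ census UP-facts and appear ONLY as displayed hypotheses.  MACHINE support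
(machine ≠ kernel): ◇₈ peel j318002 h8 `a459e02921a60310`, ◇₁₀ peel j318002 h10 `74004db439790926`, CHARGEDEPTH-d8-d12 `a045233a103d`.

THE CONTROLLING QUANTITY (the lens's object).  `totalCharge Z = Σ_f |c_f|` (the total charge `Q` of a cell).  Every RULE-D settle ∕ cover option that
the proof below ever invokes produces a cell of STRICTLY LARGER total charge: below an `N`-cell, lowering a charged letter along its line (node −2e, top
fixed: charge +e), lowering an apex `aI ↦ (a−d)I + d·ℓ` (charge +d); above a `P`-cell, raising a charged letter along its line (top +2e: charge +e),
raising an apex (charge +e).  The moves that would DECREASE `Q` (raising a node below an `N`-cell toward the apex, lowering a top above a `P`-cell) are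
exactly the ones RULE D never forces at the demands chosen here (node∕apex coordinates below, top∕apex coordinates above).  Hence a well-founded
induction DOWNWARD in `Q ≤ 2h` — no census, no `decide`, every `h`.

MAIN THEOREM (KERNEL, sorry-free, h-uniform) `levelLocal_of_cd_seeds`: for a configuration `C` in ◇_h with `RuleDMu4Closed C` and the charge-depth
inequalities `CDIneq C`,
  (SN) every `N`-cell with ≥ 2 charged letters of SEED SHAPE is level, and (SP) every HIGH `P`-cell with ≥ 3 charged letters is level
  ⟹ (LVN) every `N`-cell with ≥ 2 charged letters is level, and (LVP3) every `P`-cell with ≥ 3 charged letters is level.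
SEED SHAPE (`SeedShapeN`) = node-flat (all four node levels equal; an apex `aI` has node level `a`) OR twin-apex 2-charged (≤ 2 charged letters, the
apex letters at one common level `a`, and no charged FLOOR letter unless `a = 0`).  HIGH (`HighP`) = every charged letter has node level `≥ 2·(#charged)`.
As laws: `levelNLaw_of_cd_seeds : ChargeDepthLaw h → SeedNLaw h → SeedPLaw h → LevelNLaw h`, `levelP3Law_of_cd_seeds : … → LevelP3Law h` (every `h`).

CONSEQUENCES (KERNEL glue onto `DiamondLevelLaws` v2.1 and the LINE theorem of `LinePhaseRigidity`):
* `oddLineFree_of_lt_twelve : h < 12 → OddLineFree h` — the displayed LINE hypothesis of every `DiamondLevelLaws` reduction is a kernel theorem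
  (`LinePhaseRigidity.oddFCFreeLine_of_lt_twelve`, census glue `lsupport_of_diamond_ceiling`).
* **(T₈) ⟸ (CD₈) ∧ (SN₈) ∧ (SP₈)** `seedB1Odd_eight_of_cd_seeds` (via `DiamondLevelLaws.seedB1Odd_eight_of_partial_cd`).
* **(DL3_h), (DL_h) ⟸ (CD_h) ∧ (SN_h) ∧ (SP_h) for h ≤ 10** (`dl3_of_cd_seeds_le_ten`, `downLineLaw_of_cd_seeds_le_ten`).
* **(T_h) ⟸ (CD_h) ∧ (SN_h) ∧ (SP_h) ∧ (NS_h) for h ≤ 10** `seedB1Odd_of_cd_seeds_nest_le_ten` (master reduction `seedB1Odd_of_level_nest_downLine`).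
NONE of these is a proof of (T₈) or (T₁₀): the displayed hypotheses are census UP-facts, not theorems.

CENSUS SIZE OF THE DISPLAYED INPUTS (dead orbits of the peel tables; cite as `j318002 h8 a459e02921a60310` ∕ `h10 74004db439790926`):
  ◇₈ : (CD₈) 3 555 · (SN₈) 2 142 = node-flat non-level `N` with 2∕3∕4 charged 70∕330∕1 324 + twin-apex 418 · (SP₈) 20 (the family `P[aI | 6I+ℓ_φ | 6I+ℓ_φ′ | 6I+ℓ_φ″]`,
       `a ∈ {0,2,4,6}`) — 5 717 orbits, versus (CD₈)+(LVN₈)+(LVP3₈) = 3 555 + 46 586 + 43 506 = 93 647 of `seedB1Odd_eight_of_partial_cd`;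
  ◇₁₀: (CD₁₀) 8 622 · (SN₁₀) 5 664 = 125∕715∕3 504 + 1 320 · (SP₁₀) 511 — 14 797 orbits, versus 8 622 + 211 041 + 201 401 = 421 064; every listed class is
       100 % dead in both tables (UP-facts; ALIVE count 0).  Machine cross-check of the induction itself (pure RULE D, no other axiom): the Q-monotone
       clause fixpoint `alpha13/fixB3.py 8 auto qmono` derives all 89 660 non-seed law orbits of ◇₈ from the 3 987-orbit automatic seed (max depth 14).

v2 §8 — THE `N`-HALF OF (CD) IS NOT A SEED.  A LEVEL `N`-cell violating the (CD-N) inequality has — unless it has four charged letters and is node-flat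
or has all node levels `≥ 6` (`CDNSeedShape`) — an edge (at) or (tt) all of whose RULE-D outcomes are LEVEL `P`-cells violating the (CD-P) inequality
(§8 `edge_at_cd`, `edge_tt_cd`: the same kernel as §3 with a (CD-P) kill instead of the induction hypothesis).  Hence, with NO induction,
`cdN_of_cdP_seed` ∕ `chargeDepthLaw_of_cdP_seed : ChargeDepthPLaw h → CDNSeedLaw h → ChargeDepthLaw h` (every `h`), and the displayed (CD_h) of the
consequences shrinks to its `P`-half `ChargeDepthPLaw` plus the thin `CDNSeedLaw`: **(T₈) ⟸ (CD-P₈) ∧ (CDN4₈) ∧ (SN₈) ∧ (SP₈)** `seedB1Odd_eight_of_cdP_seeds`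
(census ◇₈: 1 745 + 100 + 2 142 + 20 = 4 007 orbits), **(T_h) ⟸ (CD-P_h) ∧ (CDN4_h) ∧ (SN_h) ∧ (SP_h) ∧ (NS_h), h ≤ 10** `seedB1Odd_of_cdP_seeds_nest_le_ten`
(◇₁₀: 4 202 + 206 + 5 664 + 511 = 10 583 orbits).  The machine Q-monotone fixpoint (`alpha13/fixB4.py`) has exactly these irreducible seeds: ◇₈ 1 745 + 100,
◇₁₀ 4 202 + 206 (the 206 = 14 bi-flat shapes × 10 + the 66 level `{6I+2ℓ, 8I+ℓ}`-mixtures).  DUALITY: the Q-raising part of RULE D is silent exactly on the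
TOP-FLAT (= level) `P`-cells and the NODE-FLAT `N`-cells; everything else reduces to them (plus the twin-apex ∕ HIGH residues).

v3 §9 — THE SECOND INDUCTION.  The non-high 2-charged `P`-cells join the induction (`levelLocal_induction2`, informative edges `edge_at_info` ∕
`edge_tt_info`), so the twin-apex `N`-seed shrinks to the HIGH TWINS (`HighTwin`; ◇₈ 17, ◇₁₀ 136 orbits): **(T₈) ⟸ (CD-P₈) ∧ (CDN4₈) ∧ (SN2₈) ∧ (SP₈)**
`seedB1Odd_eight_of_cdP_seeds2` (1 745 + 100 + 1 741 + 20 = 3 606 orbits), `seedB1Odd_of_cdP_seeds2_nest_le_ten` (◇₁₀ 4 202 + 206 + 4 480 + 511 = 9 399).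

v4 §10 — THE FLOOR (every letter of node 0; ◇₈ 1 220 of the 1 741 (SN2₈) orbits).  KERNEL laws (every `h`): **(F1) `floorDescent`** — below a floor
`N`-cell every RULE-D option at (top of a charged letter, node of another) slides the letter towards its floor apex; **(F3) `floorTwin` ∕ `floorTwin_present`**
— by the A2I⁻ swap clause a floor `N`-cell with a UNIT letter `σ` and an apex `f′` forces its own `P`-TWIN `Z ∘ (σ f′) ∈ C.upper` (`levelLocal_induction3`,
hypotheses `A2IMinusClosed C`, `PermClosed C.lower`): (T₈) ⟸ (CD-P₈) ∧ (CDN4₈) ∧ (SN3₈) ∧ (SP₈) `seedB1Odd_eight_of_cdP_seeds3` (3 478 orbits), `…_seeds3_nest_le_ten`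
(◇₁₀ 9 199); for ANY charge **(F3′) `floorSwap`** and **`floorChain`** (partial descent or polluter).  **v6 §11 (R1)+(R2)**: induction per CHARGE-COUNT STRATUM
`k = 4, 3, 2` on `(2h+1)·maxTop + Q` (`levelLocal_induction4`, `KillAbove2`); the 2-charged floor closes (`floorTwo_absent`) ⇒ (SN4), `seedB1Odd_eight_of_cdP_seeds4`
(◇₈ 3 457), `…_seeds4_nest_le_ten` (◇₁₀ 9 163).  **v7 (R3)** `floorApex_absent`: every floor `N`-cell with an apex and ≥ 2 charged letters is derived ⇒ **(SN5) = node-flat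
minus floor-with-apex**, `seedB1Odd_eight_of_cdP_seeds5` (◇₈ 1 745 + 100 + 1 501 + 20 = 3 366), `seedB1Odd_of_cdP_seeds5_nest_le_ten` (◇₁₀ 4 202 + 206 + 4 040 + 511
= 8 959).  NOT proofs of (T₈) ∕ (T₁₀).  **v8 §13** (g13): `lineRaise_of_ray`, `floorAscent`, `fullDescent_of_unit`.  **v9–v11 §14** (g14): GROUND CELLS `groundDescent` ∕
`groundSwap` ∕ `groundChain` (§10 with spectators freed; the archetype-(a) step at `N[O|4I|2ℓ|2ℓ]` of the census chains, memo `CHARGE-INDUCTION-g14.md`); the SPREAD-ORDER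
steps `floorN_absent_of_floorDescents_absent(′)` = the (R4) step (470 ∕ 470 sampled ◇₈ heads of the census-free induction die by it) and, by DUALITY (`inDiamond_dual`,
`ceilingAscent`), `ceilingP_absent_of_ceilingAscents_absent` = the (SP) step; the served form of `X⁺` below the ceiling is the companion module `XPlusServed`.

WHAT IS RESTATED.  §2 re-proves six small helpers of `DiamondUpFacts` v4 (g12; that module is not yet built by the gate, hence not importable today):
`lineChild_of_ray`, `chargeCount_congr`, `chargeCount_agree_succ`, `charged_of_three`, `coord_add_coord_add_two`, `adapted_add_two` — verbatim, attributed,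
in this file's own namespace; everything else is imported from `DiamondLevelLaws` (built).  No Literature fact, no new axiom, no `decide` on census data.
-/

set_option linter.dupNamespace false
set_option linter.style.longLine false

namespace Summit.HodgeConjecture.HodgeConjecture.Cruxes.BlochSeedDiscOne.ChargeInduction

open Finset Summit.Ventures.HSemireg.Pad4Tower
open Summit.HodgeConjecture.HodgeConjecture.Cruxes.BlochSeedDiscOne.DiamondLevelLaws

/-! ## §1 Total charge, charge count, the seed shapes, the seed laws -/

/-- the TOTAL CHARGE `Q(Z) = Σ_f |c_f|` — the controlling quantity of the induction. -/
def totalCharge (Z : MCell) : ℤ := absCharge (Z 0) + absCharge (Z 1) + absCharge (Z 2) + absCharge (Z 3)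

theorem fin4_cases (g : Fin 4) : g = 0 ∨ g = 1 ∨ g = 2 ∨ g = 3 := by fin_cases g <;> simp

theorem totalCharge_lt {Z P : MCell} (hle : ∀ f, absCharge (Z f) ≤ absCharge (P f)) (g : Fin 4) (hlt : absCharge (Z g) < absCharge (P g)) :
    totalCharge Z < totalCharge P := by
  have h0 := hle 0; have h1 := hle 1; have h2 := hle 2; have h3 := hle 3
  unfold totalCharge
  rcases fin4_cases g with rfl | rfl | rfl | rfl <;> omega

theorem totalCharge_le_of_inDiamond {h : ℤ} {Z : MCell} (hZ : MCell.InDiamond h Z) : totalCharge Z ≤ 2 * h := by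
  have a0 := (hZ 0).2.1; have b0 := (hZ 0).2.2.2; have a1 := (hZ 1).2.1; have b1 := (hZ 1).2.2.2
  have a2 := (hZ 2).2.1; have b2 := (hZ 2).2.2.2; have a3 := (hZ 3).2.1; have b3 := (hZ 3).2.2.2
  unfold totalCharge; omega

theorem totalCharge_nonneg (Z : MCell) : 0 ≤ totalCharge Z := by
  have h0 : 0 ≤ absCharge (Z 0) := abs_nonneg _; have h1 : 0 ≤ absCharge (Z 1) := abs_nonneg _
  have h2 : 0 ≤ absCharge (Z 2) := abs_nonneg _; have h3 : 0 ≤ absCharge (Z 3) := abs_nonneg _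
  unfold totalCharge; omega

/-- `chargeCount` is monotone under slotwise implication of chargedness … -/
theorem chargeCount_mono {Z P : MCell} (h : ∀ f, (Z f).2 ≠ (0, 0) → (P f).2 ≠ (0, 0)) : chargeCount Z ≤ chargeCount P :=
  Finset.card_le_card fun f hf => by
    simp only [Finset.mem_filter, Finset.mem_univ, true_and] at hf ⊢
    exact h f hf

/-- … and strictly so when a slot gains a charge. -/
theorem chargeCount_strictMono {Z P : MCell} (h : ∀ f, (Z f).2 ≠ (0, 0) → (P f).2 ≠ (0, 0)) {g : Fin 4} (hZg : (Z g).2 = (0, 0))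
    (hPg : (P g).2 ≠ (0, 0)) : chargeCount Z < chargeCount P := by
  apply Finset.card_lt_card
  refine Finset.ssubset_iff_subset_ne.mpr ⟨fun f hf => ?_, fun he => ?_⟩
  · simp only [Finset.mem_filter, Finset.mem_univ, true_and] at hf ⊢
    exact h f hf
  · have hg : g ∈ Finset.univ.filter (fun f : Fin 4 => (P f).2 ≠ (0, 0)) := by simp [hPg]
    rw [← he] at hg
    simp [hZg] at hg

/-- (restated from `DiamondUpFacts` v4, g12) -/
theorem chargeCount_congr {N P : MCell} (h : ∀ f, (N f).2 ≠ (0, 0) ↔ (P f).2 ≠ (0, 0)) : chargeCount N = chargeCount P := by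
  unfold chargeCount; congr 1; exact Finset.filter_congr fun f _ => h f

/-- (restated from `DiamondUpFacts` v4, g12) one slot gains a charge: the count goes up by one. -/
theorem chargeCount_agree_succ {P Z : MCell} {g : Fin 4} (hag : MAgree P Z g) (hZg : (Z g).2 = (0, 0)) (hPg : (P g).2 ≠ (0, 0)) :
    chargeCount P = chargeCount Z + 1 := by
  unfold chargeCount
  have hset : Finset.univ.filter (fun f : Fin 4 => (P f).2 ≠ (0, 0)) = insert g (Finset.univ.filter (fun f : Fin 4 => (Z f).2 ≠ (0, 0))) := by
    ext f
    simp only [Finset.mem_filter, Finset.mem_univ, true_and, Finset.mem_insert]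
    by_cases hf : f = g
    · subst hf; exact ⟨fun _ => Or.inl rfl, fun _ => hPg⟩
    · rw [hag f hf]; exact ⟨fun h => Or.inr h, fun h => h.resolve_left hf⟩
  rw [hset, Finset.card_insert_of_notMem (by simp [hZg])]

/-- (restated from `DiamondUpFacts` v4, g12) with at least three charged letters, every slot other than an uncharged one is charged. -/
theorem charged_of_three {P : MCell} (h3 : 3 ≤ chargeCount P) {g f : Fin 4} (hg : (P g).2 = (0, 0)) (hfg : f ≠ g) : (P f).2 ≠ (0, 0) := by
  intro hf
  unfold chargeCount at h3
  have hsub : Finset.univ.filter (fun f : Fin 4 => (P f).2 ≠ (0, 0)) ⊆ (Finset.univ.erase g).erase f := by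
    intro x hx
    simp only [Finset.mem_filter, Finset.mem_univ, true_and] at hx
    simp only [Finset.mem_erase, Finset.mem_univ, and_true]
    exact ⟨fun e => hx (e ▸ hf), fun e => hx (e ▸ hg)⟩
  have hc := Finset.card_le_card hsub
  rw [Finset.card_erase_of_mem (by simp [hfg]), Finset.card_erase_of_mem (Finset.mem_univ g)] at hc
  simp only [Finset.card_univ, Fintype.card_fin] at hc
  omega

theorem absCharge_of_uncharged {x : BPoint} (h0 : x.2 = (0, 0)) : absCharge x = 0 := by
  simp [absCharge, chargeOf, h0]

theorem nodeLevel_of_uncharged {x : BPoint} (h0 : x.2 = (0, 0)) : nodeLevel x = x.1 := by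
  unfold nodeLevel; rw [absCharge_of_uncharged h0, sub_zero]

theorem causalTop_of_uncharged {x : BPoint} (h0 : x.2 = (0, 0)) : causalTop x = x.1 := by
  unfold causalTop; rw [absCharge_of_uncharged h0, add_zero]

/-- NODE-FLAT: all four node levels agree (an apex `aI` has node level `a`). -/
def NodeFlat (Z : MCell) : Prop := ∀ f g, nodeLevel (Z f) = nodeLevel (Z g)

/-- TWIN-APEX 2-charged shape: at most two charged letters, all apex letters at one common level `a`, and no charged floor letter unless `a = 0`
(these are exactly the 2-charged `N`-cells at which no RULE-D demand of the kind used below exists). -/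
def TwinApex2 (Z : MCell) : Prop :=
  chargeCount Z ≤ 2 ∧ (∀ f g, (Z f).2 = (0, 0) → (Z g).2 = (0, 0) → (Z f).1 = (Z g).1) ∧
    (∀ f g, (Z f).2 = (0, 0) → (Z g).2 ≠ (0, 0) → nodeLevel (Z g) = 0 → (Z f).1 = 0)

/-- the SEED SHAPE of an `N`-cell. -/
def SeedShapeN (Z : MCell) : Prop := NodeFlat Z ∨ TwinApex2 Z

/-- a HIGH `P`-cell: every charged letter has node level `≥ 2·(#charged letters)` (so every level `N`-child keeping these nodes is (CD)-admissible). -/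
def HighP (P : MCell) : Prop := ∀ f, (P f).2 ≠ (0, 0) → 2 * (chargeCount P : ℤ) ≤ nodeLevel (P f)

/-- (SN) locally: the seed-shaped `N`-cells with ≥ 2 charged letters are level. -/
def SeedNLocal (C : MConfig) : Prop := ∀ Z ∈ C.lower, 2 ≤ chargeCount Z → SeedShapeN Z → LevelCell Z

/-- (SP) locally: the HIGH `P`-cells with ≥ 3 charged letters are level. -/
def SeedPLocal (C : MConfig) : Prop := ∀ P ∈ C.upper, 3 ≤ chargeCount P → HighP P → LevelCell P

/-- **(SN_h) THE `N`-SEED LAW** (CONJECTURE, h-uniform; UP-fact of the peel censuses: ◇₈ 2 142 ∕ 2 142 orbits dead, ◇₁₀ 5 664 ∕ 5 664). -/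
def SeedNLaw (h : ℤ) : Prop := ∀ C : MConfig, C.InDiamond h → C.G1Closed → C.StaticH1 → SeedNLocal C

/-- **(SP_h) THE `P`-SEED LAW** (CONJECTURE, h-uniform; UP-fact: ◇₈ 20 ∕ 20 orbits dead, ◇₁₀ 511 ∕ 511). -/
def SeedPLaw (h : ℤ) : Prop := ∀ C : MConfig, C.InDiamond h → C.G1Closed → C.StaticH1 → SeedPLocal C

theorem chargeDepthLaw_antitone {h h' : ℤ} (hh : h ≤ h') (H : ChargeDepthLaw h') : ChargeDepthLaw h :=
  fun C hU hG hS => H C (inDiamond_config_mono hh hU) hG hS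

theorem seedNLaw_antitone {h h' : ℤ} (hh : h ≤ h') (H : SeedNLaw h') : SeedNLaw h :=
  fun C hU hG hS => H C (inDiamond_config_mono hh hU) hG hS

theorem seedPLaw_antitone {h h' : ℤ} (hh : h ≤ h') (H : SeedPLaw h') : SeedPLaw h :=
  fun C hU hG hS => H C (inDiamond_config_mono hh hU) hG hS

/-! ## §2 Letter geometry of the four Q-raising moves -/

/-- (restated from `DiamondUpFacts` v4, g12) **the LINE CHILD**: if the charged μ₄ letter `x` (node direction `m`) is `e > 0` null steps in a direction
`r ≠ m + 2` above a ◇-letter `y`, then `y` is charged, on the line of `x` (same causal top), `2e` node levels deeper. -/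
theorem lineChild_of_ray {x y : BPoint} {m r : Fin 4} {e : ℤ} (hxax : x.2 = (0, 0) ∨ AxisPt x) (hna : x.2 ≠ (0, 0))
    (hm : Adapted x m) (hm0 : coord x m = x.1 - absCharge x) (hr : r ≠ m + 2) (he : 0 < e) (hxy : x = ray y r e)
    (hyax : y.2 = (0, 0) ∨ AxisPt y) (hy : absCharge y ≤ y.1) :
    y.2 ≠ (0, 0) ∧ causalTop y = causalTop x ∧ nodeLevel y + 2 * e = nodeLevel x := by
  obtain ⟨α, a, b⟩ := y
  subst hxy
  simp only [causalTop, nodeLevel, absCharge, chargeOf, coord, AxisPt, Adapted, Prod.mk.injEq, ne_eq] at *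
  fin_cases m <;> fin_cases r <;> simp at hxax hna hm hm0 hr hyax hy ⊢ <;>
    (simp only [abs_eq_max_neg, max_def] at *; split_ifs at * <;> omega)

/-- **the TOP RAISE**: `e > 0` null steps from a charged μ₄ letter `x` in its TOP direction `k` (adapted, `coord x k = top`) give a charged letter with the
same node level and charge `+e`. -/
theorem topRaise_of_ray {x y : BPoint} {k : Fin 4} {e : ℤ} (hxax : x.2 = (0, 0) ∨ AxisPt x) (hna : x.2 ≠ (0, 0)) (hk : Adapted x k)
    (hk0 : coord x k = x.1 + absCharge x) (he : 0 < e) (hy : y = ray x k e) :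
    y.2 ≠ (0, 0) ∧ nodeLevel y = nodeLevel x ∧ absCharge y = absCharge x + e := by
  obtain ⟨α, a, b⟩ := x
  subst hy
  simp only [nodeLevel, absCharge, chargeOf, coord, AxisPt, Adapted, Prod.mk.injEq, ne_eq] at *
  fin_cases k <;> simp at hxax hna hk hk0 ⊢ <;> (simp only [abs_eq_max_neg, max_def] at *; split_ifs at * <;> omega)

/-- **the APEX LOWERING**: if the apex `aI` is `d > 0` null steps (any direction) above `y`, then `y` is charged with causal top `a` and charge `d`. -/
theorem apexLower_of_ray {a : ℤ} {y : BPoint} {r : Fin 4} {d : ℤ} (hd : 0 < d) (hy : ((a, 0, 0) : BPoint) = ray y r d) :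
    y.2 ≠ (0, 0) ∧ causalTop y = a ∧ absCharge y = d := by
  obtain ⟨α, p, q⟩ := y
  simp only [causalTop, absCharge, chargeOf, ne_eq, Prod.mk.injEq]
  fin_cases r <;> simp [ray, Prod.ext_iff] at hy ⊢ <;> (simp only [abs_eq_max_neg, max_def] at *; split_ifs at * <;> omega)

/-- **the APEX RAISE**: `d ≥ 0` null steps up from an apex carry charge `d`. -/
theorem absCharge_ray_apex (a : ℤ) (m : Fin 4) {d : ℤ} (hd : 0 ≤ d) : absCharge (ray ((a, 0, 0) : BPoint) m d) = d := by
  have h1 := top_ray_apex a m hd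
  have h2 := nodeLevel_ray_apex a m hd
  unfold nodeLevel at h2
  omega

/-- (restated from `DiamondUpFacts` v4, g12) the two coordinates of a frame sum to `2α` … -/
theorem coord_add_coord_add_two (x : BPoint) (m : Fin 4) : coord x m + coord x (m + 2) = 2 * x.1 := by
  fin_cases m <;> simp [coord] <;> ring

/-- (restated) … and adaptedness is a property of the frame `{m, m+2}`. -/
theorem adapted_add_two {x : BPoint} {m : Fin 4} (hm : Adapted x m) : Adapted x (m + 2) := by
  fin_cases m <;> simpa [Adapted] using hm

/-- every μ₄ letter has a TOP direction: an adapted coordinate of value `α + |c|`. -/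
theorem exists_top_dir {x : BPoint} (hxax : x.2 = (0, 0) ∨ AxisPt x) : ∃ k : Fin 4, Adapted x k ∧ coord x k = x.1 + absCharge x := by
  obtain ⟨m, hm, hm0⟩ := exists_node_dir hxax
  exact ⟨m + 2, adapted_add_two hm, by have := coord_add_coord_add_two x m; omega⟩

/-! ## §3 The `N`-side edges: RULE D below a non-seed `N`-cell produces a `P`-cell of larger total charge with the same tops -/

/-- the KILL HYPOTHESIS below the `N`-cell `Z` with count floor `n`: no `P`-cell of `C` with ≥ `n` charged letters, the same causal tops slotwise, and
strictly larger total charge.  (In the induction it is discharged by the induction hypothesis: such a `P`-cell is non-level iff `Z` is.) -/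
def KillBelow (C : MConfig) (Z : MCell) (n : ℕ) : Prop :=
  ∀ P ∈ C.upper, n ≤ chargeCount P → (∀ f, causalTop (P f) = causalTop (Z f)) → totalCharge Z < totalCharge P → False

/-- a charged letter of `Z` settled below off its top ray: the server is a LINE CHILD — same count, same tops, larger `Q`. -/
theorem lineKill {h : ℤ} {C : MConfig} (hU : C.InDiamond h) {Z P : MCell} (hZ : Z ∈ C.lower) (hP : P ∈ C.upper) {g : Fin 4}
    (hgc : (Z g).2 ≠ (0, 0)) {m r : Fin 4} (hm : Adapted (Z g) m) (hm0 : coord (Z g) m = (Z g).1 - absCharge (Z g)) (hr : r ≠ m + 2)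
    (hag : MAgree P Z g) (hlt : (P g).1 < (Z g).1) (hray : Z g = ray (P g) r ((Z g).1 - (P g).1)) {n : ℕ} (hn : n ≤ chargeCount Z)
    (hK : KillBelow C Z n) : False := by
  obtain ⟨hc, ht, -⟩ := lineChild_of_ray (hU.1 Z hZ g).1 hgc hm hm0 hr (by omega) hray (hU.2 P hP g).1 (hU.2 P hP g).2.1
  refine hK P hP (hn.trans (chargeCount_mono fun f hf => ?_)) (fun f => ?_) (totalCharge_lt (fun f => ?_) g ?_)
  · by_cases hfg : f = g
    · subst hfg; exact hc
    · rw [hag f hfg]; exact hf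
  · by_cases hfg : f = g
    · subst hfg; exact ht
    · rw [hag f hfg]
  · by_cases hfg : f = g
    · subst hfg; unfold causalTop at ht; omega
    · exact le_of_eq (by rw [hag f hfg])
  · unfold causalTop at ht; omega

/-- an apex letter of `Z` served below (any direction): the server is an APEX LOWERING — count `+1`, same tops, larger `Q`. -/
theorem apexKillBelow {h : ℤ} {C : MConfig} (hU : C.InDiamond h) {Z P : MCell} (hZ : Z ∈ C.lower) (hP : P ∈ C.upper) {g : Fin 4}
    (hg0 : (Z g).2 = (0, 0)) {r : Fin 4} (hag : MAgree P Z g) (hlt : (P g).1 < (Z g).1) (hray : Z g = ray (P g) r ((Z g).1 - (P g).1))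
    {n : ℕ} (hn : n ≤ chargeCount Z + 1) (hK : KillBelow C Z n) : False := by
  have _hZ := hZ; have _hU := hU
  have hap : isApex (Z g) := (isApex_iff_snd _).2 hg0
  have hray' : (((Z g).1, 0, 0) : BPoint) = ray (P g) r ((Z g).1 - (P g).1) := by rw [← eq_of_isApex hap]; exact hray
  obtain ⟨hc, ht, hq⟩ := apexLower_of_ray (by omega) hray'
  have ha0 : absCharge (Z g) = 0 := absCharge_of_uncharged hg0
  refine hK P hP (hn.trans (le_of_eq (chargeCount_agree_succ hag hg0 hc).symm)) (fun f => ?_) (totalCharge_lt (fun f => ?_) g ?_)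
  · by_cases hfg : f = g
    · subst hfg; rw [ht]; unfold causalTop; omega
    · rw [hag f hfg]
  · by_cases hfg : f = g
    · subst hfg; rw [ha0, hq]; omega
    · exact le_of_eq (by rw [hag f hfg])
  · rw [ha0, hq]; omega

/-- **EDGE (tt)**: two charged letters of DISTINCT node levels.  RULE D at the pair of node coordinates: a line child at either letter, or a cover lowering
both along their lines — each killed by `KillBelow C Z (chargeCount Z)`. -/
theorem edge_tt {h : ℤ} {C : MConfig} (hU : C.InDiamond h) {Z : MCell} (hZ : Z ∈ C.lower) (hD : RuleDMu4N C Z) {g j : Fin 4} (hgj : g ≠ j)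
    (hgc : (Z g).2 ≠ (0, 0)) (hjc : (Z j).2 ≠ (0, 0)) (hne : nodeLevel (Z g) ≠ nodeLevel (Z j)) (hK : KillBelow C Z (chargeCount Z)) : False := by
  obtain ⟨m, hm, hm0⟩ := exists_node_dir (hU.1 Z hZ g).1
  obtain ⟨m', hm', hm0'⟩ := exists_node_dir (hU.1 Z hZ j).1
  have hne' : coord (Z g) m ≠ coord (Z j) m' := by unfold nodeLevel at hne; rwa [hm0, hm0']
  rcases hD g j hgj m m' hm hm' hne' with ⟨r, hr, P, hP, hag, hlt, hray⟩ | ⟨r, hr, P, hP, hag, hlt, hray⟩ |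
      ⟨a, b, ha, hb, P, hP, hag2, hlt1, hray1, hlt2, hray2⟩
  · exact lineKill hU hZ hP hgc hm hm0 hr hag hlt hray le_rfl hK
  · exact lineKill hU hZ hP hjc hm' hm0' hr hag hlt hray le_rfl hK
  · have ha' : a = m := ha.elim id fun h' => absurd h'.1 (not_isApex_of_snd_ne hgc)
    have hb' : b = m' := hb.elim id fun h' => absurd h'.1 (not_isApex_of_snd_ne hjc)
    rw [ha'] at hray1
    rw [hb'] at hray2
    obtain ⟨hc1, ht1, -⟩ := lineChild_of_ray (hU.1 Z hZ g).1 hgc hm hm0 (fin4_ne_add_two m) (by omega) hray1 (hU.2 P hP g).1 (hU.2 P hP g).2.1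
    obtain ⟨hc2, ht2, -⟩ := lineChild_of_ray (hU.1 Z hZ j).1 hjc hm' hm0' (fin4_ne_add_two m') (by omega) hray2 (hU.2 P hP j).1 (hU.2 P hP j).2.1
    refine hK P hP (chargeCount_mono fun f hf => ?_) (fun f => ?_) (totalCharge_lt (fun f => ?_) g ?_)
    · by_cases hfg : f = g
      · subst hfg; exact hc1
      · by_cases hfj : f = j
        · subst hfj; exact hc2
        · rw [hag2 f hfg hfj]; exact hf
    · by_cases hfg : f = g
      · subst hfg; exact ht1
      · by_cases hfj : f = j
        · subst hfj; exact ht2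
        · rw [hag2 f hfg hfj]
    · by_cases hfg : f = g
      · subst hfg; unfold causalTop at ht1; omega
      · by_cases hfj : f = j
        · subst hfj; unfold causalTop at ht2; omega
        · exact le_of_eq (by rw [hag2 f hfg hfj])
    · unfold causalTop at ht1; omega

/-- **EDGE (at)**: an apex letter `aI` at `g` and a charged letter at `j` of node level `≠ a`.  RULE D at (apex coordinate, node coordinate): an apex
lowering at `g`, a line child at `j`, or a cover doing both — each killed by `KillBelow C Z (chargeCount Z)`. -/
theorem edge_at {h : ℤ} {C : MConfig} (hU : C.InDiamond h) {Z : MCell} (hZ : Z ∈ C.lower) (hD : RuleDMu4N C Z) {g j : Fin 4}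
    (hg0 : (Z g).2 = (0, 0)) (hjc : (Z j).2 ≠ (0, 0)) (hne : (Z g).1 ≠ nodeLevel (Z j)) (hK : KillBelow C Z (chargeCount Z)) : False := by
  have hgj : g ≠ j := fun e => hjc (by rw [← e]; exact hg0)
  have hap : isApex (Z g) := (isApex_iff_snd _).2 hg0
  obtain ⟨m', hm', hm0'⟩ := exists_node_dir (hU.1 Z hZ j).1
  have hne' : coord (Z g) m' ≠ coord (Z j) m' := by rw [coord_of_isApex hap, hm0']; unfold nodeLevel at hne; exact hne
  rcases hD g j hgj m' m' (adapted_of_isApex hap m') hm' hne' with ⟨r, -, P, hP, hag, hlt, hray⟩ | ⟨r, hr, P, hP, hag, hlt, hray⟩ |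
      ⟨a, b, -, hb, P, hP, hag2, hlt1, hray1, hlt2, hray2⟩
  · exact apexKillBelow hU hZ hP hg0 hag hlt hray (Nat.le_succ _) hK
  · exact lineKill hU hZ hP hjc hm' hm0' hr hag hlt hray le_rfl hK
  · have hb' : b = m' := hb.elim id fun h' => absurd h'.1 (not_isApex_of_snd_ne hjc)
    rw [hb'] at hray2
    have hray1' : (((Z g).1, 0, 0) : BPoint) = ray (P g) a ((Z g).1 - (P g).1) := by rw [← eq_of_isApex hap]; exact hray1
    obtain ⟨hc1, ht1, hq1⟩ := apexLower_of_ray (by omega) hray1'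
    obtain ⟨hc2, ht2, -⟩ := lineChild_of_ray (hU.1 Z hZ j).1 hjc hm' hm0' (fin4_ne_add_two m') (by omega) hray2 (hU.2 P hP j).1 (hU.2 P hP j).2.1
    have ha0 : absCharge (Z g) = 0 := absCharge_of_uncharged hg0
    refine hK P hP (chargeCount_mono fun f hf => ?_) (fun f => ?_) (totalCharge_lt (fun f => ?_) g ?_)
    · by_cases hfg : f = g
      · subst hfg; exact hc1
      · by_cases hfj : f = j
        · subst hfj; exact hc2
        · rw [hag2 f hfg hfj]; exact hf
    · by_cases hfg : f = g
      · subst hfg; rw [ht1]; unfold causalTop; omega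
      · by_cases hfj : f = j
        · subst hfj; exact ht2
        · rw [hag2 f hfg hfj]
    · by_cases hfg : f = g
      · subst hfg; rw [ha0, hq1]; omega
      · by_cases hfj : f = j
        · subst hfj; unfold causalTop at ht2; omega
        · exact le_of_eq (by rw [hag2 f hfg hfj])
    · rw [ha0, hq1]; omega

/-- **EDGE (aa)**: two apex letters of DISTINCT levels.  RULE D at the two apex coordinates: apex lowerings (count `+1` or `+2`) — killed by
`KillBelow C Z (chargeCount Z + 1)`. -/
theorem edge_aa {h : ℤ} {C : MConfig} (hU : C.InDiamond h) {Z : MCell} (hZ : Z ∈ C.lower) (hD : RuleDMu4N C Z) {g j : Fin 4} (hgj : g ≠ j)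
    (hg0 : (Z g).2 = (0, 0)) (hj0 : (Z j).2 = (0, 0)) (hne : (Z g).1 ≠ (Z j).1) (hK : KillBelow C Z (chargeCount Z + 1)) : False := by
  have hapg : isApex (Z g) := (isApex_iff_snd _).2 hg0
  have hapj : isApex (Z j) := (isApex_iff_snd _).2 hj0
  have hne' : coord (Z g) 0 ≠ coord (Z j) 0 := by rw [coord_of_isApex hapg, coord_of_isApex hapj]; exact hne
  rcases hD g j hgj 0 0 (adapted_of_isApex hapg 0) (adapted_of_isApex hapj 0) hne' with ⟨r, -, P, hP, hag, hlt, hray⟩ |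
      ⟨r, -, P, hP, hag, hlt, hray⟩ | ⟨a, b, -, -, P, hP, hag2, hlt1, hray1, hlt2, hray2⟩
  · exact apexKillBelow hU hZ hP hg0 hag hlt hray le_rfl hK
  · exact apexKillBelow hU hZ hP hj0 hag hlt hray le_rfl hK
  · have hray1' : (((Z g).1, 0, 0) : BPoint) = ray (P g) a ((Z g).1 - (P g).1) := by rw [← eq_of_isApex hapg]; exact hray1
    have hray2' : (((Z j).1, 0, 0) : BPoint) = ray (P j) b ((Z j).1 - (P j).1) := by rw [← eq_of_isApex hapj]; exact hray2
    obtain ⟨hc1, ht1, hq1⟩ := apexLower_of_ray (by omega) hray1'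
    obtain ⟨hc2, ht2, hq2⟩ := apexLower_of_ray (by omega) hray2'
    have ha0 : absCharge (Z g) = 0 := absCharge_of_uncharged hg0
    have hb0 : absCharge (Z j) = 0 := absCharge_of_uncharged hj0
    refine hK P hP (chargeCount_strictMono (fun f hf => ?_) hg0 hc1) (fun f => ?_) (totalCharge_lt (fun f => ?_) g ?_)
    · by_cases hfg : f = g
      · subst hfg; exact hc1
      · by_cases hfj : f = j
        · subst hfj; exact hc2
        · rw [hag2 f hfg hfj]; exact hf
    · by_cases hfg : f = g
      · subst hfg; rw [ht1]; unfold causalTop; omega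
      · by_cases hfj : f = j
        · subst hfj; rw [ht2]; unfold causalTop; omega
        · rw [hag2 f hfg hfj]
    · by_cases hfg : f = g
      · subst hfg; rw [ha0, hq1]; omega
      · by_cases hfj : f = j
        · subst hfj; rw [hb0, hq2]; omega
        · exact le_of_eq (by rw [hag2 f hfg hfj])
    · rw [ha0, hq1]; omega

/-- **EDGE (at-floor)** (cf. (K8b) of `DiamondUpFacts`): an apex letter `aI`, `a ≠ 0`, and a charged FLOOR letter.  RULE D at (apex coordinate, node
coordinate `0`): the floor letter cannot be lowered off its top ray inside ◇, so an apex lowering results — killed by `KillBelow C Z (chargeCount Z + 1)`. -/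
theorem edge_at_floor {h : ℤ} {C : MConfig} (hU : C.InDiamond h) {Z : MCell} (hZ : Z ∈ C.lower) (hD : RuleDMu4N C Z) {g j : Fin 4}
    (hg0 : (Z g).2 = (0, 0)) (hjc : (Z j).2 ≠ (0, 0)) (hj0 : nodeLevel (Z j) = 0) (hne : (Z g).1 ≠ 0)
    (hK : KillBelow C Z (chargeCount Z + 1)) : False := by
  have hgj : g ≠ j := fun e => hjc (by rw [← e]; exact hg0)
  have hap : isApex (Z g) := (isApex_iff_snd _).2 hg0
  obtain ⟨m', hm', hm0'⟩ := exists_node_dir (hU.1 Z hZ j).1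
  have hfl : OnFloor (Z j) := by unfold nodeLevel at hj0; show (Z j).1 = absCharge (Z j); omega
  have hm0'' : coord (Z j) m' = 0 := by rw [hm0']; unfold nodeLevel at hj0; exact hj0
  have hne' : coord (Z g) m' ≠ coord (Z j) m' := by rw [coord_of_isApex hap, hm0'']; exact hne
  rcases hD g j hgj m' m' (adapted_of_isApex hap m') hm' hne' with ⟨r, -, P, hP, hag, hlt, hray⟩ | ⟨r, hr, P, hP, -, hlt, hray⟩ |
      ⟨a, b, -, hb, P, hP, -, -, -, hlt2, hray2⟩
  · exact apexKillBelow hU hZ hP hg0 hag hlt hray le_rfl hK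
  · exact (not_inDiamond_below_offtop hfl (hU.1 Z hZ j).1 hm' hm0'' hr (by omega) hray (hU.2 P hP j).1 (hU.2 P hP j).2.1).elim
  · have hb' : b = m' := hb.elim id fun h' => absurd h'.1 (not_isApex_of_snd_ne hjc)
    rw [hb'] at hray2
    exact (not_inDiamond_below_offtop hfl (hU.1 Z hZ j).1 hm' hm0'' (fin4_ne_add_two m') (by omega) hray2 (hU.2 P hP j).1
      (hU.2 P hP j).2.1).elim

/-! ## §4 The `P`-side edges: RULE D above a non-high `P`-cell produces an `N`-cell of larger total charge with the same charged nodes -/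

/-- the KILL HYPOTHESIS above the `P`-cell `P`: no `N`-cell of `C` with at least as many charged letters, every charged letter of `P` still charged with
the same node level, and strictly larger total charge.  (Discharged in the induction by the induction hypothesis if the child is non-level, and by the
charge-depth inequality (CD-N) if it is level — this is where non-HIGH-ness is used.) -/
def KillAbove (C : MConfig) (P : MCell) : Prop :=
  ∀ N ∈ C.lower, chargeCount P ≤ chargeCount N → (∀ f, (P f).2 ≠ (0, 0) → (N f).2 ≠ (0, 0) ∧ nodeLevel (N f) = nodeLevel (P f)) →
    totalCharge P < totalCharge N → False

/-- a charged letter of `P` settled above off its node ray: the server is a TOP RAISE — same count, same nodes, larger `Q`. -/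
theorem topKill {h : ℤ} {C : MConfig} (hU : C.InDiamond h) {P N : MCell} (hP : P ∈ C.upper) (hN : N ∈ C.lower) {f : Fin 4}
    (hfc : (P f).2 ≠ (0, 0)) {k r : Fin 4} (hk : Adapted (P f) k) (hk0 : coord (P f) k = (P f).1 + absCharge (P f)) (hr : r ≠ k + 2)
    (hag : MAgree P N f) (hlt : (P f).1 < (N f).1) (hray : N f = ray (P f) r ((N f).1 - (P f).1)) (hK : KillAbove C P) : False := by
  have hrk : r = k :=
    (ray_dir_of_adapted (hU.2 P hP f).1 (not_isApex_of_snd_ne hfc) hk (by omega) hray (hU.1 N hN f).1).resolve_right hr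
  rw [hrk] at hray
  obtain ⟨hc, hn, hq⟩ := topRaise_of_ray (hU.2 P hP f).1 hfc hk hk0 (by omega) hray
  refine hK N hN (chargeCount_mono fun f' hf' => ?_) (fun f' hf' => ?_) (totalCharge_lt (fun f' => ?_) f ?_)
  · by_cases e : f' = f
    · subst e; exact hc
    · rw [← hag f' e]; exact hf'
  · by_cases e : f' = f
    · subst e; exact ⟨hc, hn⟩
    · rw [← hag f' e]; exact ⟨hf', rfl⟩
  · by_cases e : f' = f
    · subst e; rw [hq]; omega
    · exact le_of_eq (by rw [hag f' e])
  · rw [hq]; omega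

/-- an apex letter of `P` served above (any direction): the server is an APEX RAISE — count `+1`, charged nodes kept, larger `Q`. -/
theorem apexKillAbove {h : ℤ} {C : MConfig} (hU : C.InDiamond h) {P N : MCell} (hP : P ∈ C.upper) (hN : N ∈ C.lower) {g : Fin 4}
    (hg0 : (P g).2 = (0, 0)) {r : Fin 4} (hag : MAgree P N g) (hlt : (P g).1 < (N g).1) (hray : N g = ray (P g) r ((N g).1 - (P g).1))
    (hK : KillAbove C P) : False := by
  have _h := hU; have _hP := hP
  have hap : isApex (P g) := (isApex_iff_snd _).2 hg0
  obtain ⟨d, hd⟩ : ∃ d : ℤ, d = (N g).1 - (P g).1 := ⟨_, rfl⟩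
  rw [← hd] at hray
  rw [eq_of_isApex hap] at hray
  have hc : (N g).2 ≠ (0, 0) := by rw [hray]; exact snd_ne_ray_apex _ _ (by omega)
  have hq : absCharge (N g) = d := by rw [hray]; exact absCharge_ray_apex _ _ (by omega)
  have ha0 : absCharge (P g) = 0 := absCharge_of_uncharged hg0
  refine hK N hN (chargeCount_mono fun f' hf' => ?_) (fun f' hf' => ?_) (totalCharge_lt (fun f' => ?_) g ?_)
  · by_cases e : f' = g
    · subst e; exact hc
    · rw [← hag f' e]; exact hf'
  · by_cases e : f' = g
    · subst e; exact absurd hg0 hf'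
    · rw [← hag f' e]; exact ⟨hf', rfl⟩
  · by_cases e : f' = g
    · subst e; rw [ha0, hq]; omega
    · exact le_of_eq (by rw [hag f' e])
  · rw [ha0, hq]; omega

/-- **EDGE (AA)**: two charged letters of DISTINCT causal tops.  RULE D at the pair of top coordinates: top raises (or a cover raising both) — each killed by
`KillAbove C P`. -/
theorem edge_AA {h : ℤ} {C : MConfig} (hU : C.InDiamond h) {P : MCell} (hP : P ∈ C.upper) (hD : RuleDMu4P C P) {f g : Fin 4} (hfg : f ≠ g)
    (hfc : (P f).2 ≠ (0, 0)) (hgc : (P g).2 ≠ (0, 0)) (hne : causalTop (P f) ≠ causalTop (P g)) (hK : KillAbove C P) : False := by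
  obtain ⟨k, hk, hk0⟩ := exists_top_dir (hU.2 P hP f).1
  obtain ⟨k', hk', hk0'⟩ := exists_top_dir (hU.2 P hP g).1
  have hne' : coord (P f) k ≠ coord (P g) k' := by unfold causalTop at hne; rwa [hk0, hk0']
  rcases hD f g hfg k k' hk hk' hne' with ⟨r, hr, N, hN, hag, hlt, hray⟩ | ⟨r, hr, N, hN, hag, hlt, hray⟩ |
      ⟨a, b, ha, hb, N, hN, hag2, hlt1, hray1, hlt2, hray2⟩
  · exact topKill hU hP hN hfc hk hk0 hr hag hlt hray hK
  · exact topKill hU hP hN hgc hk' hk0' hr hag hlt hray hK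
  · have ha' : a = k := ha.elim id fun h' => absurd h'.1 (not_isApex_of_snd_ne hfc)
    have hb' : b = k' := hb.elim id fun h' => absurd h'.1 (not_isApex_of_snd_ne hgc)
    rw [ha'] at hray1
    rw [hb'] at hray2
    obtain ⟨hc1, hn1, hq1⟩ := topRaise_of_ray (hU.2 P hP f).1 hfc hk hk0 (by omega) hray1
    obtain ⟨hc2, hn2, hq2⟩ := topRaise_of_ray (hU.2 P hP g).1 hgc hk' hk0' (by omega) hray2
    refine hK N hN (chargeCount_mono fun f' hf' => ?_) (fun f' hf' => ?_) (totalCharge_lt (fun f' => ?_) f ?_)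
    · by_cases e : f' = f
      · subst e; exact hc1
      · by_cases e' : f' = g
        · subst e'; exact hc2
        · rw [hag2 f' e e']; exact hf'
    · by_cases e : f' = f
      · subst e; exact ⟨hc1, hn1⟩
      · by_cases e' : f' = g
        · subst e'; exact ⟨hc2, hn2⟩
        · rw [hag2 f' e e']; exact ⟨hf', rfl⟩
    · by_cases e : f' = f
      · subst e; rw [hq1]; omega
      · by_cases e' : f' = g
        · subst e'; rw [hq2]; omega
        · exact le_of_eq (by rw [hag2 f' e e'])
    · rw [hq1]; omega

/-- **EDGE (Aa)**: a charged letter at `f` and an apex `aI` at `g` with `top(f) ≠ a`.  RULE D at (top coordinate, apex coordinate): a top raise at `f`, an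
apex raise at `g`, or a cover doing both — each killed by `KillAbove C P`. -/
theorem edge_Aa {h : ℤ} {C : MConfig} (hU : C.InDiamond h) {P : MCell} (hP : P ∈ C.upper) (hD : RuleDMu4P C P) {f g : Fin 4}
    (hfc : (P f).2 ≠ (0, 0)) (hg0 : (P g).2 = (0, 0)) (hne : causalTop (P f) ≠ (P g).1) (hK : KillAbove C P) : False := by
  have hfg : f ≠ g := fun e => hfc (by rw [e]; exact hg0)
  have hap : isApex (P g) := (isApex_iff_snd _).2 hg0
  obtain ⟨k, hk, hk0⟩ := exists_top_dir (hU.2 P hP f).1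
  have hne' : coord (P f) k ≠ coord (P g) k := by rw [hk0, coord_of_isApex hap]; unfold causalTop at hne; exact hne
  rcases hD f g hfg k k hk (adapted_of_isApex hap k) hne' with ⟨r, hr, N, hN, hag, hlt, hray⟩ | ⟨r, -, N, hN, hag, hlt, hray⟩ |
      ⟨a, b, ha, -, N, hN, hag2, hlt1, hray1, hlt2, hray2⟩
  · exact topKill hU hP hN hfc hk hk0 hr hag hlt hray hK
  · exact apexKillAbove hU hP hN hg0 hag hlt hray hK
  · have ha' : a = k := ha.elim id fun h' => absurd h'.1 (not_isApex_of_snd_ne hfc)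
    rw [ha'] at hray1
    obtain ⟨hc1, hn1, hq1⟩ := topRaise_of_ray (hU.2 P hP f).1 hfc hk hk0 (by omega) hray1
    obtain ⟨d, hd⟩ : ∃ d : ℤ, d = (N g).1 - (P g).1 := ⟨_, rfl⟩
    rw [← hd] at hray2
    rw [eq_of_isApex hap] at hray2
    have hc2 : (N g).2 ≠ (0, 0) := by rw [hray2]; exact snd_ne_ray_apex _ _ (by omega)
    have hq2 : absCharge (N g) = d := by rw [hray2]; exact absCharge_ray_apex _ _ (by omega)
    have ha0 : absCharge (P g) = 0 := absCharge_of_uncharged hg0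
    refine hK N hN (chargeCount_mono fun f' hf' => ?_) (fun f' hf' => ?_) (totalCharge_lt (fun f' => ?_) f ?_)
    · by_cases e : f' = f
      · subst e; exact hc1
      · by_cases e' : f' = g
        · subst e'; exact hc2
        · rw [hag2 f' e e']; exact hf'
    · by_cases e : f' = f
      · subst e; exact ⟨hc1, hn1⟩
      · by_cases e' : f' = g
        · subst e'; exact absurd hg0 hf'
        · rw [hag2 f' e e']; exact ⟨hf', rfl⟩
    · by_cases e : f' = f
      · subst e; rw [hq1]; omega
      · by_cases e' : f' = g
        · subst e'; rw [ha0, hq2]; omega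
        · exact le_of_eq (by rw [hag2 f' e e'])
    · rw [hq1]; omega

/-! ## §5 THE CHARGE INDUCTION -/

/-- **THE CHARGE INDUCTION** (KERNEL, h-uniform): in a RULE-D-closed configuration in ◇_h obeying the charge-depth inequalities, the seed laws (SN), (SP)
imply the partial level laws (LVN), (LVP3).  Induction downward in the total charge `Q ≤ 2h` (measure `2h − Q ≤ n`), jointly for `N`- and `P`-cells:
a non-level non-seed cell has a RULE-D edge (§3, §4) all of whose outcomes are non-level law-class cells of larger `Q` (absent by induction) or — on the
`P`-side — level `N`-cells violating (CD-N) at a non-high letter. -/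
theorem levelLocal_induction {h : ℤ} {C : MConfig} (hU : C.InDiamond h) (hD : RuleDMu4Closed C) (hCD : CDIneq C) (hSN : SeedNLocal C)
    (hSP : SeedPLocal C) (n : ℕ) :
    (∀ Z ∈ C.lower, 2 * h - totalCharge Z ≤ n → 2 ≤ chargeCount Z → LevelCell Z) ∧
      (∀ P ∈ C.upper, 2 * h - totalCharge P ≤ n → 3 ≤ chargeCount P → LevelCell P) := by
  induction n using Nat.strong_induction_on with
  | _ n IH =>
  refine ⟨fun Z hZ hμ h2 => ?_, fun P hP hμ h3 => ?_⟩
  · by_contra hnl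
    -- the induction hypothesis kills every same-tops `P`-child of larger total charge with ≥ 3 charged letters
    have hKill : ∀ P ∈ C.upper, 3 ≤ chargeCount P → (∀ f, causalTop (P f) = causalTop (Z f)) → totalCharge Z < totalCharge P → False := by
      intro P hP hP3 htops hQ
      have hQP := totalCharge_le_of_inDiamond (hU.2 P hP)
      have hn1 : n - 1 < n := by omega
      have hPl : LevelCell P := (IH (n - 1) hn1).2 P hP (by omega) hP3
      exact hnl fun f f' => by rw [← htops f, ← htops f']; exact hPl f f'
    have hK1 : KillBelow C Z (chargeCount Z + 1) := fun P hP hcnt htops hQ => hKill P hP (by omega) htops hQ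
    rcases Nat.lt_or_ge 2 (chargeCount Z) with h3 | hle2
    · -- at least three charged letters: not node-flat, so an edge (tt) or (at) exists
      have hK : KillBelow C Z (chargeCount Z) := fun P hP hcnt htops hQ => hKill P hP (by omega) htops hQ
      have hnf : ¬ NodeFlat Z := fun hF => hnl (hSN Z hZ h2 (Or.inl hF))
      obtain ⟨f, g, hfg'⟩ : ∃ f g, nodeLevel (Z f) ≠ nodeLevel (Z g) := by
        by_contra hall; push Not at hall; exact hnf hall
      have hfg : f ≠ g := fun e => hfg' (by rw [e])
      by_cases hf0 : (Z f).2 = (0, 0)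
      · by_cases hg0 : (Z g).2 = (0, 0)
        · exact charged_of_three h3 hg0 hfg hf0
        · exact edge_at hU hZ (hD.1 Z hZ) hf0 hg0 (by rw [← nodeLevel_of_uncharged hf0]; exact hfg') hK
      · by_cases hg0 : (Z g).2 = (0, 0)
        · exact edge_at hU hZ (hD.1 Z hZ) hg0 hf0 (by rw [← nodeLevel_of_uncharged hg0]; exact fun e => hfg' e.symm) hK
        · exact edge_tt hU hZ (hD.1 Z hZ) hfg hf0 hg0 hfg' hK
    · -- exactly two charged letters: not twin-apex, so an edge (aa) or (at-floor) exists
      have hns : ¬ TwinApex2 Z := fun hT => hnl (hSN Z hZ h2 (Or.inr hT))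
      by_cases hB : ∀ f g, (Z f).2 = (0, 0) → (Z g).2 = (0, 0) → (Z f).1 = (Z g).1
      · have hC : ¬ ∀ f g, (Z f).2 = (0, 0) → (Z g).2 ≠ (0, 0) → nodeLevel (Z g) = 0 → (Z f).1 = 0 := fun hC => hns ⟨hle2, hB, hC⟩
        push Not at hC
        obtain ⟨f, g, hf0, hgc, hg0n, hfne⟩ := hC
        exact edge_at_floor hU hZ (hD.1 Z hZ) hf0 hgc hg0n hfne hK1
      · push Not at hB
        obtain ⟨f, g, hf0, hg0, hne⟩ := hB
        have hfg : f ≠ g := fun e => hne (by rw [e])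
        exact edge_aa hU hZ (hD.1 Z hZ) hfg hf0 hg0 hne hK1
  · by_contra hnl
    have hnh : ¬ HighP P := fun hH => hnl (hSP P hP h3 hH)
    obtain ⟨f₀, hf₀c, hlt₀⟩ : ∃ f₀, (P f₀).2 ≠ (0, 0) ∧ nodeLevel (P f₀) < 2 * (chargeCount P : ℤ) := by
      by_contra hall; push Not at hall; exact hnh hall
    -- the kill hypothesis above: non-level children by induction, level children by (CD-N) at the slot f₀
    have hK : KillAbove C P := by
      intro N hN hcnt hnodes hQ
      by_cases hNl : LevelCell N
      · have h1 := hCD.2 N hN hNl f₀ (hnodes f₀ hf₀c).1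
        rw [(hnodes f₀ hf₀c).2] at h1
        have h2 : (chargeCount P : ℤ) ≤ chargeCount N := by exact_mod_cast hcnt
        omega
      · have hQN := totalCharge_le_of_inDiamond (hU.1 N hN)
        have hn1 : n - 1 < n := by omega
        exact hNl ((IH (n - 1) hn1).1 N hN (by omega) (by omega))
    by_cases hAA : ∃ f g, (P f).2 ≠ (0, 0) ∧ (P g).2 ≠ (0, 0) ∧ causalTop (P f) ≠ causalTop (P g)
    · obtain ⟨f, g, hfc, hgc, hne⟩ := hAA
      exact edge_AA hU hP (hD.2 P hP) (fun e => hne (by rw [e])) hfc hgc hne hK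
    · push Not at hAA
      obtain ⟨g, hg⟩ : ∃ g, causalTop (P g) ≠ causalTop (P f₀) := by
        by_contra hall; push Not at hall; exact hnl fun f f' => by rw [hall f, hall f']
      have hg0 : (P g).2 = (0, 0) := by
        by_contra hgc; exact hg (hAA g f₀ hgc hf₀c)
      exact edge_Aa hU hP (hD.2 P hP) hf₀c hg0 (by rw [← causalTop_of_uncharged hg0]; exact fun e => hg e.symm) hK

/-- **(CD) ∧ (SN) ∧ (SP) ⇒ (LVN) ∧ (LVP3), locally** (KERNEL, every `h`). -/
theorem levelLocal_of_cd_seeds {h : ℤ} {C : MConfig} (hU : C.InDiamond h) (hD : RuleDMu4Closed C) (hCD : CDIneq C) (hSN : SeedNLocal C)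
    (hSP : SeedPLocal C) :
    (∀ Z ∈ C.lower, 2 ≤ chargeCount Z → LevelCell Z) ∧ (∀ P ∈ C.upper, 3 ≤ chargeCount P → LevelCell P) := by
  refine ⟨fun Z hZ h2 => ?_, fun P hP h3 => ?_⟩
  · have h0 := totalCharge_nonneg Z
    exact (levelLocal_induction hU hD hCD hSN hSP (2 * h - totalCharge Z).toNat).1 Z hZ (Int.self_le_toNat _) h2
  · have h0 := totalCharge_nonneg P
    exact (levelLocal_induction hU hD hCD hSN hSP (2 * h - totalCharge P).toNat).2 P hP (Int.self_le_toNat _) h3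

/-- **(LVN_h) ⟸ (CD_h) ∧ (SN_h) ∧ (SP_h)** (KERNEL, every `h`).  (CD_h), (SN_h), (SP_h) are CONJECTURES ∕ census UP-facts, displayed; NOT proved. -/
theorem levelNLaw_of_cd_seeds {h : ℤ} (hCD : ChargeDepthLaw h) (hSN : SeedNLaw h) (hSP : SeedPLaw h) : LevelNLaw h :=
  fun C hU hG hS => (levelLocal_of_cd_seeds hU hS.1 (hCD C hU hG hS) (hSN C hU hG hS) (hSP C hU hG hS)).1

/-- **(LVP3_h) ⟸ (CD_h) ∧ (SN_h) ∧ (SP_h)** (KERNEL, every `h`). -/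
theorem levelP3Law_of_cd_seeds {h : ℤ} (hCD : ChargeDepthLaw h) (hSN : SeedNLaw h) (hSP : SeedPLaw h) : LevelP3Law h :=
  fun C hU hG hS => (levelLocal_of_cd_seeds hU hS.1 (hCD C hU hG hS) (hSN C hU hG hS) (hSP C hU hG hS)).2

/-- **(LV_h) ⟸ (CD_h) ∧ (SN_h) ∧ (SP_h)** (KERNEL). -/
theorem levelLaw_of_cd_seeds {h : ℤ} (hCD : ChargeDepthLaw h) (hSN : SeedNLaw h) (hSP : SeedPLaw h) : LevelLaw h :=
  levelLaw_of_partial (levelNLaw_of_cd_seeds hCD hSN hSP) (levelP3Law_of_cd_seeds hCD hSN hSP)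

/-- **(FD_h) ⟸ (CD_h) ∧ (SN_h) ∧ (SP_h)** (KERNEL). -/
theorem floorDepthLaw_of_cd_seeds {h : ℤ} (hCD : ChargeDepthLaw h) (hSN : SeedNLaw h) (hSP : SeedPLaw h) : FloorDepthLaw h :=
  floorDepthLaw_of_partial_chargeDepth (levelNLaw_of_cd_seeds hCD hSN hSP) (levelP3Law_of_cd_seeds hCD hSN hSP) hCD

/-! ## §6 The LINE theorem is in the kernel: `OddLineFree h` for every `h < 12` -/

/-- `LinePhaseRigidity.OddFCFreeLine h` (effective LINE-`h` supports) gives the tree-vocabulary `OddLineFree h` (◇_h designs on the ceiling line). -/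
theorem oddLineFree_of_oddFCFreeLine {h : ℤ} (H : LinePhaseRigidity.OddFCFreeLine h) : OddLineFree h :=
  fun C hU hN hP hG hD hX => H C (LinePhaseRigidity.lsupport_of_diamond_ceiling hU ⟨hN, hP⟩) hG hD hX

/-- **(OL_h) FOR EVERY `h < 12` IS A KERNEL THEOREM** (`LinePhaseRigidity.oddFCFreeLine_of_lt_twelve`, unit phase rigidity on the line, g9). -/
theorem oddLineFree_of_lt_twelve {h : ℤ} (hh : h < 12) : OddLineFree h :=
  oddLineFree_of_oddFCFreeLine (LinePhaseRigidity.oddFCFreeLine_of_lt_twelve hh)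

theorem oddLineFree_eight : OddLineFree 8 := oddLineFree_of_lt_twelve (by norm_num)

theorem oddLineFree_all_le {h : ℤ} (hh : h < 12) : ∀ h' ≤ h, OddLineFree h' :=
  fun _ hh' => oddLineFree_of_lt_twelve (lt_of_le_of_lt hh' hh)

/-! ## §7 Consequences for (T₈), (DL3), (DL), (T_h≤10) -/

/-- **(T₈) ⟸ (CD₈) ∧ (SN₈) ∧ (SP₈)** (KERNEL glue; `DiamondLevelLaws.seedB1Odd_eight_of_partial_cd` with (LVN₈), (LVP3₈) from the charge induction and
(OL₈) from §6).  The three displayed hypotheses are census UP-facts of ◇₈ (j318002 h8 `a459e02921a60310`: 3 555 + 2 142 + 20 orbits), NOT theorems.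
HC ∕ HC_CM ∕ HC_AV ∕ H2 ∕ (T₈) NOT proved. -/
theorem seedB1Odd_eight_of_cd_seeds (hCD : ChargeDepthLaw 8) (hSN : SeedNLaw 8) (hSP : SeedPLaw 8) : SeedB1OddDiamondG1H1 8 :=
  seedB1Odd_eight_of_partial_cd hCD (levelNLaw_of_cd_seeds hCD hSN hSP) (levelP3Law_of_cd_seeds hCD hSN hSP) oddLineFree_eight

/-- **(DL3_h) ⟸ (CD_h) ∧ (SN_h) ∧ (SP_h) for `h ≤ 10`** (KERNEL; `DiamondLevelLaws.dl3_of_partial_cd_le_ten`). -/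
theorem dl3_of_cd_seeds_le_ten {h : ℤ} (hh : h ≤ 10) (hCD : ChargeDepthLaw h) (hSN : SeedNLaw h) (hSP : SeedPLaw h) : DownLineLaw3 h :=
  dl3_of_partial_cd_le_ten hh hCD (levelNLaw_of_cd_seeds hCD hSN hSP) (levelP3Law_of_cd_seeds hCD hSN hSP)

/-- **(DL_h) ⟸ (CD_h) ∧ (SN_h) ∧ (SP_h) for `h ≤ 10`** (KERNEL). -/
theorem downLineLaw_of_cd_seeds_le_ten {h : ℤ} (hh : h ≤ 10) (hCD : ChargeDepthLaw h) (hSN : SeedNLaw h) (hSP : SeedPLaw h) :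
    DownLineLaw h :=
  downLineLaw_of_partial_cd_le_ten hh hCD (levelNLaw_of_cd_seeds hCD hSN hSP) (levelP3Law_of_cd_seeds hCD hSN hSP)

/-- **(T_h) ⟸ (CD_h) ∧ (SN_h) ∧ (SP_h) ∧ (NS_h) for every `h ≤ 10`** (KERNEL glue onto the master reduction `seedB1Odd_of_level_nest_downLine`; the
down-line laws below `h` by antitonicity, the LINE hypotheses by §6).  In particular **(T₁₀) ⟸ (CD₁₀) ∧ (SN₁₀) ∧ (SP₁₀) ∧ (NS₁₀)** — census sizes
8 622 + 5 664 + 511 orbits of ◇₁₀ (j318002 h10 `74004db439790926`) + the nest UP-fact.  NOT a proof of (T₁₀); HC ∕ HC_CM ∕ HC_AV ∕ H2 NOT proved. -/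
theorem seedB1Odd_of_cd_seeds_nest_le_ten {h : ℤ} (hh : h ≤ 10) (hCD : ChargeDepthLaw h) (hSN : SeedNLaw h) (hSP : SeedPLaw h)
    (hNS : NestLaw h) : SeedB1OddDiamondG1H1 h :=
  seedB1Odd_of_level_nest_downLine (levelLaw_of_cd_seeds hCD hSN hSP) hNS
    (fun h' hh' => downLineLaw_of_cd_seeds_le_ten (hh'.trans hh) (chargeDepthLaw_antitone hh' hCD) (seedNLaw_antitone hh' hSN)
      (seedPLaw_antitone hh' hSP))
    (oddLineFree_all_le (by omega))

theorem seedB1Odd_ten_of_cd_seeds_nest (hCD : ChargeDepthLaw 10) (hSN : SeedNLaw 10) (hSP : SeedPLaw 10) (hNS : NestLaw 10) :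
    SeedB1OddDiamondG1H1 10 :=
  seedB1Odd_of_cd_seeds_nest_le_ten le_rfl hCD hSN hSP hNS


/-! ## §8 (v2) The `N`-half of (CD) is not a seed: (CD-N_h) ⟸ (CD-P_h) ∧ (CDN4_h), by the §3 edges with a (CD-P) kill and no induction

A LEVEL `N`-cell `Z` (all causal tops equal) violating (CD-N) at a charged letter `f₀` (`node f₀ < 2·#charged`) has
* if it has an apex letter `g`: the edge (at) at `(g, f₀)` — the apex level is the common top, `> node f₀`; outcomes: apex lowering (count `+1`, `f₀` kept:
  `node f₀ + 2 < 2·(#+1)`), line lowering of `f₀` (count kept, `node − 2e`), or both — every outcome is a LEVEL `P`-cell violating `2·# − 2 ≤ node`;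
* if all four letters are charged and it is not of seed shape: a letter `f₁` of node `< 6 = 2·4 − 2` and a letter `j` of another node, edge (tt) at
  `(f₁, j)` — every outcome keeps or lowers `f₁` and keeps the count `4`, so violates (CD-P) at `f₁`.
So the (CD-N) inequality follows from the (CD-P) inequality and the seed law for `CDNSeedShape` cells (four charged letters; node-flat, or all nodes `≥ 6`).
Census (j318002): the seed shapes are the 10 bi-flat level shapes `N[tI+cℓ_φ₁|…|tI+cℓ_φ₄]` (`t + 2c ≤ 8`, `t < 8`) × 10 phase patterns = 100 orbits of ◇₈
(peel rounds 7–14), and 206 orbits of ◇₁₀ (14 bi-flat shapes × 10 + 66 level `{6I+2ℓ, 8I+ℓ}` mixtures; rounds 13–25); all dead (UP-facts), NOT theorems. -/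

/-- the (CD-P) KILL below `Z`: no `P`-cell of `C` with the same causal tops slotwise has a charged letter violating `2·#charged − 2 ≤ node`.
For a LEVEL `Z` it follows from the (CD-P) inequalities of `C` alone (`killBelowCD_of_level`). -/
def KillBelowCD (C : MConfig) (Z : MCell) : Prop :=
  ∀ P ∈ C.upper, (∀ f, causalTop (P f) = causalTop (Z f)) → ∀ f, (P f).2 ≠ (0, 0) → nodeLevel (P f) + 2 < 2 * (chargeCount P : ℤ) → False

/-- the `P`-half of `DiamondLevelLaws.CDIneq`: a charged letter of a level `n`-charged `P`-cell has node level `≥ 2n − 2`. -/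
def CDPIneq (C : MConfig) : Prop :=
  ∀ P ∈ C.upper, LevelCell P → ∀ f, (P f).2 ≠ (0, 0) → 2 * (chargeCount P : ℤ) - 2 ≤ nodeLevel (P f)

/-- the SEED SHAPE of the `N`-half of (CD): four charged letters, and node-flat or all node levels `≥ 6`. -/
def CDNSeedShape (Z : MCell) : Prop := chargeCount Z = 4 ∧ (NodeFlat Z ∨ ∀ f, 6 ≤ nodeLevel (Z f))

/-- (CDN4) locally: the (CD-N) inequality `8 ≤ node` for the LEVEL `N`-cells of seed shape. -/
def CDNSeedLocal (C : MConfig) : Prop :=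
  ∀ Z ∈ C.lower, LevelCell Z → CDNSeedShape Z → ∀ f, (Z f).2 ≠ (0, 0) → 2 * (chargeCount Z : ℤ) ≤ nodeLevel (Z f)

/-- **(CD-P_h)** the `P`-half of the charge-depth law (CONJECTURE ∕ census UP-fact at 8, 10: 1 745 ∕ 4 202 dead level `P`-orbits; NOT proved). -/
def ChargeDepthPLaw (h : ℤ) : Prop := ∀ C : MConfig, C.InDiamond h → C.G1Closed → C.StaticH1 → CDPIneq C

/-- **(CDN4_h)** the seed part of the `N`-half of the charge-depth law (CONJECTURE ∕ census UP-fact at 8, 10: 100 ∕ 206 dead orbits; NOT proved). -/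
def CDNSeedLaw (h : ℤ) : Prop := ∀ C : MConfig, C.InDiamond h → C.G1Closed → C.StaticH1 → CDNSeedLocal C

theorem chargeDepthPLaw_antitone {h h' : ℤ} (hh : h ≤ h') (H : ChargeDepthPLaw h') : ChargeDepthPLaw h :=
  fun C hU hG hS => H C (inDiamond_config_mono hh hU) hG hS

theorem cdnSeedLaw_antitone {h h' : ℤ} (hh : h ≤ h') (H : CDNSeedLaw h') : CDNSeedLaw h :=
  fun C hU hG hS => H C (inDiamond_config_mono hh hU) hG hS

/-- (CD) ⇒ (CD-P) (the trivial direction, for the record). -/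
theorem chargeDepthPLaw_of_chargeDepthLaw {h : ℤ} (H : ChargeDepthLaw h) : ChargeDepthPLaw h := fun C hU hG hS => (H C hU hG hS).1

/-- (CD) ⇒ (CDN4) (the trivial direction, for the record). -/
theorem cdnSeedLaw_of_chargeDepthLaw {h : ℤ} (H : ChargeDepthLaw h) : CDNSeedLaw h := fun C hU hG hS Z hZ hl _ => (H C hU hG hS).2 Z hZ hl

/-- below a LEVEL cell the (CD-P) kill holds: a same-tops `P`-cell is level, so it obeys the (CD-P) inequality. -/
theorem killBelowCD_of_level {C : MConfig} (hCDP : CDPIneq C) {Z : MCell} (hZl : LevelCell Z) : KillBelowCD C Z := by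
  intro P hP htops f hfc hlt
  have hPl : LevelCell P := fun a b => by rw [htops a, htops b]; exact hZl a b
  have := hCDP P hP hPl f hfc
  omega

theorem chargeCount_eq_four {Z : MCell} (hall : ∀ f, (Z f).2 ≠ (0, 0)) : chargeCount Z = 4 := by
  unfold chargeCount; rw [Finset.filter_true_of_mem (fun f _ => hall f)]; simp

/-- a charged letter `g` of node `< 2·#` settled below off its top ray: the line child keeps the count and lowers `g` — (CD-P) is violated at `g`. -/
theorem lineKillCD {h : ℤ} {C : MConfig} (hU : C.InDiamond h) {Z P : MCell} (hZ : Z ∈ C.lower) (hP : P ∈ C.upper) {g : Fin 4}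
    (hgc : (Z g).2 ≠ (0, 0)) {m r : Fin 4} (hm : Adapted (Z g) m) (hm0 : coord (Z g) m = (Z g).1 - absCharge (Z g)) (hr : r ≠ m + 2)
    (hag : MAgree P Z g) (hlt : (P g).1 < (Z g).1) (hray : Z g = ray (P g) r ((Z g).1 - (P g).1))
    (hlow : nodeLevel (Z g) < 2 * (chargeCount Z : ℤ)) (hK : KillBelowCD C Z) : False := by
  obtain ⟨hc, ht, hnd⟩ := lineChild_of_ray (hU.1 Z hZ g).1 hgc hm hm0 hr (by omega) hray (hU.2 P hP g).1 (hU.2 P hP g).2.1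
  have hcnt : chargeCount P = chargeCount Z := chargeCount_congr fun f => by
    by_cases hfg : f = g
    · subst hfg; exact ⟨fun _ => hgc, fun _ => hc⟩
    · rw [hag f hfg]
  refine hK P hP (fun f => ?_) g hc ?_
  · by_cases hfg : f = g
    · subst hfg; exact ht
    · rw [hag f hfg]
  · rw [hcnt]; omega

/-- an apex letter `g` served below while a charged letter `j ≠ g` of node `< 2·#` is kept: the apex lowering raises the count by one — (CD-P) is
violated at `j`. -/
theorem apexKillBelowCD {h : ℤ} {C : MConfig} (hU : C.InDiamond h) {Z P : MCell} (hZ : Z ∈ C.lower) (hP : P ∈ C.upper) {g : Fin 4}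
    (hg0 : (Z g).2 = (0, 0)) {r : Fin 4} (hag : MAgree P Z g) (hlt : (P g).1 < (Z g).1) (hray : Z g = ray (P g) r ((Z g).1 - (P g).1))
    {j : Fin 4} (hjg : j ≠ g) (hjc : (Z j).2 ≠ (0, 0)) (hlow : nodeLevel (Z j) < 2 * (chargeCount Z : ℤ)) (hK : KillBelowCD C Z) : False := by
  have _hZ := hZ; have _hU := hU
  have hap : isApex (Z g) := (isApex_iff_snd _).2 hg0
  have hray' : (((Z g).1, 0, 0) : BPoint) = ray (P g) r ((Z g).1 - (P g).1) := by rw [← eq_of_isApex hap]; exact hray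
  obtain ⟨hc, ht, -⟩ := apexLower_of_ray (by omega) hray'
  have ha0 : absCharge (Z g) = 0 := absCharge_of_uncharged hg0
  have hcnt : chargeCount P = chargeCount Z + 1 := chargeCount_agree_succ hag hg0 hc
  refine hK P hP (fun f => ?_) j (by rw [hag j hjg]; exact hjc) ?_
  · by_cases hfg : f = g
    · subst hfg; rw [ht]; unfold causalTop; omega
    · rw [hag f hfg]
  · rw [hag j hjg, hcnt]; push_cast; omega

/-- **EDGE (at) with the (CD-P) kill**: an apex letter at `g`, a charged letter at `j` of node level `≠` the apex level and `< 2·#charged`.  RULE D at (apex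
coordinate, node coordinate): apex lowering, line child at `j`, or both — each a same-tops `P`-cell violating (CD-P) at `j`. -/
theorem edge_at_cd {h : ℤ} {C : MConfig} (hU : C.InDiamond h) {Z : MCell} (hZ : Z ∈ C.lower) (hD : RuleDMu4N C Z) {g j : Fin 4}
    (hg0 : (Z g).2 = (0, 0)) (hjc : (Z j).2 ≠ (0, 0)) (hne : (Z g).1 ≠ nodeLevel (Z j)) (hlow : nodeLevel (Z j) < 2 * (chargeCount Z : ℤ))
    (hK : KillBelowCD C Z) : False := by
  have hgj : g ≠ j := fun e => hjc (by rw [← e]; exact hg0)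
  have hap : isApex (Z g) := (isApex_iff_snd _).2 hg0
  obtain ⟨m', hm', hm0'⟩ := exists_node_dir (hU.1 Z hZ j).1
  have hne' : coord (Z g) m' ≠ coord (Z j) m' := by rw [coord_of_isApex hap, hm0']; unfold nodeLevel at hne; exact hne
  rcases hD g j hgj m' m' (adapted_of_isApex hap m') hm' hne' with ⟨r, -, P, hP, hag, hlt, hray⟩ | ⟨r, hr, P, hP, hag, hlt, hray⟩ |
      ⟨a, b, -, hb, P, hP, hag2, hlt1, hray1, hlt2, hray2⟩
  · exact apexKillBelowCD hU hZ hP hg0 hag hlt hray hgj.symm hjc hlow hK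
  · exact lineKillCD hU hZ hP hjc hm' hm0' hr hag hlt hray hlow hK
  · have hb' : b = m' := hb.elim id fun h' => absurd h'.1 (not_isApex_of_snd_ne hjc)
    rw [hb'] at hray2
    have hray1' : (((Z g).1, 0, 0) : BPoint) = ray (P g) a ((Z g).1 - (P g).1) := by rw [← eq_of_isApex hap]; exact hray1
    obtain ⟨hc1, ht1, -⟩ := apexLower_of_ray (by omega) hray1'
    obtain ⟨hc2, ht2, hnd2⟩ := lineChild_of_ray (hU.1 Z hZ j).1 hjc hm' hm0' (fin4_ne_add_two m') (by omega) hray2 (hU.2 P hP j).1 (hU.2 P hP j).2.1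
    have ha0 : absCharge (Z g) = 0 := absCharge_of_uncharged hg0
    have hcnt : chargeCount Z < chargeCount P := by
      refine chargeCount_strictMono (fun f hf => ?_) hg0 hc1
      by_cases hfg : f = g
      · subst hfg; exact hc1
      · by_cases hfj : f = j
        · subst hfj; exact hc2
        · rw [hag2 f hfg hfj]; exact hf
    have hcnt' : (chargeCount Z : ℤ) + 1 ≤ chargeCount P := by exact_mod_cast hcnt
    refine hK P hP (fun f => ?_) j hc2 (by omega)
    by_cases hfg : f = g
    · subst hfg; rw [ht1]; unfold causalTop; omega
    · by_cases hfj : f = j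
      · subst hfj; exact ht2
      · rw [hag2 f hfg hfj]

/-- **EDGE (tt) with the (CD-P) kill**: two charged letters `g`, `j` of distinct node levels, `node g + 2 < 2·#charged`.  RULE D at the two node coordinates:
a line child at `g`, at `j`, or at both — each keeps the count and keeps or lowers `g`, so violates (CD-P) at `g`. -/
theorem edge_tt_cd {h : ℤ} {C : MConfig} (hU : C.InDiamond h) {Z : MCell} (hZ : Z ∈ C.lower) (hD : RuleDMu4N C Z) {g j : Fin 4} (hgj : g ≠ j)
    (hgc : (Z g).2 ≠ (0, 0)) (hjc : (Z j).2 ≠ (0, 0)) (hne : nodeLevel (Z g) ≠ nodeLevel (Z j))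
    (hlow : nodeLevel (Z g) + 2 < 2 * (chargeCount Z : ℤ)) (hK : KillBelowCD C Z) : False := by
  obtain ⟨m, hm, hm0⟩ := exists_node_dir (hU.1 Z hZ g).1
  obtain ⟨m', hm', hm0'⟩ := exists_node_dir (hU.1 Z hZ j).1
  have hne' : coord (Z g) m ≠ coord (Z j) m' := by unfold nodeLevel at hne; rwa [hm0, hm0']
  rcases hD g j hgj m m' hm hm' hne' with ⟨r, hr, P, hP, hag, hlt, hray⟩ | ⟨r, hr, P, hP, hag, hlt, hray⟩ |
      ⟨a, b, ha, hb, P, hP, hag2, hlt1, hray1, hlt2, hray2⟩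
  · exact lineKillCD hU hZ hP hgc hm hm0 hr hag hlt hray (by omega) hK
  · obtain ⟨hc, ht, -⟩ := lineChild_of_ray (hU.1 Z hZ j).1 hjc hm' hm0' hr (by omega) hray (hU.2 P hP j).1 (hU.2 P hP j).2.1
    have hcnt : chargeCount P = chargeCount Z := chargeCount_congr fun f => by
      by_cases hfj : f = j
      · subst hfj; exact ⟨fun _ => hjc, fun _ => hc⟩
      · rw [hag f hfj]
    refine hK P hP (fun f => ?_) g (by rw [hag g hgj]; exact hgc) ?_
    · by_cases hfj : f = j
      · subst hfj; exact ht
      · rw [hag f hfj]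
    · rw [hag g hgj, hcnt]; omega
  · have ha' : a = m := ha.elim id fun h' => absurd h'.1 (not_isApex_of_snd_ne hgc)
    have hb' : b = m' := hb.elim id fun h' => absurd h'.1 (not_isApex_of_snd_ne hjc)
    rw [ha'] at hray1
    rw [hb'] at hray2
    obtain ⟨hc1, ht1, hnd1⟩ := lineChild_of_ray (hU.1 Z hZ g).1 hgc hm hm0 (fin4_ne_add_two m) (by omega) hray1 (hU.2 P hP g).1 (hU.2 P hP g).2.1
    obtain ⟨hc2, ht2, -⟩ := lineChild_of_ray (hU.1 Z hZ j).1 hjc hm' hm0' (fin4_ne_add_two m') (by omega) hray2 (hU.2 P hP j).1 (hU.2 P hP j).2.1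
    have hcnt : chargeCount P = chargeCount Z := chargeCount_congr fun f => by
      by_cases hfg : f = g
      · subst hfg; exact ⟨fun _ => hgc, fun _ => hc1⟩
      · by_cases hfj : f = j
        · subst hfj; exact ⟨fun _ => hjc, fun _ => hc2⟩
        · rw [hag2 f hfg hfj]
    refine hK P hP (fun f => ?_) g hc1 ?_
    · by_cases hfg : f = g
      · subst hfg; exact ht1
      · by_cases hfj : f = j
        · subst hfj; exact ht2
        · rw [hag2 f hfg hfj]
    · rw [hcnt]; omega

/-- **(CD-N) ⟸ (CD-P) ∧ (CDN4), locally** (KERNEL, every `h`, no induction): in a RULE-D-closed configuration in ◇_h whose LEVEL `P`-cells obey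
`2·# − 2 ≤ node` and whose seed-shape level `N`-cells obey `8 ≤ node`, EVERY level `N`-cell obeys `2·# ≤ node` at every charged letter. -/
theorem cdN_of_cdP_seed {h : ℤ} {C : MConfig} (hU : C.InDiamond h) (hD : RuleDMu4Closed C) (hCDP : CDPIneq C) (hS : CDNSeedLocal C) :
    ∀ Z ∈ C.lower, LevelCell Z → ∀ f, (Z f).2 ≠ (0, 0) → 2 * (chargeCount Z : ℤ) ≤ nodeLevel (Z f) := by
  intro Z hZ hZl f₀ hf₀
  by_contra hlt
  push Not at hlt
  have hK := killBelowCD_of_level hCDP hZl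
  by_cases hap : ∃ g, (Z g).2 = (0, 0)
  · -- an apex letter: edge (at) at (g, f₀); the apex level is the common top, above the node of f₀
    obtain ⟨g, hg0⟩ := hap
    have hpos : 0 < absCharge (Z f₀) := absCharge_pos_of_not_isApex (hU.1 Z hZ f₀).1 (not_isApex_of_snd_ne hf₀)
    have ha0 : absCharge (Z g) = 0 := absCharge_of_uncharged hg0
    have hne : (Z g).1 ≠ nodeLevel (Z f₀) := by
      have := hZl g f₀; unfold causalTop at this; unfold nodeLevel; omega
    exact edge_at_cd hU hZ (hD.1 Z hZ) hg0 hf₀ hne hlt hK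
  · -- four charged letters: seed shape, or edge (tt) at a letter of node < 6 against a letter of another node
    push Not at hap
    have h4 : chargeCount Z = 4 := chargeCount_eq_four hap
    by_cases hF : NodeFlat Z
    · have := hS Z hZ hZl ⟨h4, Or.inl hF⟩ f₀ hf₀; omega
    · by_cases h6 : ∀ f, 6 ≤ nodeLevel (Z f)
      · have := hS Z hZ hZl ⟨h4, Or.inr h6⟩ f₀ hf₀; omega
      · push Not at h6
        obtain ⟨f₁, hf₁⟩ := h6
        obtain ⟨j, hj⟩ : ∃ j, nodeLevel (Z f₁) ≠ nodeLevel (Z j) := by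
          by_contra hall; push Not at hall
          exact hF fun a b => by rw [← hall a, ← hall b]
        have hf₁j : f₁ ≠ j := fun e => hj (by rw [e])
        exact edge_tt_cd hU hZ (hD.1 Z hZ) hf₁j (hap f₁) (hap j) hj (by rw [h4]; push_cast; omega) hK

/-- **`CDIneq C` ⟸ (CD-P) ∧ (CDN4), locally** (KERNEL). -/
theorem cdIneq_of_cdP_seed {h : ℤ} {C : MConfig} (hU : C.InDiamond h) (hD : RuleDMu4Closed C) (hCDP : CDPIneq C) (hS : CDNSeedLocal C) :
    CDIneq C :=
  ⟨hCDP, cdN_of_cdP_seed hU hD hCDP hS⟩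

/-- **(CD_h) ⟸ (CD-P_h) ∧ (CDN4_h)** (KERNEL, every `h`).  Both displayed hypotheses are census UP-facts (◇₈: 1 745 + 100 orbits; ◇₁₀: 4 202 + 206), NOT proved. -/
theorem chargeDepthLaw_of_cdP_seed {h : ℤ} (hP : ChargeDepthPLaw h) (hS : CDNSeedLaw h) : ChargeDepthLaw h :=
  fun C hU hG hSt => cdIneq_of_cdP_seed hU hSt.1 (hP C hU hG hSt) (hS C hU hG hSt)

/-- **(LVN_h) ∧ (LVP3_h) ⟸ (CD-P_h) ∧ (CDN4_h) ∧ (SN_h) ∧ (SP_h)** (KERNEL, every `h`). -/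
theorem levelNLaw_of_cdP_seeds {h : ℤ} (hP : ChargeDepthPLaw h) (hS4 : CDNSeedLaw h) (hSN : SeedNLaw h) (hSP : SeedPLaw h) : LevelNLaw h :=
  levelNLaw_of_cd_seeds (chargeDepthLaw_of_cdP_seed hP hS4) hSN hSP

theorem levelP3Law_of_cdP_seeds {h : ℤ} (hP : ChargeDepthPLaw h) (hS4 : CDNSeedLaw h) (hSN : SeedNLaw h) (hSP : SeedPLaw h) : LevelP3Law h :=
  levelP3Law_of_cd_seeds (chargeDepthLaw_of_cdP_seed hP hS4) hSN hSP

/-- **(T₈) ⟸ (CD-P₈) ∧ (CDN4₈) ∧ (SN₈) ∧ (SP₈)** (KERNEL glue).  Census sizes of the four displayed UP-facts of ◇₈ (j318002 h8 `a459e02921a60310`):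
1 745 + 100 + 2 142 + 20 = 4 007 orbits.  NOT a proof of (T₈); HC ∕ HC_CM ∕ HC_AV ∕ H2 NOT proved. -/
theorem seedB1Odd_eight_of_cdP_seeds (hP : ChargeDepthPLaw 8) (hS4 : CDNSeedLaw 8) (hSN : SeedNLaw 8) (hSP : SeedPLaw 8) :
    SeedB1OddDiamondG1H1 8 :=
  seedB1Odd_eight_of_cd_seeds (chargeDepthLaw_of_cdP_seed hP hS4) hSN hSP

/-- **(T_h) ⟸ (CD-P_h) ∧ (CDN4_h) ∧ (SN_h) ∧ (SP_h) ∧ (NS_h) for every `h ≤ 10`** (KERNEL glue); at `h = 10` the census sizes (j318002 h10 `74004db439790926`)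
are 4 202 + 206 + 5 664 + 511 orbits + the nest UP-fact.  NOT a proof of (T₁₀); HC ∕ HC_CM ∕ HC_AV ∕ H2 NOT proved. -/
theorem seedB1Odd_of_cdP_seeds_nest_le_ten {h : ℤ} (hh : h ≤ 10) (hP : ChargeDepthPLaw h) (hS4 : CDNSeedLaw h) (hSN : SeedNLaw h)
    (hSP : SeedPLaw h) (hNS : NestLaw h) : SeedB1OddDiamondG1H1 h :=
  seedB1Odd_of_cd_seeds_nest_le_ten hh (chargeDepthLaw_of_cdP_seed hP hS4) hSN hSP hNS

theorem seedB1Odd_ten_of_cdP_seeds_nest (hP : ChargeDepthPLaw 10) (hS4 : CDNSeedLaw 10) (hSN : SeedNLaw 10) (hSP : SeedPLaw 10)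
    (hNS : NestLaw 10) : SeedB1OddDiamondG1H1 10 :=
  seedB1Odd_of_cdP_seeds_nest_le_ten le_rfl hP hS4 hSN hSP hNS


/-! ## §9 (v3) The twin-apex seed is almost not a seed: the SECOND INDUCTION with the non-high 2-charged `P`-cells in the loop

Two INFORMATIVE edges (the kernel of §3 once more, now reporting what happens to ONE designated charged letter): below an `N`-cell, the (at) edge at
(apex `g`, charged `j`) yields a same-tops `P`-cell of larger `Q` in which `j` is still charged and EITHER the count went up OR the count is kept and
`j` went down by ≥ 2 node levels (`edge_at_info`); the (tt) edge at (charged `g`, charged `j`) yields one in which the count is kept, `g` is charged and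
its node did not go up (`edge_tt_info`).  With these, the induction of §5 is re-run with a STRONGER hypothesis on the `P`-side — it now also kills the
NON-HIGH non-level `P`-cells with exactly two charged letters (a class that is 100 % dead in both censuses: ◇₈ 3 080 ∕ 3 080, ◇₁₀ 9 630 dead and the
10 survivors all HIGH) — and a THINNER seed on the `N`-side: a non-level twin-apex cell with a charged letter of node `< 4`, or with a node-4 letter
under an apex of level `≠ 4`, has an (at) or (tt) edge all of whose outcomes are `P`-cells with ≥ 3 charged letters or NON-HIGH 2-charged ones.
New `N`-seed shape `SeedShapeN2 := NodeFlat ∨ HighTwin` (`HighTwin` = twin-apex, all charged nodes ≥ 4, node-4 letters only under apexes of level 4):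
census ◇₈ 1 724 + 17 = 1 741 orbits (v1∕v2: 2 142), ◇₁₀ 4 344 + 136 = 4 480 (v1∕v2: 5 664).  Consequences: `seedB1Odd_eight_of_cdP_seeds2`
**(T₈) ⟸ (CD-P₈) ∧ (CDN4₈) ∧ (SN2₈) ∧ (SP₈)** = 1 745 + 100 + 1 741 + 20 = 3 606 census orbits; `seedB1Odd_of_cdP_seeds2_nest_le_ten` (◇₁₀: 4 202 + 206 +
4 480 + 511 = 9 399); and the bonus law `levelP2LowLaw_of_cd_seeds2` **(LVP2⁻_h) ⟸ (CD_h) ∧ (SN2_h) ∧ (SP_h)**: non-high non-level 2-charged `P`-cells are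
absent (the TRUE part of the false law (LVP2)).  THE PICTURE: `N`-seed = node-flat + 17 ∕ 136 high twins; `P`-seed = top-flat (level, the (CD-P) cells)
+ 20 ∕ 511 HIGH — the two silent families of the Q-raising RULE D are DUAL. -/

/-- informative kill below `Z` at the charged letter `j` (edge (at)): every outcome is a same-tops `P`-cell of larger `Q` with `j` charged, and EITHER of
larger count OR of the same count with `j` at least two node levels lower. -/
def KillBelowAt (C : MConfig) (Z : MCell) (j : Fin 4) : Prop :=
  ∀ P ∈ C.upper, (∀ f, causalTop (P f) = causalTop (Z f)) → totalCharge Z < totalCharge P → (P j).2 ≠ (0, 0) →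
    (chargeCount Z + 1 ≤ chargeCount P ∨ (chargeCount P = chargeCount Z ∧ nodeLevel (P j) + 2 ≤ nodeLevel (Z j))) → False

/-- informative kill below `Z` at the charged letter `g` (edge (tt)): every outcome is a same-tops `P`-cell of larger `Q` and the same count, with `g`
charged and its node not higher. -/
def KillBelowTT (C : MConfig) (Z : MCell) (g : Fin 4) : Prop :=
  ∀ P ∈ C.upper, (∀ f, causalTop (P f) = causalTop (Z f)) → totalCharge Z < totalCharge P → chargeCount P = chargeCount Z →
    (P g).2 ≠ (0, 0) → nodeLevel (P g) ≤ nodeLevel (Z g) → False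

/-- **EDGE (at), informative form.** -/
theorem edge_at_info {h : ℤ} {C : MConfig} (hU : C.InDiamond h) {Z : MCell} (hZ : Z ∈ C.lower) (hD : RuleDMu4N C Z) {g j : Fin 4}
    (hg0 : (Z g).2 = (0, 0)) (hjc : (Z j).2 ≠ (0, 0)) (hne : (Z g).1 ≠ nodeLevel (Z j)) (hK : KillBelowAt C Z j) : False := by
  have hgj : g ≠ j := fun e => hjc (by rw [← e]; exact hg0)
  have hap : isApex (Z g) := (isApex_iff_snd _).2 hg0
  have ha0 : absCharge (Z g) = 0 := absCharge_of_uncharged hg0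
  obtain ⟨m', hm', hm0'⟩ := exists_node_dir (hU.1 Z hZ j).1
  have hne' : coord (Z g) m' ≠ coord (Z j) m' := by rw [coord_of_isApex hap, hm0']; unfold nodeLevel at hne; exact hne
  rcases hD g j hgj m' m' (adapted_of_isApex hap m') hm' hne' with ⟨r, -, P, hP, hag, hlt, hray⟩ | ⟨r, hr, P, hP, hag, hlt, hray⟩ |
      ⟨a, b, -, hb, P, hP, hag2, hlt1, hray1, hlt2, hray2⟩
  · -- apex lowering at g: count + 1, j untouched
    have hray' : (((Z g).1, 0, 0) : BPoint) = ray (P g) r ((Z g).1 - (P g).1) := by rw [← eq_of_isApex hap]; exact hray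
    obtain ⟨hc, ht, hq⟩ := apexLower_of_ray (by omega) hray'
    have hcnt : chargeCount P = chargeCount Z + 1 := chargeCount_agree_succ hag hg0 hc
    refine hK P hP (fun f => ?_) (totalCharge_lt (fun f => ?_) g ?_) (by rw [hag j hgj.symm]; exact hjc) (Or.inl (by omega))
    · by_cases hfg : f = g
      · subst hfg; rw [ht]; unfold causalTop; omega
      · rw [hag f hfg]
    · by_cases hfg : f = g
      · subst hfg; rw [ha0, hq]; omega
      · exact le_of_eq (by rw [hag f hfg])
    · rw [ha0, hq]; omega
  · -- line lowering at j: count kept, j two or more node levels lower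
    obtain ⟨hc, ht, hnd⟩ := lineChild_of_ray (hU.1 Z hZ j).1 hjc hm' hm0' hr (by omega) hray (hU.2 P hP j).1 (hU.2 P hP j).2.1
    have hcnt : chargeCount P = chargeCount Z := chargeCount_congr fun f => by
      by_cases hfj : f = j
      · subst hfj; exact ⟨fun _ => hjc, fun _ => hc⟩
      · rw [hag f hfj]
    refine hK P hP (fun f => ?_) (totalCharge_lt (fun f => ?_) j ?_) hc (Or.inr ⟨hcnt, by omega⟩)
    · by_cases hfj : f = j
      · subst hfj; exact ht
      · rw [hag f hfj]
    · by_cases hfj : f = j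
      · subst hfj; unfold causalTop at ht; unfold nodeLevel at hnd; omega
      · exact le_of_eq (by rw [hag f hfj])
    · unfold causalTop at ht; unfold nodeLevel at hnd; omega
  · -- cover: apex lowering at g and line lowering at j: count up
    have hb' : b = m' := hb.elim id fun h' => absurd h'.1 (not_isApex_of_snd_ne hjc)
    rw [hb'] at hray2
    have hray1' : (((Z g).1, 0, 0) : BPoint) = ray (P g) a ((Z g).1 - (P g).1) := by rw [← eq_of_isApex hap]; exact hray1
    obtain ⟨hc1, ht1, hq1⟩ := apexLower_of_ray (by omega) hray1'
    obtain ⟨hc2, ht2, hnd2⟩ := lineChild_of_ray (hU.1 Z hZ j).1 hjc hm' hm0' (fin4_ne_add_two m') (by omega) hray2 (hU.2 P hP j).1 (hU.2 P hP j).2.1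
    have hcnt : chargeCount Z < chargeCount P := by
      refine chargeCount_strictMono (fun f hf => ?_) hg0 hc1
      by_cases hfg : f = g
      · subst hfg; exact hc1
      · by_cases hfj : f = j
        · subst hfj; exact hc2
        · rw [hag2 f hfg hfj]; exact hf
    refine hK P hP (fun f => ?_) (totalCharge_lt (fun f => ?_) g ?_) hc2 (Or.inl (by omega))
    · by_cases hfg : f = g
      · subst hfg; rw [ht1]; unfold causalTop; omega
      · by_cases hfj : f = j
        · subst hfj; exact ht2
        · rw [hag2 f hfg hfj]
    · by_cases hfg : f = g
      · subst hfg; rw [ha0, hq1]; omega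
      · by_cases hfj : f = j
        · subst hfj; unfold causalTop at ht2; unfold nodeLevel at hnd2; omega
        · exact le_of_eq (by rw [hag2 f hfg hfj])
    · rw [ha0, hq1]; omega

/-- **EDGE (tt), informative form** (reporting on the letter `g`). -/
theorem edge_tt_info {h : ℤ} {C : MConfig} (hU : C.InDiamond h) {Z : MCell} (hZ : Z ∈ C.lower) (hD : RuleDMu4N C Z) {g j : Fin 4} (hgj : g ≠ j)
    (hgc : (Z g).2 ≠ (0, 0)) (hjc : (Z j).2 ≠ (0, 0)) (hne : nodeLevel (Z g) ≠ nodeLevel (Z j)) (hK : KillBelowTT C Z g) : False := by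
  obtain ⟨m, hm, hm0⟩ := exists_node_dir (hU.1 Z hZ g).1
  obtain ⟨m', hm', hm0'⟩ := exists_node_dir (hU.1 Z hZ j).1
  have hne' : coord (Z g) m ≠ coord (Z j) m' := by unfold nodeLevel at hne; rwa [hm0, hm0']
  rcases hD g j hgj m m' hm hm' hne' with ⟨r, hr, P, hP, hag, hlt, hray⟩ | ⟨r, hr, P, hP, hag, hlt, hray⟩ |
      ⟨a, b, ha, hb, P, hP, hag2, hlt1, hray1, hlt2, hray2⟩
  · obtain ⟨hc, ht, hnd⟩ := lineChild_of_ray (hU.1 Z hZ g).1 hgc hm hm0 hr (by omega) hray (hU.2 P hP g).1 (hU.2 P hP g).2.1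
    have hcnt : chargeCount P = chargeCount Z := chargeCount_congr fun f => by
      by_cases hfg : f = g
      · subst hfg; exact ⟨fun _ => hgc, fun _ => hc⟩
      · rw [hag f hfg]
    refine hK P hP (fun f => ?_) (totalCharge_lt (fun f => ?_) g ?_) hcnt hc (by omega)
    · by_cases hfg : f = g
      · subst hfg; exact ht
      · rw [hag f hfg]
    · by_cases hfg : f = g
      · subst hfg; unfold causalTop at ht; unfold nodeLevel at hnd; omega
      · exact le_of_eq (by rw [hag f hfg])
    · unfold causalTop at ht; unfold nodeLevel at hnd; omega
  · obtain ⟨hc, ht, hnd⟩ := lineChild_of_ray (hU.1 Z hZ j).1 hjc hm' hm0' hr (by omega) hray (hU.2 P hP j).1 (hU.2 P hP j).2.1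
    have hcnt : chargeCount P = chargeCount Z := chargeCount_congr fun f => by
      by_cases hfj : f = j
      · subst hfj; exact ⟨fun _ => hjc, fun _ => hc⟩
      · rw [hag f hfj]
    refine hK P hP (fun f => ?_) (totalCharge_lt (fun f => ?_) j ?_) hcnt (by rw [hag g hgj]; exact hgc) (le_of_eq (by rw [hag g hgj]))
    · by_cases hfj : f = j
      · subst hfj; exact ht
      · rw [hag f hfj]
    · by_cases hfj : f = j
      · subst hfj; unfold causalTop at ht; unfold nodeLevel at hnd; omega
      · exact le_of_eq (by rw [hag f hfj])
    · unfold causalTop at ht; unfold nodeLevel at hnd; omega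
  · have ha' : a = m := ha.elim id fun h' => absurd h'.1 (not_isApex_of_snd_ne hgc)
    have hb' : b = m' := hb.elim id fun h' => absurd h'.1 (not_isApex_of_snd_ne hjc)
    rw [ha'] at hray1
    rw [hb'] at hray2
    obtain ⟨hc1, ht1, hnd1⟩ := lineChild_of_ray (hU.1 Z hZ g).1 hgc hm hm0 (fin4_ne_add_two m) (by omega) hray1 (hU.2 P hP g).1 (hU.2 P hP g).2.1
    obtain ⟨hc2, ht2, hnd2⟩ := lineChild_of_ray (hU.1 Z hZ j).1 hjc hm' hm0' (fin4_ne_add_two m') (by omega) hray2 (hU.2 P hP j).1 (hU.2 P hP j).2.1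
    have hcnt : chargeCount P = chargeCount Z := chargeCount_congr fun f => by
      by_cases hfg : f = g
      · subst hfg; exact ⟨fun _ => hgc, fun _ => hc1⟩
      · by_cases hfj : f = j
        · subst hfj; exact ⟨fun _ => hjc, fun _ => hc2⟩
        · rw [hag2 f hfg hfj]
    refine hK P hP (fun f => ?_) (totalCharge_lt (fun f => ?_) g ?_) hcnt hc1 (by omega)
    · by_cases hfg : f = g
      · subst hfg; exact ht1
      · by_cases hfj : f = j
        · subst hfj; exact ht2
        · rw [hag2 f hfg hfj]
    · by_cases hfg : f = g
      · subst hfg; unfold causalTop at ht1; unfold nodeLevel at hnd1; omega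
      · by_cases hfj : f = j
        · subst hfj; unfold causalTop at ht2; unfold nodeLevel at hnd2; omega
        · exact le_of_eq (by rw [hag2 f hfg hfj])
    · unfold causalTop at ht1; unfold nodeLevel at hnd1; omega

/-- a HIGH TWIN: twin-apex 2-charged, every charged letter of node `≥ 4`, and a node-4 letter only under apexes of level `4` (these are exactly the
twin-apex cells at which neither informative edge produces a non-high child; census ◇₈ 17 non-node-flat orbits, ◇₁₀ 136). -/
def HighTwin (Z : MCell) : Prop :=
  TwinApex2 Z ∧ (∀ f, (Z f).2 ≠ (0, 0) → 4 ≤ nodeLevel (Z f)) ∧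
    (∀ f g, (Z f).2 ≠ (0, 0) → nodeLevel (Z f) = 4 → (Z g).2 = (0, 0) → (Z g).1 = 4)

/-- the THIN seed shape of an `N`-cell (v3): node-flat, or a high twin. -/
def SeedShapeN2 (Z : MCell) : Prop := NodeFlat Z ∨ HighTwin Z

/-- (SN2) locally. -/
def SeedN2Local (C : MConfig) : Prop := ∀ Z ∈ C.lower, 2 ≤ chargeCount Z → SeedShapeN2 Z → LevelCell Z

/-- **(SN2_h) THE THIN `N`-SEED LAW** (CONJECTURE ∕ census UP-fact at 8, 10: 1 741 ∕ 4 480 dead orbits; NOT proved). -/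
def SeedN2Law (h : ℤ) : Prop := ∀ C : MConfig, C.InDiamond h → C.G1Closed → C.StaticH1 → SeedN2Local C

theorem seedShapeN_of_seedShapeN2 {Z : MCell} (hZ : SeedShapeN2 Z) : SeedShapeN Z := hZ.elim Or.inl fun hH => Or.inr hH.1

theorem seedN2Local_of_seedNLocal {C : MConfig} (H : SeedNLocal C) : SeedN2Local C :=
  fun Z hZ h2 hs => H Z hZ h2 (seedShapeN_of_seedShapeN2 hs)

theorem seedN2Law_of_seedNLaw {h : ℤ} (H : SeedNLaw h) : SeedN2Law h := fun C hU hG hS => seedN2Local_of_seedNLocal (H C hU hG hS)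

theorem seedN2Law_antitone {h h' : ℤ} (hh : h ≤ h') (H : SeedN2Law h') : SeedN2Law h :=
  fun C hU hG hS => H C (inDiamond_config_mono hh hU) hG hS

/-- **THE SECOND CHARGE INDUCTION** (KERNEL, h-uniform): as `levelLocal_induction`, with the non-high 2-charged `P`-cells inside the induction and the thin
`N`-seed (SN2). -/
theorem levelLocal_induction2 {h : ℤ} {C : MConfig} (hU : C.InDiamond h) (hD : RuleDMu4Closed C) (hCD : CDIneq C) (hSN : SeedN2Local C)
    (hSP : SeedPLocal C) (n : ℕ) :
    (∀ Z ∈ C.lower, 2 * h - totalCharge Z ≤ n → 2 ≤ chargeCount Z → LevelCell Z) ∧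
      (∀ P ∈ C.upper, 2 * h - totalCharge P ≤ n → 2 ≤ chargeCount P → (3 ≤ chargeCount P ∨ ¬ HighP P) → LevelCell P) := by
  induction n using Nat.strong_induction_on with
  | _ n IH =>
  refine ⟨fun Z hZ hμ h2 => ?_, fun P hP hμ h2 h23 => ?_⟩
  · by_contra hnl
    -- the induction hypothesis kills every same-tops `P`-child of larger `Q` with ≥ 3 charged letters, or with 2 and not high
    have hKillP : ∀ P ∈ C.upper, 2 ≤ chargeCount P → (3 ≤ chargeCount P ∨ ¬ HighP P) → (∀ f, causalTop (P f) = causalTop (Z f)) →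
        totalCharge Z < totalCharge P → False := by
      intro P hP hP2 hP3 htops hQ
      have hQP := totalCharge_le_of_inDiamond (hU.2 P hP)
      have hn1 : n - 1 < n := by omega
      have hPl : LevelCell P := (IH (n - 1) hn1).2 P hP (by omega) hP2 hP3
      exact hnl fun f f' => by rw [← htops f, ← htops f']; exact hPl f f'
    have hK1 : KillBelow C Z (chargeCount Z + 1) := fun P hP hcnt htops hQ => hKillP P hP (by omega) (Or.inl (by omega)) htops hQ
    rcases Nat.lt_or_ge 2 (chargeCount Z) with h3 | hle2
    · -- at least three charged letters: not node-flat, so an edge (tt) or (at) exists (as in §5)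
      have hK : KillBelow C Z (chargeCount Z) := fun P hP hcnt htops hQ => hKillP P hP (by omega) (Or.inl (by omega)) htops hQ
      have hnf : ¬ NodeFlat Z := fun hF => hnl (hSN Z hZ h2 (Or.inl hF))
      obtain ⟨f, g, hfg'⟩ : ∃ f g, nodeLevel (Z f) ≠ nodeLevel (Z g) := by
        by_contra hall; push Not at hall; exact hnf hall
      have hfg : f ≠ g := fun e => hfg' (by rw [e])
      by_cases hf0 : (Z f).2 = (0, 0)
      · by_cases hg0 : (Z g).2 = (0, 0)
        · exact charged_of_three h3 hg0 hfg hf0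
        · exact edge_at hU hZ (hD.1 Z hZ) hf0 hg0 (by rw [← nodeLevel_of_uncharged hf0]; exact hfg') hK
      · by_cases hg0 : (Z g).2 = (0, 0)
        · exact edge_at hU hZ (hD.1 Z hZ) hg0 hf0 (by rw [← nodeLevel_of_uncharged hg0]; exact fun e => hfg' e.symm) hK
        · exact edge_tt hU hZ (hD.1 Z hZ) hfg hf0 hg0 hfg' hK
    · -- exactly two charged letters
      have h2e : chargeCount Z = 2 := le_antisymm hle2 h2
      have hnf : ¬ NodeFlat Z := fun hF => hnl (hSN Z hZ h2 (Or.inl hF))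
      by_cases hT : TwinApex2 Z
      · -- twin-apex but not a high twin
        have hnh : ¬ HighTwin Z := fun hH => hnl (hSN Z hZ h2 (Or.inr hH))
        have hKat : ∀ j, (Z j).2 ≠ (0, 0) → nodeLevel (Z j) ≤ 4 → KillBelowAt C Z j := by
          intro j hjc hj4 P hP htops hQ hPj hor
          rcases hor with hcnt | ⟨hcnt, hnd⟩
          · exact hKillP P hP (by omega) (Or.inl (by omega)) htops hQ
          · refine hKillP P hP (by omega) (Or.inr fun hH => ?_) htops hQ
            have := hH j hPj
            rw [hcnt, h2e] at this
            push_cast at this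
            omega
        have hKtt : ∀ g, (Z g).2 ≠ (0, 0) → nodeLevel (Z g) < 4 → KillBelowTT C Z g := by
          intro g hgc hg4 P hP htops hQ hcnt hPg hnd
          refine hKillP P hP (by omega) (Or.inr fun hH => ?_) htops hQ
          have := hH g hPg
          rw [hcnt, h2e] at this
          push_cast at this
          omega
        by_cases hlow : ∃ f, (Z f).2 ≠ (0, 0) ∧ nodeLevel (Z f) < 4
        · -- a low charged letter f: an apex off its node gives (at); else the other charged letter has another node: (tt)
          obtain ⟨f, hfc, hf4⟩ := hlow
          by_cases hapx : ∃ g, (Z g).2 = (0, 0) ∧ (Z g).1 ≠ nodeLevel (Z f)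
          · obtain ⟨g, hg0, hne⟩ := hapx
            exact edge_at_info hU hZ (hD.1 Z hZ) hg0 hfc hne (hKat f hfc (by omega))
          · push Not at hapx
            obtain ⟨j, hj⟩ : ∃ j, nodeLevel (Z j) ≠ nodeLevel (Z f) := by
              by_contra hall; push Not at hall; exact hnf fun a b => by rw [hall a, hall b]
            have hjc : (Z j).2 ≠ (0, 0) := fun hj0 => hj (by rw [nodeLevel_of_uncharged hj0]; exact hapx j hj0)
            have hfj : f ≠ j := fun e => hj (by rw [e])
            exact edge_tt_info hU hZ (hD.1 Z hZ) hfj hfc hjc (fun e => hj e.symm) (hKtt f hfc hf4)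
        · -- all charged letters of node ≥ 4: not a high twin ⇒ a node-4 letter under an apex of level ≠ 4: (at)
          push Not at hlow
          have hC : ¬ ∀ f g, (Z f).2 ≠ (0, 0) → nodeLevel (Z f) = 4 → (Z g).2 = (0, 0) → (Z g).1 = 4 := fun hC => hnh ⟨hT, hlow, hC⟩
          push Not at hC
          obtain ⟨f, g, hfc, hf4, hg0, hg4⟩ := hC
          exact edge_at_info hU hZ (hD.1 Z hZ) hg0 hfc (by rw [hf4]; exact hg4) (hKat f hfc (le_of_eq hf4))
      · -- not twin-apex: an edge (aa) or (at-floor) exists (as in §5)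
        by_cases hB : ∀ f g, (Z f).2 = (0, 0) → (Z g).2 = (0, 0) → (Z f).1 = (Z g).1
        · have hC : ¬ ∀ f g, (Z f).2 = (0, 0) → (Z g).2 ≠ (0, 0) → nodeLevel (Z g) = 0 → (Z f).1 = 0 := fun hC => hT ⟨hle2, hB, hC⟩
          push Not at hC
          obtain ⟨f, g, hf0, hgc, hg0n, hfne⟩ := hC
          exact edge_at_floor hU hZ (hD.1 Z hZ) hf0 hgc hg0n hfne hK1
        · push Not at hB
          obtain ⟨f, g, hf0, hg0, hne⟩ := hB
          have hfg : f ≠ g := fun e => hne (by rw [e])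
          exact edge_aa hU hZ (hD.1 Z hZ) hfg hf0 hg0 hne hK1
  · by_contra hnl
    by_cases hHi : HighP P
    · exact h23.elim (fun h3 => hnl (hSP P hP h3 hHi)) fun hnh => hnh hHi
    obtain ⟨f₀, hf₀c, hlt₀⟩ : ∃ f₀, (P f₀).2 ≠ (0, 0) ∧ nodeLevel (P f₀) < 2 * (chargeCount P : ℤ) := by
      by_contra hall; push Not at hall; exact hHi hall
    have hK : KillAbove C P := by
      intro N hN hcnt hnodes hQ
      by_cases hNl : LevelCell N
      · have h1 := hCD.2 N hN hNl f₀ (hnodes f₀ hf₀c).1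
        rw [(hnodes f₀ hf₀c).2] at h1
        have h2' : (chargeCount P : ℤ) ≤ chargeCount N := by exact_mod_cast hcnt
        omega
      · have hQN := totalCharge_le_of_inDiamond (hU.1 N hN)
        have hn1 : n - 1 < n := by omega
        exact hNl ((IH (n - 1) hn1).1 N hN (by omega) (by omega))
    by_cases hAA : ∃ f g, (P f).2 ≠ (0, 0) ∧ (P g).2 ≠ (0, 0) ∧ causalTop (P f) ≠ causalTop (P g)
    · obtain ⟨f, g, hfc, hgc, hne⟩ := hAA
      exact edge_AA hU hP (hD.2 P hP) (fun e => hne (by rw [e])) hfc hgc hne hK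
    · push Not at hAA
      obtain ⟨g, hg⟩ : ∃ g, causalTop (P g) ≠ causalTop (P f₀) := by
        by_contra hall; push Not at hall; exact hnl fun f f' => by rw [hall f, hall f']
      have hg0 : (P g).2 = (0, 0) := by
        by_contra hgc; exact hg (hAA g f₀ hgc hf₀c)
      exact edge_Aa hU hP (hD.2 P hP) hf₀c hg0 (by rw [← causalTop_of_uncharged hg0]; exact fun e => hg e.symm) hK

/-- **(CD) ∧ (SN2) ∧ (SP) ⇒ (LVN) ∧ (LVP3) ∧ (LVP2⁻), locally** (KERNEL, every `h`). -/
theorem levelLocal_of_cd_seeds2 {h : ℤ} {C : MConfig} (hU : C.InDiamond h) (hD : RuleDMu4Closed C) (hCD : CDIneq C) (hSN : SeedN2Local C)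
    (hSP : SeedPLocal C) :
    (∀ Z ∈ C.lower, 2 ≤ chargeCount Z → LevelCell Z) ∧ (∀ P ∈ C.upper, 3 ≤ chargeCount P → LevelCell P) ∧
      (∀ P ∈ C.upper, 2 ≤ chargeCount P → ¬ HighP P → LevelCell P) := by
  refine ⟨fun Z hZ h2 => ?_, fun P hP h3 => ?_, fun P hP h2 hnh => ?_⟩
  · have h0 := totalCharge_nonneg Z
    exact (levelLocal_induction2 hU hD hCD hSN hSP (2 * h - totalCharge Z).toNat).1 Z hZ (Int.self_le_toNat _) h2
  · have h0 := totalCharge_nonneg P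
    exact (levelLocal_induction2 hU hD hCD hSN hSP (2 * h - totalCharge P).toNat).2 P hP (Int.self_le_toNat _) (by omega) (Or.inl h3)
  · have h0 := totalCharge_nonneg P
    exact (levelLocal_induction2 hU hD hCD hSN hSP (2 * h - totalCharge P).toNat).2 P hP (Int.self_le_toNat _) h2 (Or.inr hnh)

/-- **(LVP2⁻_h) THE LOW 2-CHARGED `P` LAW** (as a statement): a non-high `P`-cell with ≥ 2 charged letters is level.  (The unrestricted (LVP2) is FALSE at
◇₁₀ — ten HIGH 2-charged non-level `P`-orbits survive the peel — but its non-high part is a census UP-fact at 8 and 10, and by `levelP2LowLaw_of_cd_seeds2`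
a CONSEQUENCE of (CD) ∧ (SN2) ∧ (SP).) -/
def LevelP2LowLaw (h : ℤ) : Prop :=
  ∀ C : MConfig, C.InDiamond h → C.G1Closed → C.StaticH1 → ∀ P ∈ C.upper, 2 ≤ chargeCount P → ¬ HighP P → LevelCell P

theorem levelNLaw_of_cd_seeds2 {h : ℤ} (hCD : ChargeDepthLaw h) (hSN : SeedN2Law h) (hSP : SeedPLaw h) : LevelNLaw h :=
  fun C hU hG hS => (levelLocal_of_cd_seeds2 hU hS.1 (hCD C hU hG hS) (hSN C hU hG hS) (hSP C hU hG hS)).1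

theorem levelP3Law_of_cd_seeds2 {h : ℤ} (hCD : ChargeDepthLaw h) (hSN : SeedN2Law h) (hSP : SeedPLaw h) : LevelP3Law h :=
  fun C hU hG hS => (levelLocal_of_cd_seeds2 hU hS.1 (hCD C hU hG hS) (hSN C hU hG hS) (hSP C hU hG hS)).2.1

/-- **(LVP2⁻_h) ⟸ (CD_h) ∧ (SN2_h) ∧ (SP_h)** (KERNEL, every `h`). -/
theorem levelP2LowLaw_of_cd_seeds2 {h : ℤ} (hCD : ChargeDepthLaw h) (hSN : SeedN2Law h) (hSP : SeedPLaw h) : LevelP2LowLaw h :=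
  fun C hU hG hS => (levelLocal_of_cd_seeds2 hU hS.1 (hCD C hU hG hS) (hSN C hU hG hS) (hSP C hU hG hS)).2.2

/-- **(T₈) ⟸ (CD-P₈) ∧ (CDN4₈) ∧ (SN2₈) ∧ (SP₈)** (KERNEL glue).  Census sizes of the four displayed UP-facts of ◇₈ (j318002 h8 `a459e02921a60310`):
1 745 + 100 + 1 741 + 20 = 3 606 orbits.  NOT a proof of (T₈); HC ∕ HC_CM ∕ HC_AV ∕ H2 NOT proved. -/
theorem seedB1Odd_eight_of_cdP_seeds2 (hP : ChargeDepthPLaw 8) (hS4 : CDNSeedLaw 8) (hSN : SeedN2Law 8) (hSP : SeedPLaw 8) :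
    SeedB1OddDiamondG1H1 8 :=
  have hCD := chargeDepthLaw_of_cdP_seed hP hS4
  seedB1Odd_eight_of_partial_cd hCD (levelNLaw_of_cd_seeds2 hCD hSN hSP) (levelP3Law_of_cd_seeds2 hCD hSN hSP) oddLineFree_eight

/-- **(T_h) ⟸ (CD-P_h) ∧ (CDN4_h) ∧ (SN2_h) ∧ (SP_h) ∧ (NS_h) for every `h ≤ 10`** (KERNEL glue); at `h = 10` the census sizes (j318002 h10
`74004db439790926`) are 4 202 + 206 + 4 480 + 511 orbits + the nest UP-fact.  NOT a proof of (T₁₀); HC ∕ HC_CM ∕ HC_AV ∕ H2 NOT proved. -/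
theorem seedB1Odd_of_cdP_seeds2_nest_le_ten {h : ℤ} (hh : h ≤ 10) (hP : ChargeDepthPLaw h) (hS4 : CDNSeedLaw h) (hSN : SeedN2Law h)
    (hSP : SeedPLaw h) (hNS : NestLaw h) : SeedB1OddDiamondG1H1 h := by
  have hCD := chargeDepthLaw_of_cdP_seed hP hS4
  refine seedB1Odd_of_level_nest_downLine (levelLaw_of_partial (levelNLaw_of_cd_seeds2 hCD hSN hSP) (levelP3Law_of_cd_seeds2 hCD hSN hSP)) hNS
    (fun h' hh' => ?_) (oddLineFree_all_le (by omega))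
  have hCD' := chargeDepthLaw_antitone hh' hCD
  exact downLineLaw_of_partial_cd_le_ten (hh'.trans hh) hCD' (levelNLaw_of_cd_seeds2 hCD' (seedN2Law_antitone hh' hSN) (seedPLaw_antitone hh' hSP))
    (levelP3Law_of_cd_seeds2 hCD' (seedN2Law_antitone hh' hSN) (seedPLaw_antitone hh' hSP))

theorem seedB1Odd_ten_of_cdP_seeds2_nest (hP : ChargeDepthPLaw 10) (hS4 : CDNSeedLaw 10) (hSN : SeedN2Law 10) (hSP : SeedPLaw 10)
    (hNS : NestLaw 10) : SeedB1OddDiamondG1H1 10 :=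
  seedB1Odd_of_cdP_seeds2_nest_le_ten le_rfl hP hS4 hSN hSP hNS


/-! ## §10 (v4) THE FLOOR — option law (F1): below a floor `N`-cell every RULE-D option slides a letter towards its floor apex

The largest remaining seed is the FLOOR family (node-flat at node 0: every letter an `O` or a floor letter `cℓ_φ`; 1 220 of the 1 741 (SN2₈) orbits).
(F1) FLOOR DESCENT (KERNEL, every `h`): RULE D at (top coordinate of a charged letter `g`, node coordinate of any other letter `j`) of a floor `N`-cell
is served only by sliding `g` down its own line towards its apex `O` — a floor `P`-cell agreeing with `Z` off `g`, with `g` of charge `e` less,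
`0 < e ≤ |c_g|`, hence of SMALLER total charge: line children and apex lowerings of `j` would leave the diamond (node `< 0`).  This is the exact
sense in which the floor family has no Q-raising demand below and is closed downwards; the dual statement above floor `P`-cells is `edge_AA` ∕
`edge_Aa` (top ∕ apex raises, node 0 kept, Q up).  See the memo §7 for the census phenomenology (Q-downward order of death; A2I⁻ swap clause). -/

/-- **the TOP CHILD**: `e > 0` null steps DOWN from a charged μ₄ letter `x`, in a direction `r ≠ k + 2` where `k` is its TOP direction (adapted,
`coord x k = top`), to a ◇-letter `y`: the node level does not go up, and if it is kept then `y` is on the line of `x` towards its down-apex — top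
`2e` lower, charge `e` smaller. -/
theorem topChild_of_ray {x y : BPoint} {k r : Fin 4} {e : ℤ} (hxax : x.2 = (0, 0) ∨ AxisPt x) (hna : x.2 ≠ (0, 0))
    (hk : Adapted x k) (hk0 : coord x k = x.1 + absCharge x) (hr : r ≠ k + 2) (he : 0 < e) (hxy : x = ray y r e)
    (hyax : y.2 = (0, 0) ∨ AxisPt y) (hy : absCharge y ≤ y.1) :
    nodeLevel y ≤ nodeLevel x ∧ (nodeLevel y = nodeLevel x → causalTop y + 2 * e = causalTop x ∧ absCharge y + e = absCharge x) := by
  obtain ⟨α, a, b⟩ := y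
  subst hxy
  simp only [causalTop, nodeLevel, absCharge, chargeOf, coord, AxisPt, Adapted, Prod.mk.injEq, ne_eq] at *
  fin_cases k <;> fin_cases r <;> simp at hxax hna hk hk0 hr hyax hy ⊢ <;>
    (simp only [abs_eq_max_neg, max_def] at *; split_ifs at * <;> omega)

/-- a FLOOR cell: every letter of node level `0` (an `O` or a floor letter `cℓ_φ`). -/
def FloorCell (Z : MCell) : Prop := ∀ f, nodeLevel (Z f) = 0

theorem nodeLevel_nonneg_of_inDiamond {h : ℤ} {x : BPoint} (hx : InDiamond h x) : 0 ≤ nodeLevel x := by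
  unfold nodeLevel; have := hx.2.1; omega

/-- **(F1) FLOOR DESCENT** (KERNEL, every `h`): below a floor `N`-cell, RULE D at (top of the charged letter `g`, node of `j ≠ g`) is served by a
`P ∈ C.upper` that agrees with `Z` off `g` and whose `g`-letter is the floor letter `e` charges lower on the same line (`0 < e`, top `− 2e`). -/
theorem floorDescent {h : ℤ} {C : MConfig} (hU : C.InDiamond h) {Z : MCell} (hZ : Z ∈ C.lower) (hD : RuleDMu4N C Z) (hF : FloorCell Z)
    {g j : Fin 4} (hgj : g ≠ j) (hgc : (Z g).2 ≠ (0, 0)) :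
    ∃ P ∈ C.upper, ∃ e : ℤ, 0 < e ∧ MAgree P Z g ∧ nodeLevel (P g) = 0 ∧ causalTop (P g) + 2 * e = causalTop (Z g) ∧
      absCharge (P g) + e = absCharge (Z g) := by
  obtain ⟨k, hk, hk0⟩ := exists_top_dir (hU.1 Z hZ g).1
  obtain ⟨m', hm', hm0'⟩ := exists_node_dir (hU.1 Z hZ j).1
  have hcg : 0 < absCharge (Z g) := absCharge_pos_of_not_isApex (hU.1 Z hZ g).1 (fun ha => hgc ((isApex_iff_snd _).1 ha))
  have hFg := hF g
  have hFj := hF j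
  unfold nodeLevel at hFg hFj
  have hne' : coord (Z g) k ≠ coord (Z j) m' := by rw [hk0, hm0']; omega
  -- the `j`-options leave the diamond: an apex `O` cannot be lowered, a floor letter has no line child
  have hjapex : (Z j).2 = (0, 0) → ∀ P ∈ C.upper, (P j).1 < (Z j).1 → False := by
    intro hj0 P hP hlt
    have hPj := (hU.2 P hP j).2.1
    have := absCharge_of_uncharged hj0
    have h0 := absCharge_nonneg (P j)
    omega
  have hjline : (Z j).2 ≠ (0, 0) → ∀ P ∈ C.upper, ∀ r : Fin 4, r ≠ m' + 2 → (P j).1 < (Z j).1 →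
      Z j = ray (P j) r ((Z j).1 - (P j).1) → False := by
    intro hjc P hP r hr hlt hray
    obtain ⟨-, -, hnd⟩ := lineChild_of_ray (hU.1 Z hZ j).1 hjc hm' hm0' hr (by omega) hray (hU.2 P hP j).1 (hU.2 P hP j).2.1
    have h0 := nodeLevel_nonneg_of_inDiamond (hU.2 P hP j)
    have := hF j
    omega
  rcases hD g j hgj k m' hk hm' hne' with ⟨r, hr, P, hP, hag, hlt, hray⟩ | ⟨r, hr, P, hP, hag, hlt, hray⟩ |
      ⟨a, b, ha, hb, P, hP, hag2, hlt1, hray1, hlt2, hray2⟩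
  · obtain ⟨hle, hline⟩ := topChild_of_ray (hU.1 Z hZ g).1 hgc hk hk0 hr (by omega) hray (hU.2 P hP g).1 (hU.2 P hP g).2.1
    have h0 := nodeLevel_nonneg_of_inDiamond (hU.2 P hP g)
    have hn : nodeLevel (P g) = nodeLevel (Z g) := by have := hF g; omega
    obtain ⟨ht, hq⟩ := hline hn
    exact ⟨P, hP, (Z g).1 - (P g).1, by omega, hag, by rw [hn]; exact hF g, ht, hq⟩
  · by_cases hj0 : (Z j).2 = (0, 0)
    · exact (hjapex hj0 P hP hlt).elim
    · exact (hjline hj0 P hP r hr hlt hray).elim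
  · by_cases hj0 : (Z j).2 = (0, 0)
    · exact (hjapex hj0 P hP hlt2).elim
    · have hb' : b = m' := hb.elim id fun h' => absurd h'.1 (not_isApex_of_snd_ne hj0)
      rw [hb'] at hray2
      exact (hjline hj0 P hP m' (fin4_ne_add_two m') hlt2 hray2).elim

/-- **(F1), Q-form**: a floor `N`-cell with a charged letter (and the configuration RULE-D closed) has below it a floor `P`-cell agreeing with it off
that letter and of strictly smaller total charge. -/
theorem floorDescent_Q {h : ℤ} {C : MConfig} (hU : C.InDiamond h) {Z : MCell} (hZ : Z ∈ C.lower) (hD : RuleDMu4N C Z) (hF : FloorCell Z)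
    {g : Fin 4} (hgc : (Z g).2 ≠ (0, 0)) :
    ∃ P ∈ C.upper, FloorCell P ∧ MAgree P Z g ∧ totalCharge P < totalCharge Z := by
  obtain ⟨j, hgj⟩ : ∃ j : Fin 4, g ≠ j := ⟨g + 1, by fin_cases g <;> decide⟩
  obtain ⟨P, hP, e, he, hag, hn, -, hq⟩ := floorDescent hU hZ hD hF hgj hgc
  refine ⟨P, hP, fun f => ?_, hag, totalCharge_lt (fun f => ?_) g (by omega)⟩
  · by_cases hfg : f = g
    · subst hfg; exact hn
    · rw [hag f hfg]; exact hF f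
  · by_cases hfg : f = g
    · subst hfg; omega
    · exact le_of_eq (by rw [hag f hfg])


/-! ### (F3) THE FLOOR TWIN — the A2I⁻ swap clause: a floor `N`-cell with a unit letter and an apex forces its own `P`-twin

The first place where an `H₁` instance family (A2I⁻) enters the charge induction.  For a floor `N`-cell `Z` with a charged letter `σ` and an
apex letter `f′`, the A2I⁻ clause with head `Z`, partner `q = Z(σ ↦ O)` (depth `d = |c_σ|`, the guard `d ≤ cabs` is tight) and server
`N′ = q(f′ ↦ Z_σ) = Z ∘ (σ f′)` — the SAME `G₁`-orbit as `Z` — has, inside the diamond, no escape on `σ` in another direction, nothing below the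
origin, no A1W cell, and no spacelike polluter; its only escapes are the shallower `u`-partners `Z − e·σ` (`0 < e < |c_σ|`) and the polluters
`Z(σ ↦ O, f′ ↦ c′ℓ)` (`0 < c′ ≤ |c_σ|`).  For a UNIT letter (`|c_σ| = 1`) both lists collapse to the `P`-TWIN `Z ∘ (σ f′)` as a `P`-cell, and
(F1) forces `q`; so `Z` present ⇒ its `P`-twin present — a nonlevel floor `P`-cell of the same total charge, killed by the `P`-half of the same
induction stage (`edge_Aa`).  Hence these cells LEAVE the seed: (SN3) below. -/

theorem ray_zero' (x : BPoint) (u : Fin 4) : ray x u 0 = x := by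
  obtain ⟨a, b, c⟩ := x
  fin_cases u <;> simp [ray]

/-- for a μ₄ letter the encoder's `cabs` is `|c|`. -/
theorem cabs_eq_absCharge {x : BPoint} (hxax : x.2 = (0, 0) ∨ AxisPt x) : cabs x = absCharge x := by
  obtain ⟨a, b, c⟩ := x
  simp only [cabs, absCharge, chargeOf, AxisPt, Prod.mk.injEq] at *
  rcases hxax with ⟨rfl, rfl⟩ | ⟨-, rfl⟩ | ⟨rfl, -⟩ <;> simp

/-- a floor apex is the origin `O`. -/
theorem floor_apex_eq {h : ℤ} {x : BPoint} (hx : InDiamond h x) (hn : nodeLevel x = 0) (h0 : x.2 = (0, 0)) : x = (0, 0, 0) := by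
  have := absCharge_of_uncharged h0
  obtain ⟨a, b, c⟩ := x
  simp only [nodeLevel, Prod.mk.injEq] at *
  exact ⟨by omega, h0.1, h0.2⟩

/-- an uncharged letter from `|c| = 0`. -/
theorem snd_eq_zero_of_absCharge {x : BPoint} (hxax : x.2 = (0, 0) ∨ AxisPt x) (h0 : absCharge x = 0) : x.2 = (0, 0) := by
  obtain ⟨a, b, c⟩ := x
  simp only [absCharge, chargeOf, AxisPt, Prod.mk.injEq] at *
  rcases hxax with ⟨rfl, rfl⟩ | ⟨hb, rfl⟩ | ⟨rfl, hc⟩ <;> simp_all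

/-- the TOP direction of a charged letter of non-negative node level is its encoder direction. -/
theorem encDir_of_top_dir {x : BPoint} {k : Fin 4} (hxax : x.2 = (0, 0) ∨ AxisPt x) (hc : x.2 ≠ (0, 0)) (hx0 : absCharge x ≤ x.1)
    (hk : Adapted x k) (hk0 : coord x k = x.1 + absCharge x) : EncDir x k := by
  left
  refine ⟨by have := absCharge_nonneg x; omega, ?_⟩
  rw [cabs_eq_absCharge hxax]
  obtain ⟨a, b, c⟩ := x
  simp only [coord, Adapted, absCharge, chargeOf, AxisPt, ray, Prod.mk.injEq, ne_eq] at *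
  fin_cases k <;> simp at hk hk0 hxax hc ⊢ <;> (simp only [abs_eq_max_neg, max_def] at *; split_ifs at * <;> omega)

/-- a floor letter in its encoder direction: `x = ray O u (x.1)`, `x.1 = |c| = cabs x`. -/
theorem floor_letter_ray {h : ℤ} {x : BPoint} {u : Fin 4} (hx : InDiamond h x) (hn : nodeLevel x = 0) (hu : EncDir x u) :
    x = ray (0, 0, 0) u x.1 ∧ x.1 = absCharge x ∧ cabs x = x.1 := by
  have hnl : x.1 = absCharge x := by unfold nodeLevel at hn; omega
  have hcabs : cabs x = absCharge x := cabs_eq_absCharge hx.1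
  refine ⟨?_, hnl, by rw [hcabs, hnl]⟩
  rcases hu with ⟨-, hr⟩ | ⟨hlt, -⟩
  · rw [hcabs, ← hnl, sub_self] at hr; exact hr
  · exfalso; have := hx.2.1; have := absCharge_nonneg x; omega

/-- a floor letter has no strict below-partner in a direction other than its encoder direction (inside the diamond). -/
theorem floor_noOtherDir {h : ℤ} {x y : BPoint} {u w : Fin 4} {d : ℤ} (hx : InDiamond h x) (hn : nodeLevel x = 0) (hu : EncDir x u)
    (hy : InDiamond h y) (hw : w ≠ u) (hd : 0 < d) (hxy : x = ray y w d) : False := by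
  obtain ⟨hray, hlev, -⟩ := floor_letter_ray hx hn hu
  have hyax := hy.1
  have hyle := hy.2.1
  obtain ⟨a, b, c⟩ := y
  obtain ⟨α, β, γ⟩ := x
  simp only [absCharge, chargeOf, AxisPt, ray, Prod.mk.injEq, ne_eq] at *
  fin_cases u <;> fin_cases w <;> simp at hw hray hxy hyax ⊢ <;>
    (simp only [abs_eq_max_neg, max_def] at *; split_ifs at * <;> omega)

/-- no diamond letter is spacelike-separated from the origin. -/
theorem floor_notSpacelike {h : ℤ} {y : BPoint} (hy : InDiamond h y) : ¬ Spacelike (bsub y (0, 0, 0)) := by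
  have hyax := hy.1
  have hyle := hy.2.1
  obtain ⟨a, b, c⟩ := y
  simp only [Spacelike, absCharge, chargeOf, AxisPt, Prod.mk.injEq, not_lt] at *
  rcases hyax with ⟨rfl, rfl⟩ | ⟨-, rfl⟩ | ⟨rfl, -⟩
  · simp; nlinarith
  · simp at hyle ⊢
    have h1 : |b| * |b| ≤ a * a := mul_le_mul hyle hyle (abs_nonneg b) (le_trans (abs_nonneg b) hyle)
    nlinarith [sq_abs b, abs_mul_abs_self b]
  · simp at hyle ⊢
    have h1 : |c| * |c| ≤ a * a := mul_le_mul hyle hyle (abs_nonneg c) (le_trans (abs_nonneg c) hyle)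
    nlinarith [sq_abs c, abs_mul_abs_self c]

/-- **(F3) THE FLOOR TWIN** (KERNEL, every `h`): a floor `N`-cell `Z ∈ C.lower` with a UNIT letter `σ` and an apex letter `f′`, whose partner
`q = Z(σ ↦ O)` is present, in an A2I⁻-closed configuration with `S₄`-closed lower level in the diamond, has its `P`-TWIN present: a
`P ∈ C.upper` with `Z`'s letters, `σ` and `f′` swapped. -/
theorem floorTwin {h : ℤ} {C : MConfig} (hU : C.InDiamond h) (hA : A2IMinusClosed C) (hPl : PermClosed C.lower)
    {Z : MCell} (hZ : Z ∈ C.lower) (hF : FloorCell Z) {σ f' : Fin 4} (hσf : σ ≠ f') (hσ1 : absCharge (Z σ) = 1)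
    (hf' : (Z f').2 = (0, 0)) {q : MCell} (hq : q ∈ C.upper) (hqa : MAgree q Z σ) (hqσ : q σ = Z f') :
    ∃ P ∈ C.upper, (∀ g, g ≠ σ → g ≠ f' → P g = Z g) ∧ P σ = Z f' ∧ P f' = Z σ := by
  have hZσD := hU.1 Z hZ σ
  have hZf'D := hU.1 Z hZ f'
  have hσc : (Z σ).2 ≠ (0, 0) := fun h0 => by have := absCharge_of_uncharged h0; omega
  have hO : Z f' = (0, 0, 0) := floor_apex_eq hZf'D (hF f') hf'
  obtain ⟨u, hk, hk0⟩ := exists_top_dir hZσD.1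
  have hu : EncDir (Z σ) u := encDir_of_top_dir hZσD.1 hσc hZσD.2.1 hk hk0
  obtain ⟨hray, hlev, hcabs⟩ := floor_letter_ray hZσD (hF σ) hu
  have h11 : (Z σ).1 = 1 := by omega
  -- the server N' = Z ∘ (σ f')
  have hN' : Z.perm (Equiv.swap σ f') ∈ C.lower := hPl _ Z hZ
  have hN'σ : Z.perm (Equiv.swap σ f') σ = Z f' := by simp [MCell.perm_apply, Equiv.swap_apply_left]
  have hN'f : Z.perm (Equiv.swap σ f') f' = Z σ := by simp [MCell.perm_apply, Equiv.swap_apply_right]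
  have hN'g : ∀ g, g ≠ σ → g ≠ f' → Z.perm (Equiv.swap σ f') g = Z g := fun g h1 h2 => by
    simp [MCell.perm_apply, Equiv.swap_apply_of_ne_of_ne h1 h2]
  by_contra hno
  push Not at hno
  apply hA Z hZ q hq _ hN' σ u f' u
  refine ⟨not_isApex_of_snd_ne hσc, hu, ⟨hqa, ?_, ?_⟩, ?_, hσf.symm, ⟨?_, ?_, ?_⟩, ?_, ?_, ?_, ?_, ?_⟩
  · rw [hqσ, hO]; simp; omega
  · rw [hqσ, hO]; simpa using hray
  · intro _; rw [hqσ, hO, hcabs]; simp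
  · intro g hg
    by_cases hgs : g = σ
    · rw [hgs, hqσ, hN'σ]
    · rw [hqa g hgs, hN'g g hgs hg]
  · rw [hqa f' hσf.symm, hN'f, hO]; simp; omega
  · rw [hqa f' hσf.symm, hN'f, hO]; simpa using hray
  · -- no partner on σ in another direction
    rintro P hP w hw ⟨-, hlt, hrayw⟩
    exact floor_noOtherDir hZσD (hF σ) hu (hU.2 P hP σ) hw (by omega) hrayw
  · -- shallower u-partners have their σ-letter at level 0
    rintro P hP ⟨-, hlt, -⟩
    rw [hqσ, hO]
    have := (hU.2 P hP σ).2.1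
    have := absCharge_nonneg (P σ)
    simp; omega
  · -- nothing strictly below the origin
    rintro P hP ⟨-, hlt, -⟩
    rw [hqσ, hO] at hlt
    have := (hU.2 P hP σ).2.1
    have := absCharge_nonneg (P σ)
    simp at hlt; omega
  · -- A1W: nothing null-below the origin
    intro P hP hnb
    exfalso
    rw [hO] at hnb
    have h1 : (P f').1 < 0 := by simpa using hnb.1
    have h2 := (hU.2 P hP f').2.1
    have h3 := absCharge_nonneg (P f')
    omega
  · -- polluters: the only candidate inside the diamond is the twin itself
    intro P hP hPg hline
    have hPσD := hU.2 P hP σ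
    have hPσ : P σ = Z f' := by
      obtain ⟨hle, hr⟩ := hline
      rw [hqσ, hO] at hle hr
      have h0 : (P σ).1 = 0 := by have := hPσD.2.1; have := absCharge_nonneg (P σ); simp at hle; omega
      rw [h0, sub_zero, ray_zero'] at hr
      rw [hO]; exact hr.symm
    refine ⟨?_, ?_⟩
    · rintro ⟨h1, h2, h3⟩
      rw [hN'f] at h2
      rw [hO] at h1 h3
      have h1' : (P f').1 = 1 := by simp at h1; omega
      apply hno P hP hPg hPσ
      rw [h3, hray, h1', h11]; simp
    · rintro ⟨-, hsp⟩
      rw [hO] at hsp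
      exact floor_notSpacelike (hU.2 P hP f') hsp

/-- **(F1) + (F3)**: in a RULE-D-closed, A2I⁻-closed configuration with `S₄`-closed lower level in the diamond, a floor `N`-cell with a unit
letter `σ` and an apex letter `f′ ≠ σ` has its `P`-twin `Z ∘ (σ f′) ∈ C.upper`. -/
theorem floorTwin_present {h : ℤ} {C : MConfig} (hU : C.InDiamond h) (hA : A2IMinusClosed C) (hPl : PermClosed C.lower)
    {Z : MCell} (hZ : Z ∈ C.lower) (hD : RuleDMu4N C Z) (hF : FloorCell Z) {σ f' : Fin 4} (hσf : σ ≠ f') (hσ1 : absCharge (Z σ) = 1)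
    (hf' : (Z f').2 = (0, 0)) : Z.perm (Equiv.swap σ f') ∈ C.upper := by
  have hσc : (Z σ).2 ≠ (0, 0) := fun h0 => by have := absCharge_of_uncharged h0; omega
  obtain ⟨q, hq, e, he, hag, hn, -, hqc⟩ := floorDescent hU hZ hD hF hσf hσc
  have hq0 : absCharge (q σ) = 0 := by have := absCharge_nonneg (q σ); omega
  have hqσ : q σ = Z f' := by
    rw [floor_apex_eq (hU.1 Z hZ f') (hF f') hf']
    exact floor_apex_eq (hU.2 q hq σ) hn (snd_eq_zero_of_absCharge (hU.2 q hq σ).1 hq0)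
  obtain ⟨P, hP, hg, hs, hf⟩ := floorTwin hU hA hPl hZ hF hσf hσ1 hf' hq hag hqσ
  have hPe : P = Z.perm (Equiv.swap σ f') := by
    funext g
    by_cases h1 : g = σ
    · subst h1; rw [hs]; simp [MCell.perm_apply, Equiv.swap_apply_left]
    · by_cases h2 : g = f'
      · subst h2; rw [hf]; simp [MCell.perm_apply, Equiv.swap_apply_right]
      · rw [hg g h1 h2]; simp [MCell.perm_apply, Equiv.swap_apply_of_ne_of_ne h1 h2]
  exact hPe ▸ hP



/-! ### (F3′) the general FLOOR SWAP clause (any charge): the escapes are the shallower partners `Z − e·σ` and the polluters `Z(σ ↦ O, f′ ↦ c′ℓ)` -/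

/-- **(F3′) THE FLOOR SWAP CLAUSE** (KERNEL, every `h`, any charge `c = |c_σ| ≥ 1`): a floor `N`-cell `Z ∈ C.lower` with a charged letter `σ`
(encoder direction `u`) and an apex letter `f′`, whose bottom partner `q = Z(σ ↦ O)` is present, in an A2I⁻-closed configuration with `S₄`-closed
lower level in the diamond, has present EITHER a shallower `u`-partner (a floor `P`-cell `Z − e·σ`, `0 < e < c`: it agrees with `Z` off `σ` and its
`σ`-letter lies strictly between `O` and `Z σ` on the ray) OR a polluter `Z(σ ↦ O, f′ ↦ c′·ℓ_u)` with `0 < c′ ≤ c` (for `c′ = c`: the `P`-twin). -/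
theorem floorSwap {h : ℤ} {C : MConfig} (hU : C.InDiamond h) (hA : A2IMinusClosed C) (hPl : PermClosed C.lower)
    {Z : MCell} (hZ : Z ∈ C.lower) (hF : FloorCell Z) {σ f' u : Fin 4} (hσf : σ ≠ f') (hσc : (Z σ).2 ≠ (0, 0)) (hu : EncDir (Z σ) u)
    (hf' : (Z f').2 = (0, 0)) {q : MCell} (hq : q ∈ C.upper) (hqa : MAgree q Z σ) (hqσ : q σ = Z f') :
    (∃ P ∈ C.upper, MAgree P Z σ ∧ 0 < (P σ).1 ∧ (P σ).1 < (Z σ).1 ∧ Z σ = ray (P σ) u ((Z σ).1 - (P σ).1)) ∨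
      ∃ P ∈ C.upper, (∀ g, g ≠ σ → g ≠ f' → P g = Z g) ∧ P σ = Z f' ∧ 0 < (P f').1 ∧ (P f').1 ≤ (Z σ).1 ∧
        P f' = ray (Z f') u (P f').1 := by
  have hZσD := hU.1 Z hZ σ
  have hZf'D := hU.1 Z hZ f'
  have hO : Z f' = (0, 0, 0) := floor_apex_eq hZf'D (hF f') hf'
  obtain ⟨hray, hlev, hcabs⟩ := floor_letter_ray hZσD (hF σ) hu
  have hcpos : 0 < (Z σ).1 := by
    have := absCharge_pos_of_not_isApex hZσD.1 (fun ha => hσc ((isApex_iff_snd _).1 ha)); omega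
  have hN' : Z.perm (Equiv.swap σ f') ∈ C.lower := hPl _ Z hZ
  have hN'σ : Z.perm (Equiv.swap σ f') σ = Z f' := by simp [MCell.perm_apply, Equiv.swap_apply_left]
  have hN'f : Z.perm (Equiv.swap σ f') f' = Z σ := by simp [MCell.perm_apply, Equiv.swap_apply_right]
  have hN'g : ∀ g, g ≠ σ → g ≠ f' → Z.perm (Equiv.swap σ f') g = Z g := fun g h1 h2 => by
    simp [MCell.perm_apply, Equiv.swap_apply_of_ne_of_ne h1 h2]
  by_contra hno
  push Not at hno
  obtain ⟨hno1, hno2⟩ := hno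
  apply hA Z hZ q hq _ hN' σ u f' u
  refine ⟨not_isApex_of_snd_ne hσc, hu, ⟨hqa, ?_, ?_⟩, ?_, hσf.symm, ⟨?_, ?_, ?_⟩, ?_, ?_, ?_, ?_, ?_⟩
  · rw [hqσ, hO]; simpa using hcpos
  · rw [hqσ, hO]; simpa using hray
  · intro _; rw [hqσ, hO, hcabs]; simp
  · intro g hg
    by_cases hgs : g = σ
    · rw [hgs, hqσ, hN'σ]
    · rw [hqa g hgs, hN'g g hgs hg]
  · rw [hqa f' hσf.symm, hN'f, hO]; simpa using hcpos
  · rw [hqa f' hσf.symm, hN'f, hO]; simpa using hray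
  · rintro P hP w hw ⟨-, hlt, hrayw⟩
    exact floor_noOtherDir hZσD (hF σ) hu (hU.2 P hP σ) hw (by omega) hrayw
  · -- a shallower u-partner with σ-letter above level 0 is the first alternative
    rintro P hP ⟨hag, hlt, hr⟩
    rw [hqσ, hO]
    by_contra hpos
    exact hno1 P hP hag (by simp at hpos; omega) hlt hr
  · rintro P hP ⟨-, hlt, -⟩
    rw [hqσ, hO] at hlt
    have := (hU.2 P hP σ).2.1
    have := absCharge_nonneg (P σ)
    simp at hlt; omega
  · intro P hP hnb
    exfalso
    rw [hO] at hnb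
    have h1 : (P f').1 < 0 := by simpa using hnb.1
    have h2 := (hU.2 P hP f').2.1
    have h3 := absCharge_nonneg (P f')
    omega
  · intro P hP hPg hline
    have hPσD := hU.2 P hP σ
    have hPσ : P σ = Z f' := by
      obtain ⟨hle, hr⟩ := hline
      rw [hqσ, hO] at hle hr
      have h0 : (P σ).1 = 0 := by have := hPσD.2.1; have := absCharge_nonneg (P σ); simp at hle; omega
      rw [h0, sub_zero, ray_zero'] at hr
      rw [hO]; exact hr.symm
    refine ⟨?_, ?_⟩
    · rintro ⟨h1, h2, h3⟩
      rw [hN'f] at h2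
      rw [hO] at h1 h3
      have h1' : 0 < (P f').1 := by simpa using h1
      refine hno2 P hP hPg hPσ h1' h2 ?_
      rw [hO]; simpa using h3
    · rintro ⟨-, hsp⟩
      rw [hO] at hsp
      exact floor_notSpacelike (hU.2 P hP f') hsp


/-- a point on the ray from the origin in direction `u` at non-negative height `e` is a floor letter of charge `e` (or `O`). -/
theorem floor_of_ray_origin {y : BPoint} {u : Fin 4} {e : ℤ} (he : 0 ≤ e) (hy : y = ray (0, 0, 0) u e) :
    nodeLevel y = 0 ∧ absCharge y = e ∧ y.1 = e := by
  subst hy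
  simp only [nodeLevel, absCharge, chargeOf]
  fin_cases u <;> simp [abs_of_nonneg he]

/-- a diamond letter strictly below a floor letter along its encoder direction is a floor letter (on the same ray from `O`). -/
theorem floor_of_uPartner {h : ℤ} {x y : BPoint} {u : Fin 4} (hx : InDiamond h x) (hn : nodeLevel x = 0) (hu : EncDir x u)
    (hy : InDiamond h y) (hlt : y.1 < x.1) (hxy : x = ray y u (x.1 - y.1)) : nodeLevel y = 0 ∧ absCharge y = y.1 := by
  obtain ⟨hray, hlev, -⟩ := floor_letter_ray hx hn hu
  have hyle := hy.2.1
  have h0 := absCharge_nonneg y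
  -- y = ray O u (y.1): compare the two ray expressions for x
  have hyeq : y = ray (0, 0, 0) u y.1 := by
    obtain ⟨a, b, c⟩ := y
    obtain ⟨α, β, γ⟩ := x
    simp only [ray, Prod.mk.injEq] at hray hxy ⊢
    fin_cases u <;> simp at hray hxy ⊢ <;> omega
  have := floor_of_ray_origin (le_trans h0 hyle) hyeq
  exact ⟨this.1, this.2.1⟩

/-- **THE FLOOR CHAIN** ((F1) + (F3′), KERNEL, every `h`): a floor `N`-cell `Z ∈ C.lower` with a charged letter `σ` and an apex letter `f′`, in a
RULE-D-closed (at `Z`), A2I⁻-closed configuration with `S₄`-closed lower level in the diamond, has present EITHER a floor `P`-cell agreeing with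
`Z` off `σ` whose `σ`-letter is charged and of smaller charge (a partial descent `Z − e·σ`, `0 < e < |c_σ|`) OR a polluter `Z(σ ↦ O, f′ ↦ c′ℓ)`,
`0 < c′ ≤ |c_σ|` (a floor `P`-cell; `c′ = |c_σ|` is the `P`-twin).  For a unit letter only the twin remains (`floorTwin_present`). -/
theorem floorChain {h : ℤ} {C : MConfig} (hU : C.InDiamond h) (hA : A2IMinusClosed C) (hPl : PermClosed C.lower)
    {Z : MCell} (hZ : Z ∈ C.lower) (hD : RuleDMu4N C Z) (hF : FloorCell Z) {σ f' : Fin 4} (hσf : σ ≠ f') (hσc : (Z σ).2 ≠ (0, 0))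
    (hf' : (Z f').2 = (0, 0)) :
    (∃ P ∈ C.upper, MAgree P Z σ ∧ nodeLevel (P σ) = 0 ∧ 0 < absCharge (P σ) ∧ absCharge (P σ) < absCharge (Z σ)) ∨
      ∃ P ∈ C.upper, (∀ g, g ≠ σ → g ≠ f' → P g = Z g) ∧ P σ = Z f' ∧ nodeLevel (P f') = 0 ∧ 0 < absCharge (P f') ∧
        absCharge (P f') ≤ absCharge (Z σ) := by
  have hZσD := hU.1 Z hZ σ
  obtain ⟨u, hk, hk0⟩ := exists_top_dir hZσD.1
  have hu : EncDir (Z σ) u := encDir_of_top_dir hZσD.1 hσc hZσD.2.1 hk hk0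
  obtain ⟨-, hlev, -⟩ := floor_letter_ray hZσD (hF σ) hu
  obtain ⟨P₀, hP₀, e, he, hag, hn, -, hqc⟩ := floorDescent hU hZ hD hF hσf hσc
  by_cases h0 : absCharge (P₀ σ) = 0
  · -- the full descent is present: apply the swap clause
    have hqσ : P₀ σ = Z f' := by
      rw [floor_apex_eq (hU.1 Z hZ f') (hF f') hf']
      exact floor_apex_eq (hU.2 P₀ hP₀ σ) hn (snd_eq_zero_of_absCharge (hU.2 P₀ hP₀ σ).1 h0)
    rcases floorSwap hU hA hPl hZ hF hσf hσc hu hf' hP₀ hag hqσ with ⟨P, hP, hagP, hpos, hlt, hr⟩ | ⟨P, hP, hg, hs, hpos, hle, hr⟩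
    · left
      obtain ⟨hnP, hcP⟩ := floor_of_uPartner hZσD (hF σ) hu (hU.2 P hP σ) hlt hr
      exact ⟨P, hP, hagP, hnP, by omega, by omega⟩
    · right
      have hO : Z f' = (0, 0, 0) := floor_apex_eq (hU.1 Z hZ f') (hF f') hf'
      rw [hO] at hr
      obtain ⟨hnP, hcP, -⟩ := floor_of_ray_origin (le_of_lt hpos) hr
      exact ⟨P, hP, hg, hs, hnP, by omega, by omega⟩
  · left
    have := absCharge_nonneg (P₀ σ)
    exact ⟨P₀, hP₀, hag, hn, by omega, by omega⟩

/-! ### (SN3): the floor cells with a unit letter and an apex leave the seed -/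

/-- a floor cell with a UNIT letter and an apex letter (the (F1)+(F3) shape). Decidable. -/
def FloorUnitApex (Z : MCell) : Prop := FloorCell Z ∧ (∃ σ, absCharge (Z σ) = 1) ∧ ∃ f, (Z f).2 = (0, 0)

/-- the THIRD seed shape: (SN2) minus the floor-unit-apex cells. -/
def SeedShapeN3 (Z : MCell) : Prop := (NodeFlat Z ∧ ¬ FloorUnitApex Z) ∨ HighTwin Z

/-- **(SN3) locally**: every nonlevel-excluded … every present `N`-cell of the third seed shape with ≥ 2 charged letters is level. -/
def SeedN3Local (C : MConfig) : Prop := ∀ Z ∈ C.lower, 2 ≤ chargeCount Z → SeedShapeN3 Z → LevelCell Z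

/-- **(SN3_h) THE THIRD `N`-SEED** (census UP-fact as a sub-law of (SN2_h): ◇₈ 1 741 − 128 = 1 613 orbits). -/
def SeedN3Law (h : ℤ) : Prop := ∀ C : MConfig, C.InDiamond h → C.G1Closed → C.StaticH1 → SeedN3Local C

theorem seedN3Local_of_seedN2Local {C : MConfig} (H : SeedN2Local C) : SeedN3Local C :=
  fun Z hZ h2 hs => H Z hZ h2 (hs.elim (fun h1 => Or.inl h1.1) Or.inr)

theorem seedN3Law_of_seedN2Law {h : ℤ} (H : SeedN2Law h) : SeedN3Law h := fun C hU hG hS => seedN3Local_of_seedN2Local (H C hU hG hS)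

theorem seedN3Law_antitone {h h' : ℤ} (hh : h ≤ h') (H : SeedN3Law h') : SeedN3Law h :=
  fun C hU hG hS => H C (inDiamond_config_mono hh hU) hG hS

theorem exists_charged_ne {Z : MCell} (h2 : 2 ≤ chargeCount Z) (σ : Fin 4) : ∃ g, g ≠ σ ∧ (Z g).2 ≠ (0, 0) := by
  by_contra hall
  push Not at hall
  unfold chargeCount at h2
  have hsub : Finset.univ.filter (fun f : Fin 4 => (Z f).2 ≠ (0, 0)) ⊆ {σ} := by
    intro x hx
    simp only [Finset.mem_filter, Finset.mem_univ, true_and] at hx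
    simp only [Finset.mem_singleton]
    by_contra hxs
    exact hx (hall x hxs)
  have := Finset.card_le_card hsub
  rw [Finset.card_singleton] at this
  omega

theorem totalCharge_swap (Z : MCell) (σ f' : Fin 4) : totalCharge (Z.perm (Equiv.swap σ f')) = totalCharge Z := by
  fin_cases σ <;> fin_cases f' <;> simp [totalCharge, MCell.perm_apply, Equiv.swap_apply_def] <;> omega

theorem levelCell_of_swap {Z : MCell} {σ f' : Fin 4} (hL : LevelCell (Z.perm (Equiv.swap σ f'))) : LevelCell Z := by
  intro f g
  have := hL (Equiv.swap σ f' f) (Equiv.swap σ f' g)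
  simpa [MCell.perm_apply, Equiv.swap_apply_self] using this

theorem levelLocal_induction3 {h : ℤ} {C : MConfig} (hU : C.InDiamond h) (hD : RuleDMu4Closed C) (hA : A2IMinusClosed C) (hPl : PermClosed C.lower)
    (hCD : CDIneq C) (hSN : SeedN3Local C) (hSP : SeedPLocal C) (n : ℕ) :
    (∀ Z ∈ C.lower, 2 * h - totalCharge Z ≤ n → 2 ≤ chargeCount Z → LevelCell Z) ∧
      (∀ P ∈ C.upper, 2 * h - totalCharge P ≤ n → 2 ≤ chargeCount P → (3 ≤ chargeCount P ∨ ¬ HighP P) → LevelCell P) := by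
  induction n using Nat.strong_induction_on with
  | _ n IH =>
  have hPn : ∀ P ∈ C.upper, 2 * h - totalCharge P ≤ n → 2 ≤ chargeCount P → (3 ≤ chargeCount P ∨ ¬ HighP P) → LevelCell P := by
    intro P hP hμ h2 h23
    by_contra hnl
    by_cases hHi : HighP P
    · exact h23.elim (fun h3 => hnl (hSP P hP h3 hHi)) fun hnh => hnh hHi
    obtain ⟨f₀, hf₀c, hlt₀⟩ : ∃ f₀, (P f₀).2 ≠ (0, 0) ∧ nodeLevel (P f₀) < 2 * (chargeCount P : ℤ) := by
      by_contra hall; push Not at hall; exact hHi hall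
    have hK : KillAbove C P := by
      intro N hN hcnt hnodes hQ
      by_cases hNl : LevelCell N
      · have h1 := hCD.2 N hN hNl f₀ (hnodes f₀ hf₀c).1
        rw [(hnodes f₀ hf₀c).2] at h1
        have h2' : (chargeCount P : ℤ) ≤ chargeCount N := by exact_mod_cast hcnt
        omega
      · have hQN := totalCharge_le_of_inDiamond (hU.1 N hN)
        have hn1 : n - 1 < n := by omega
        exact hNl ((IH (n - 1) hn1).1 N hN (by omega) (by omega))
    by_cases hAA : ∃ f g, (P f).2 ≠ (0, 0) ∧ (P g).2 ≠ (0, 0) ∧ causalTop (P f) ≠ causalTop (P g)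
    · obtain ⟨f, g, hfc, hgc, hne⟩ := hAA
      exact edge_AA hU hP (hD.2 P hP) (fun e => hne (by rw [e])) hfc hgc hne hK
    · push Not at hAA
      obtain ⟨g, hg⟩ : ∃ g, causalTop (P g) ≠ causalTop (P f₀) := by
        by_contra hall; push Not at hall; exact hnl fun f f' => by rw [hall f, hall f']
      have hg0 : (P g).2 = (0, 0) := by
        by_contra hgc; exact hg (hAA g f₀ hgc hf₀c)
      exact edge_Aa hU hP (hD.2 P hP) hf₀c hg0 (by rw [← causalTop_of_uncharged hg0]; exact fun e => hg e.symm) hK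
  refine ⟨fun Z hZ hμ h2 => ?_, hPn⟩
  · by_contra hnl
    -- (F1)+(F3): a floor cell with a unit letter and an apex forces its `P`-twin, which the `P`-half of THIS stage kills; other node-flat cells are seeds
    have hNF : ¬ NodeFlat Z := by
      intro hF
      by_cases hfu : FloorUnitApex Z
      · obtain ⟨hFl, ⟨σ, hσ1⟩, ⟨f', hf'⟩⟩ := hfu
        have hσc : (Z σ).2 ≠ (0, 0) := fun h0 => by have := absCharge_of_uncharged h0; omega
        have hσf : σ ≠ f' := fun e => hσc (by rw [e]; exact hf')
        have htw := floorTwin_present hU hA hPl hZ (hD.1 Z hZ) hFl hσf hσ1 hf'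
        obtain ⟨g, hgσ, hgc⟩ := exists_charged_ne h2 σ
        have hgf : g ≠ f' := fun e => hgc (by rw [e]; exact hf')
        have hTf : Z.perm (Equiv.swap σ f') f' = Z σ := by simp [MCell.perm_apply, Equiv.swap_apply_right]
        have hTg : Z.perm (Equiv.swap σ f') g = Z g := by simp [MCell.perm_apply, Equiv.swap_apply_of_ne_of_ne hgσ hgf]
        have h2' : 2 ≤ chargeCount (Z.perm (Equiv.swap σ f')) :=
          two_le_chargeCount hgf.symm (by rw [hTf]; exact hσc) (by rw [hTg]; exact hgc)
        have hnh : ¬ HighP (Z.perm (Equiv.swap σ f')) := fun hH => by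
          have h1 := hH f' (by rw [hTf]; exact hσc)
          rw [hTf, hFl σ] at h1
          have : (2 : ℤ) ≤ chargeCount (Z.perm (Equiv.swap σ f')) := by exact_mod_cast h2'
          omega
        have hlev := hPn _ htw (by rw [totalCharge_swap]; exact hμ) h2' (Or.inr hnh)
        exact hnl (levelCell_of_swap hlev)
      · exact hnl (hSN Z hZ h2 (Or.inl ⟨hF, hfu⟩))
    -- the induction hypothesis kills every same-tops `P`-child of larger `Q` with ≥ 3 charged letters, or with 2 and not high
    have hKillP : ∀ P ∈ C.upper, 2 ≤ chargeCount P → (3 ≤ chargeCount P ∨ ¬ HighP P) → (∀ f, causalTop (P f) = causalTop (Z f)) →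
        totalCharge Z < totalCharge P → False := by
      intro P hP hP2 hP3 htops hQ
      have hQP := totalCharge_le_of_inDiamond (hU.2 P hP)
      have hn1 : n - 1 < n := by omega
      have hPl : LevelCell P := (IH (n - 1) hn1).2 P hP (by omega) hP2 hP3
      exact hnl fun f f' => by rw [← htops f, ← htops f']; exact hPl f f'
    have hK1 : KillBelow C Z (chargeCount Z + 1) := fun P hP hcnt htops hQ => hKillP P hP (by omega) (Or.inl (by omega)) htops hQ
    rcases Nat.lt_or_ge 2 (chargeCount Z) with h3 | hle2
    · -- at least three charged letters: not node-flat, so an edge (tt) or (at) exists (as in §5)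
      have hK : KillBelow C Z (chargeCount Z) := fun P hP hcnt htops hQ => hKillP P hP (by omega) (Or.inl (by omega)) htops hQ
      have hnf : ¬ NodeFlat Z := hNF
      obtain ⟨f, g, hfg'⟩ : ∃ f g, nodeLevel (Z f) ≠ nodeLevel (Z g) := by
        by_contra hall; push Not at hall; exact hnf hall
      have hfg : f ≠ g := fun e => hfg' (by rw [e])
      by_cases hf0 : (Z f).2 = (0, 0)
      · by_cases hg0 : (Z g).2 = (0, 0)
        · exact charged_of_three h3 hg0 hfg hf0
        · exact edge_at hU hZ (hD.1 Z hZ) hf0 hg0 (by rw [← nodeLevel_of_uncharged hf0]; exact hfg') hK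
      · by_cases hg0 : (Z g).2 = (0, 0)
        · exact edge_at hU hZ (hD.1 Z hZ) hg0 hf0 (by rw [← nodeLevel_of_uncharged hg0]; exact fun e => hfg' e.symm) hK
        · exact edge_tt hU hZ (hD.1 Z hZ) hfg hf0 hg0 hfg' hK
    · -- exactly two charged letters
      have h2e : chargeCount Z = 2 := le_antisymm hle2 h2
      have hnf : ¬ NodeFlat Z := hNF
      by_cases hT : TwinApex2 Z
      · -- twin-apex but not a high twin
        have hnh : ¬ HighTwin Z := fun hH => hnl (hSN Z hZ h2 (Or.inr hH))
        have hKat : ∀ j, (Z j).2 ≠ (0, 0) → nodeLevel (Z j) ≤ 4 → KillBelowAt C Z j := by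
          intro j hjc hj4 P hP htops hQ hPj hor
          rcases hor with hcnt | ⟨hcnt, hnd⟩
          · exact hKillP P hP (by omega) (Or.inl (by omega)) htops hQ
          · refine hKillP P hP (by omega) (Or.inr fun hH => ?_) htops hQ
            have := hH j hPj
            rw [hcnt, h2e] at this
            push_cast at this
            omega
        have hKtt : ∀ g, (Z g).2 ≠ (0, 0) → nodeLevel (Z g) < 4 → KillBelowTT C Z g := by
          intro g hgc hg4 P hP htops hQ hcnt hPg hnd
          refine hKillP P hP (by omega) (Or.inr fun hH => ?_) htops hQ
          have := hH g hPg
          rw [hcnt, h2e] at this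
          push_cast at this
          omega
        by_cases hlow : ∃ f, (Z f).2 ≠ (0, 0) ∧ nodeLevel (Z f) < 4
        · -- a low charged letter f: an apex off its node gives (at); else the other charged letter has another node: (tt)
          obtain ⟨f, hfc, hf4⟩ := hlow
          by_cases hapx : ∃ g, (Z g).2 = (0, 0) ∧ (Z g).1 ≠ nodeLevel (Z f)
          · obtain ⟨g, hg0, hne⟩ := hapx
            exact edge_at_info hU hZ (hD.1 Z hZ) hg0 hfc hne (hKat f hfc (by omega))
          · push Not at hapx
            obtain ⟨j, hj⟩ : ∃ j, nodeLevel (Z j) ≠ nodeLevel (Z f) := by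
              by_contra hall; push Not at hall; exact hnf fun a b => by rw [hall a, hall b]
            have hjc : (Z j).2 ≠ (0, 0) := fun hj0 => hj (by rw [nodeLevel_of_uncharged hj0]; exact hapx j hj0)
            have hfj : f ≠ j := fun e => hj (by rw [e])
            exact edge_tt_info hU hZ (hD.1 Z hZ) hfj hfc hjc (fun e => hj e.symm) (hKtt f hfc hf4)
        · -- all charged letters of node ≥ 4: not a high twin ⇒ a node-4 letter under an apex of level ≠ 4: (at)
          push Not at hlow
          have hC : ¬ ∀ f g, (Z f).2 ≠ (0, 0) → nodeLevel (Z f) = 4 → (Z g).2 = (0, 0) → (Z g).1 = 4 := fun hC => hnh ⟨hT, hlow, hC⟩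
          push Not at hC
          obtain ⟨f, g, hfc, hf4, hg0, hg4⟩ := hC
          exact edge_at_info hU hZ (hD.1 Z hZ) hg0 hfc (by rw [hf4]; exact hg4) (hKat f hfc (le_of_eq hf4))
      · -- not twin-apex: an edge (aa) or (at-floor) exists (as in §5)
        by_cases hB : ∀ f g, (Z f).2 = (0, 0) → (Z g).2 = (0, 0) → (Z f).1 = (Z g).1
        · have hC : ¬ ∀ f g, (Z f).2 = (0, 0) → (Z g).2 ≠ (0, 0) → nodeLevel (Z g) = 0 → (Z f).1 = 0 := fun hC => hT ⟨hle2, hB, hC⟩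
          push Not at hC
          obtain ⟨f, g, hf0, hgc, hg0n, hfne⟩ := hC
          exact edge_at_floor hU hZ (hD.1 Z hZ) hf0 hgc hg0n hfne hK1
        · push Not at hB
          obtain ⟨f, g, hf0, hg0, hne⟩ := hB
          have hfg : f ≠ g := fun e => hne (by rw [e])
          exact edge_aa hU hZ (hD.1 Z hZ) hfg hf0 hg0 hne hK1

/-- **(CD) ∧ (SN3) ∧ (SP) ⇒ (LVN) ∧ (LVP3) ∧ (LVP2⁻), locally** (KERNEL, every `h`; uses A2I⁻ and the `S₄`-closure of the lower level). -/
theorem levelLocal_of_cd_seeds3 {h : ℤ} {C : MConfig} (hU : C.InDiamond h) (hD : RuleDMu4Closed C) (hA : A2IMinusClosed C) (hPl : PermClosed C.lower)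
    (hCD : CDIneq C) (hSN : SeedN3Local C) (hSP : SeedPLocal C) :
    (∀ Z ∈ C.lower, 2 ≤ chargeCount Z → LevelCell Z) ∧ (∀ P ∈ C.upper, 3 ≤ chargeCount P → LevelCell P) ∧
      (∀ P ∈ C.upper, 2 ≤ chargeCount P → ¬ HighP P → LevelCell P) := by
  refine ⟨fun Z hZ h2 => ?_, fun P hP h3 => ?_, fun P hP h2 hnh => ?_⟩
  · have h0 := totalCharge_nonneg Z
    exact (levelLocal_induction3 hU hD hA hPl hCD hSN hSP (2 * h - totalCharge Z).toNat).1 Z hZ (Int.self_le_toNat _) h2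
  · have h0 := totalCharge_nonneg P
    exact (levelLocal_induction3 hU hD hA hPl hCD hSN hSP (2 * h - totalCharge P).toNat).2 P hP (Int.self_le_toNat _) (by omega) (Or.inl h3)
  · have h0 := totalCharge_nonneg P
    exact (levelLocal_induction3 hU hD hA hPl hCD hSN hSP (2 * h - totalCharge P).toNat).2 P hP (Int.self_le_toNat _) h2 (Or.inr hnh)

theorem levelNLaw_of_cd_seeds3 {h : ℤ} (hCD : ChargeDepthLaw h) (hSN : SeedN3Law h) (hSP : SeedPLaw h) : LevelNLaw h :=
  fun C hU hG hS => (levelLocal_of_cd_seeds3 hU hS.1 hS.2.2 hG.1 (hCD C hU hG hS) (hSN C hU hG hS) (hSP C hU hG hS)).1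

theorem levelP3Law_of_cd_seeds3 {h : ℤ} (hCD : ChargeDepthLaw h) (hSN : SeedN3Law h) (hSP : SeedPLaw h) : LevelP3Law h :=
  fun C hU hG hS => (levelLocal_of_cd_seeds3 hU hS.1 hS.2.2 hG.1 (hCD C hU hG hS) (hSN C hU hG hS) (hSP C hU hG hS)).2.1

theorem levelP2LowLaw_of_cd_seeds3 {h : ℤ} (hCD : ChargeDepthLaw h) (hSN : SeedN3Law h) (hSP : SeedPLaw h) : LevelP2LowLaw h :=
  fun C hU hG hS => (levelLocal_of_cd_seeds3 hU hS.1 hS.2.2 hG.1 (hCD C hU hG hS) (hSN C hU hG hS) (hSP C hU hG hS)).2.2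

/-- **(T₈) ⟸ (CD-P₈) ∧ (CDN4₈) ∧ (SN3₈) ∧ (SP₈)** (KERNEL glue, v4).  Census sizes (j318002 h8 `a459e02921a60310`): 1 745 + 100 + 1 613 + 20 = 3 478
orbits.  NOT a proof of (T₈); HC ∕ HC_CM ∕ HC_AV ∕ H2 NOT proved. -/
theorem seedB1Odd_eight_of_cdP_seeds3 (hP : ChargeDepthPLaw 8) (hS4 : CDNSeedLaw 8) (hSN : SeedN3Law 8) (hSP : SeedPLaw 8) :
    SeedB1OddDiamondG1H1 8 :=
  have hCD := chargeDepthLaw_of_cdP_seed hP hS4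
  seedB1Odd_eight_of_partial_cd hCD (levelNLaw_of_cd_seeds3 hCD hSN hSP) (levelP3Law_of_cd_seeds3 hCD hSN hSP) oddLineFree_eight

/-- **(T_h) ⟸ (CD-P_h) ∧ (CDN4_h) ∧ (SN3_h) ∧ (SP_h) ∧ (NS_h) for every `h ≤ 10`** (KERNEL glue, v4).  NOT a proof of (T₁₀); HC ∕ HC_CM ∕ HC_AV ∕ H2
NOT proved. -/
theorem seedB1Odd_of_cdP_seeds3_nest_le_ten {h : ℤ} (hh : h ≤ 10) (hP : ChargeDepthPLaw h) (hS4 : CDNSeedLaw h) (hSN : SeedN3Law h)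
    (hSP : SeedPLaw h) (hNS : NestLaw h) : SeedB1OddDiamondG1H1 h := by
  have hCD := chargeDepthLaw_of_cdP_seed hP hS4
  refine seedB1Odd_of_level_nest_downLine (levelLaw_of_partial (levelNLaw_of_cd_seeds3 hCD hSN hSP) (levelP3Law_of_cd_seeds3 hCD hSN hSP)) hNS
    (fun h' hh' => ?_) (oddLineFree_all_le (by omega))
  have hCD' := chargeDepthLaw_antitone hh' hCD
  exact downLineLaw_of_partial_cd_le_ten (hh'.trans hh) hCD' (levelNLaw_of_cd_seeds3 hCD' (seedN3Law_antitone hh' hSN) (seedPLaw_antitone hh' hSP))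
    (levelP3Law_of_cd_seeds3 hCD' (seedN3Law_antitone hh' hSN) (seedPLaw_antitone hh' hSP))

theorem seedB1Odd_ten_of_cdP_seeds3_nest (hP : ChargeDepthPLaw 10) (hS4 : CDNSeedLaw 10) (hSN : SeedN3Law 10) (hSP : SeedPLaw 10)
    (hNS : NestLaw 10) : SeedB1OddDiamondG1H1 10 :=
  seedB1Odd_of_cdP_seeds3_nest_le_ten le_rfl hP hS4 hSN hSP hNS


/-! ## §11 (R1)+(R2): the lexicographic measure (max top, Q), stratification by the charge count, and the 2-charged FLOOR closes (v6)

Every kernel step sends a cell to cells of charge count ≥ its own and of larger (max top, Q) in the lexicographic order (below an `N`-cell the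
outcomes have the SAME tops and larger `Q`; above a `P`-cell no top decreases and `Q` grows).  So the induction may be run per count stratum
`k = 4, 3, 2` (outer, descending) on the measure `(2h+1)·maxTop + Q` (inner, descending).  The gain: a 2-charged FLOOR `N`-cell `N[O|O|aℓ|bℓ′]`
(`a ≤ b`) is no longer a seed — `floorChain` forces a floor `P`-cell `[O|O|cℓ|bℓ′]` (`c ≤ a`), above which RULE D at (apex, top of `bℓ′`) produces a
3-charged non-level `N`-cell (absent by the outer hypothesis) or `N[O|O|cℓ|(b+e)ℓ′]` of larger max top (absent by the inner hypothesis). -/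

/-- the largest causal top of the four letters. -/
def maxTop (Z : MCell) : ℤ := max (max (causalTop (Z 0)) (causalTop (Z 1))) (max (causalTop (Z 2)) (causalTop (Z 3)))

theorem causalTop_le_maxTop (Z : MCell) (f : Fin 4) : causalTop (Z f) ≤ maxTop Z := by
  unfold maxTop
  rcases fin4_cases f with rfl | rfl | rfl | rfl
  · exact le_max_of_le_left (le_max_left _ _)
  · exact le_max_of_le_left (le_max_right _ _)
  · exact le_max_of_le_right (le_max_left _ _)
  · exact le_max_of_le_right (le_max_right _ _)

theorem maxTop_le {Z : MCell} {c : ℤ} (h : ∀ f, causalTop (Z f) ≤ c) : maxTop Z ≤ c :=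
  max_le (max_le (h 0) (h 1)) (max_le (h 2) (h 3))

theorem maxTop_mono {Z P : MCell} (h : ∀ f, causalTop (Z f) ≤ causalTop (P f)) : maxTop Z ≤ maxTop P :=
  maxTop_le fun f => (h f).trans (causalTop_le_maxTop P f)

theorem maxTop_congr {Z P : MCell} (h : ∀ f, causalTop (P f) = causalTop (Z f)) : maxTop P = maxTop Z :=
  le_antisymm (maxTop_mono fun f => (h f).le) (maxTop_mono fun f => (h f).ge)

theorem maxTop_swap (Z : MCell) (σ f' : Fin 4) : maxTop (Z.perm (Equiv.swap σ f')) = maxTop Z := by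
  refine le_antisymm (maxTop_le fun f => ?_) (maxTop_le fun f => ?_)
  · rw [MCell.perm_apply]; exact causalTop_le_maxTop Z _
  · have : Z f = Z.perm (Equiv.swap σ f') (Equiv.swap σ f' f) := by simp [MCell.perm_apply, Equiv.swap_apply_self]
    rw [this]; exact causalTop_le_maxTop _ _

theorem causalTop_le_of_inDiamond {h : ℤ} {x : BPoint} (hx : InDiamond h x) : causalTop x ≤ h := by
  unfold causalTop; exact hx.2.2.2

theorem causalTop_nonneg_of_inDiamond {h : ℤ} {x : BPoint} (hx : InDiamond h x) : 0 ≤ causalTop x := by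
  have := absCharge_nonneg x; have := hx.2.1; unfold causalTop; omega

theorem causalTop_origin : causalTop ((0, 0, 0) : BPoint) = 0 := by simp [causalTop, absCharge, chargeOf]

theorem maxTop_le_of_inDiamond {h : ℤ} {Z : MCell} (hZ : MCell.InDiamond h Z) : maxTop Z ≤ h :=
  maxTop_le fun f => causalTop_le_of_inDiamond (hZ f)

theorem maxTop_nonneg_of_inDiamond {h : ℤ} {Z : MCell} (hZ : MCell.InDiamond h Z) : 0 ≤ maxTop Z :=
  (causalTop_nonneg_of_inDiamond (hZ 0)).trans (causalTop_le_maxTop Z 0)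

/-- the lexicographic measure (max top, total charge) as one integer. -/
def lexMeasure (h : ℤ) (Z : MCell) : ℤ := (2 * h + 1) * maxTop Z + totalCharge Z

theorem lexMeasure_le {h : ℤ} {Z : MCell} (hZ : MCell.InDiamond h Z) : lexMeasure h Z ≤ (2 * h + 1) * h + 2 * h := by
  have h1 := maxTop_le_of_inDiamond hZ
  have h2 := totalCharge_le_of_inDiamond hZ
  have h0 : 0 ≤ h := le_trans (maxTop_nonneg_of_inDiamond hZ) h1
  have := mul_le_mul_of_nonneg_left h1 (show (0 : ℤ) ≤ 2 * h + 1 by omega)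
  unfold lexMeasure; linarith

/-- the measure increases strictly along the lexicographic order (max top, Q). -/
theorem lexMeasure_lt {h : ℤ} {Z P : MCell} (hZ : MCell.InDiamond h Z) (hP : MCell.InDiamond h P)
    (hlex : maxTop Z < maxTop P ∨ (maxTop Z ≤ maxTop P ∧ totalCharge Z < totalCharge P)) : lexMeasure h Z < lexMeasure h P := by
  have hQZ := totalCharge_le_of_inDiamond hZ
  have hQP := totalCharge_nonneg P
  have h0 : 0 ≤ h := le_trans (maxTop_nonneg_of_inDiamond hZ) (maxTop_le_of_inDiamond hZ)
  have _u := hP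
  unfold lexMeasure
  rcases hlex with hlt | ⟨hle, hq⟩
  · have := mul_le_mul_of_nonneg_left (show maxTop Z + 1 ≤ maxTop P by omega) (show (0 : ℤ) ≤ 2 * h + 1 by omega)
    linarith
  · have := mul_le_mul_of_nonneg_left hle (show (0 : ℤ) ≤ 2 * h + 1 by omega)
    linarith

theorem lexMeasure_swap (h : ℤ) (Z : MCell) (σ f' : Fin 4) : lexMeasure h (Z.perm (Equiv.swap σ f')) = lexMeasure h Z := by
  unfold lexMeasure; rw [maxTop_swap, totalCharge_swap]

/-! ### counting helpers -/

theorem three_le_chargeCount {Z : MCell} {a b c : Fin 4} (hab : a ≠ b) (hac : a ≠ c) (hbc : b ≠ c) (ha : (Z a).2 ≠ (0, 0))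
    (hb : (Z b).2 ≠ (0, 0)) (hc : (Z c).2 ≠ (0, 0)) : 3 ≤ chargeCount Z := by
  unfold chargeCount
  calc 3 = ({a, b, c} : Finset (Fin 4)).card := (Finset.card_eq_three.mpr ⟨a, b, c, hab, hac, hbc, rfl⟩).symm
    _ ≤ _ := Finset.card_le_card (by
      intro f hf
      simp only [Finset.mem_insert, Finset.mem_singleton] at hf
      rcases hf with rfl | rfl | rfl <;> simp [ha, hb, hc])

theorem exists_ne_three : ∀ a b c : Fin 4, ∃ d : Fin 4, d ≠ a ∧ d ≠ b ∧ d ≠ c := by decide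

theorem exists_uncharged_ne {Z : MCell} (h2 : chargeCount Z ≤ 2) (f : Fin 4) : ∃ g, g ≠ f ∧ (Z g).2 = (0, 0) := by
  by_contra hall
  push Not at hall
  have h3 : 3 ≤ chargeCount Z := by
    rcases fin4_cases f with rfl | rfl | rfl | rfl
    · exact three_le_chargeCount (a := 1) (b := 2) (c := 3) (by decide) (by decide) (by decide) (hall 1 (by decide)) (hall 2 (by decide))
        (hall 3 (by decide))
    · exact three_le_chargeCount (a := 0) (b := 2) (c := 3) (by decide) (by decide) (by decide) (hall 0 (by decide)) (hall 2 (by decide))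
        (hall 3 (by decide))
    · exact three_le_chargeCount (a := 0) (b := 1) (c := 3) (by decide) (by decide) (by decide) (hall 0 (by decide)) (hall 1 (by decide))
        (hall 3 (by decide))
    · exact three_le_chargeCount (a := 0) (b := 1) (c := 2) (by decide) (by decide) (by decide) (hall 0 (by decide)) (hall 1 (by decide))
        (hall 2 (by decide))
  omega

theorem chargeCount_le_three {Z : MCell} {f : Fin 4} (hf : (Z f).2 = (0, 0)) : chargeCount Z ≤ 3 := by
  unfold chargeCount
  calc _ ≤ (Finset.univ.erase f).card := Finset.card_le_card (by
          intro g hg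
          simp only [Finset.mem_filter, Finset.mem_univ, true_and] at hg
          simp only [Finset.mem_erase, Finset.mem_univ, and_true]
          rintro rfl; exact hg hf)
    _ = 3 := by rw [Finset.card_erase_of_mem (Finset.mem_univ f)]; simp

/-! ### the `P`-side edges with top monotonicity -/

/-- kill above `P`, with the extra information that no causal top decreases (true for every RULE-D outcome above a `P`-cell). -/
def KillAbove2 (C : MConfig) (P : MCell) : Prop :=
  ∀ N ∈ C.lower, chargeCount P ≤ chargeCount N → (∀ f, (P f).2 ≠ (0, 0) → (N f).2 ≠ (0, 0) ∧ nodeLevel (N f) = nodeLevel (P f)) →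
    totalCharge P < totalCharge N → (∀ f, causalTop (P f) ≤ causalTop (N f)) → False

theorem topKill2 {h : ℤ} {C : MConfig} (hU : C.InDiamond h) {P N : MCell} (hP : P ∈ C.upper) (hN : N ∈ C.lower) {f : Fin 4}
    (hfc : (P f).2 ≠ (0, 0)) {k r : Fin 4} (hk : Adapted (P f) k) (hk0 : coord (P f) k = (P f).1 + absCharge (P f)) (hr : r ≠ k + 2)
    (hag : MAgree P N f) (hlt : (P f).1 < (N f).1) (hray : N f = ray (P f) r ((N f).1 - (P f).1)) (hK : KillAbove2 C P) : False := by
  have hrk : r = k :=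
    (ray_dir_of_adapted (hU.2 P hP f).1 (not_isApex_of_snd_ne hfc) hk (by omega) hray (hU.1 N hN f).1).resolve_right hr
  rw [hrk] at hray
  obtain ⟨hc, hn, hq⟩ := topRaise_of_ray (hU.2 P hP f).1 hfc hk hk0 (by omega) hray
  refine hK N hN (chargeCount_mono fun f' hf' => ?_) (fun f' hf' => ?_) (totalCharge_lt (fun f' => ?_) f ?_) (fun f' => ?_)
  · by_cases e : f' = f
    · subst e; exact hc
    · rw [← hag f' e]; exact hf'
  · by_cases e : f' = f
    · subst e; exact ⟨hc, hn⟩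
    · rw [← hag f' e]; exact ⟨hf', rfl⟩
  · by_cases e : f' = f
    · subst e; rw [hq]; omega
    · exact le_of_eq (by rw [hag f' e])
  · rw [hq]; omega
  · by_cases e : f' = f
    · subst e; unfold causalTop; rw [hq]; omega
    · exact le_of_eq (by rw [hag f' e])

theorem apexKillAbove2 {h : ℤ} {C : MConfig} (hU : C.InDiamond h) {P N : MCell} (hP : P ∈ C.upper) (hN : N ∈ C.lower) {g : Fin 4}
    (hg0 : (P g).2 = (0, 0)) {r : Fin 4} (hag : MAgree P N g) (hlt : (P g).1 < (N g).1) (hray : N g = ray (P g) r ((N g).1 - (P g).1))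
    (hK : KillAbove2 C P) : False := by
  have _h := hU; have _hP := hP
  have hap : isApex (P g) := (isApex_iff_snd _).2 hg0
  obtain ⟨d, hd⟩ : ∃ d : ℤ, d = (N g).1 - (P g).1 := ⟨_, rfl⟩
  rw [← hd] at hray
  rw [eq_of_isApex hap] at hray
  have hc : (N g).2 ≠ (0, 0) := by rw [hray]; exact snd_ne_ray_apex _ _ (by omega)
  have hq : absCharge (N g) = d := by rw [hray]; exact absCharge_ray_apex _ _ (by omega)
  have ha0 : absCharge (P g) = 0 := absCharge_of_uncharged hg0
  refine hK N hN (chargeCount_mono fun f' hf' => ?_) (fun f' hf' => ?_) (totalCharge_lt (fun f' => ?_) g ?_) (fun f' => ?_)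
  · by_cases e : f' = g
    · subst e; exact hc
    · rw [← hag f' e]; exact hf'
  · by_cases e : f' = g
    · subst e; exact absurd hg0 hf'
    · rw [← hag f' e]; exact ⟨hf', rfl⟩
  · by_cases e : f' = g
    · subst e; rw [ha0, hq]; omega
    · exact le_of_eq (by rw [hag f' e])
  · rw [ha0, hq]; omega
  · by_cases e : f' = g
    · subst e; unfold causalTop; rw [ha0, hq]; omega
    · exact le_of_eq (by rw [hag f' e])

/-- **EDGE (AA)** with top monotonicity. -/
theorem edge_AA2 {h : ℤ} {C : MConfig} (hU : C.InDiamond h) {P : MCell} (hP : P ∈ C.upper) (hD : RuleDMu4P C P) {f g : Fin 4} (hfg : f ≠ g)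
    (hfc : (P f).2 ≠ (0, 0)) (hgc : (P g).2 ≠ (0, 0)) (hne : causalTop (P f) ≠ causalTop (P g)) (hK : KillAbove2 C P) : False := by
  obtain ⟨k, hk, hk0⟩ := exists_top_dir (hU.2 P hP f).1
  obtain ⟨k', hk', hk0'⟩ := exists_top_dir (hU.2 P hP g).1
  have hne' : coord (P f) k ≠ coord (P g) k' := by unfold causalTop at hne; rwa [hk0, hk0']
  rcases hD f g hfg k k' hk hk' hne' with ⟨r, hr, N, hN, hag, hlt, hray⟩ | ⟨r, hr, N, hN, hag, hlt, hray⟩ |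
      ⟨a, b, ha, hb, N, hN, hag2, hlt1, hray1, hlt2, hray2⟩
  · exact topKill2 hU hP hN hfc hk hk0 hr hag hlt hray hK
  · exact topKill2 hU hP hN hgc hk' hk0' hr hag hlt hray hK
  · have ha' : a = k := ha.elim id fun h' => absurd h'.1 (not_isApex_of_snd_ne hfc)
    have hb' : b = k' := hb.elim id fun h' => absurd h'.1 (not_isApex_of_snd_ne hgc)
    rw [ha'] at hray1
    rw [hb'] at hray2
    obtain ⟨hc1, hn1, hq1⟩ := topRaise_of_ray (hU.2 P hP f).1 hfc hk hk0 (by omega) hray1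
    obtain ⟨hc2, hn2, hq2⟩ := topRaise_of_ray (hU.2 P hP g).1 hgc hk' hk0' (by omega) hray2
    refine hK N hN (chargeCount_mono fun f' hf' => ?_) (fun f' hf' => ?_) (totalCharge_lt (fun f' => ?_) f ?_) (fun f' => ?_)
    · by_cases e : f' = f
      · subst e; exact hc1
      · by_cases e' : f' = g
        · subst e'; exact hc2
        · rw [hag2 f' e e']; exact hf'
    · by_cases e : f' = f
      · subst e; exact ⟨hc1, hn1⟩
      · by_cases e' : f' = g
        · subst e'; exact ⟨hc2, hn2⟩
        · rw [hag2 f' e e']; exact ⟨hf', rfl⟩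
    · by_cases e : f' = f
      · subst e; rw [hq1]; omega
      · by_cases e' : f' = g
        · subst e'; rw [hq2]; omega
        · exact le_of_eq (by rw [hag2 f' e e'])
    · rw [hq1]; omega
    · by_cases e : f' = f
      · subst e; unfold causalTop; rw [hq1]; omega
      · by_cases e' : f' = g
        · subst e'; unfold causalTop; rw [hq2]; omega
        · exact le_of_eq (by rw [hag2 f' e e'])

/-- **EDGE (Aa)** with top monotonicity. -/
theorem edge_Aa2 {h : ℤ} {C : MConfig} (hU : C.InDiamond h) {P : MCell} (hP : P ∈ C.upper) (hD : RuleDMu4P C P) {f g : Fin 4}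
    (hfc : (P f).2 ≠ (0, 0)) (hg0 : (P g).2 = (0, 0)) (hne : causalTop (P f) ≠ (P g).1) (hK : KillAbove2 C P) : False := by
  have hfg : f ≠ g := fun e => hfc (by rw [e]; exact hg0)
  have hap : isApex (P g) := (isApex_iff_snd _).2 hg0
  obtain ⟨k, hk, hk0⟩ := exists_top_dir (hU.2 P hP f).1
  have hne' : coord (P f) k ≠ coord (P g) k := by rw [hk0, coord_of_isApex hap]; unfold causalTop at hne; exact hne
  rcases hD f g hfg k k hk (adapted_of_isApex hap k) hne' with ⟨r, hr, N, hN, hag, hlt, hray⟩ | ⟨r, -, N, hN, hag, hlt, hray⟩ |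
      ⟨a, b, ha, -, N, hN, hag2, hlt1, hray1, hlt2, hray2⟩
  · exact topKill2 hU hP hN hfc hk hk0 hr hag hlt hray hK
  · exact apexKillAbove2 hU hP hN hg0 hag hlt hray hK
  · have ha' : a = k := ha.elim id fun h' => absurd h'.1 (not_isApex_of_snd_ne hfc)
    rw [ha'] at hray1
    obtain ⟨hc1, hn1, hq1⟩ := topRaise_of_ray (hU.2 P hP f).1 hfc hk hk0 (by omega) hray1
    obtain ⟨d, hd⟩ : ∃ d : ℤ, d = (N g).1 - (P g).1 := ⟨_, rfl⟩
    rw [← hd] at hray2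
    rw [eq_of_isApex hap] at hray2
    have hc2 : (N g).2 ≠ (0, 0) := by rw [hray2]; exact snd_ne_ray_apex _ _ (by omega)
    have hq2 : absCharge (N g) = d := by rw [hray2]; exact absCharge_ray_apex _ _ (by omega)
    have ha0 : absCharge (P g) = 0 := absCharge_of_uncharged hg0
    refine hK N hN (chargeCount_mono fun f' hf' => ?_) (fun f' hf' => ?_) (totalCharge_lt (fun f' => ?_) f ?_) (fun f' => ?_)
    · by_cases e : f' = f
      · subst e; exact hc1
      · by_cases e' : f' = g
        · subst e'; exact hc2
        · rw [hag2 f' e e']; exact hf'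
    · by_cases e : f' = f
      · subst e; exact ⟨hc1, hn1⟩
      · by_cases e' : f' = g
        · subst e'; exact absurd hg0 hf'
        · rw [hag2 f' e e']; exact ⟨hf', rfl⟩
    · by_cases e : f' = f
      · subst e; rw [hq1]; omega
      · by_cases e' : f' = g
        · subst e'; rw [ha0, hq2]; omega
        · exact le_of_eq (by rw [hag2 f' e e'])
    · rw [hq1]; omega
    · by_cases e : f' = f
      · subst e; unfold causalTop; rw [hq1]; omega
      · by_cases e' : f' = g
        · subst e'; unfold causalTop; rw [ha0, hq2]; omega
        · exact le_of_eq (by rw [hag2 f' e e'])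

/-- informative kill above `P` at (top of the charged letter `f`, apex `g`): the outcome agrees with `P` off `{f, g}`; either `g` is kept and `f`
is top-raised (charged, same node, larger top), or `g` becomes charged and `f` is kept or top-raised. -/
def KillAboveAa (C : MConfig) (P : MCell) (f g : Fin 4) : Prop :=
  ∀ N ∈ C.lower, (∀ i, i ≠ f → i ≠ g → N i = P i) →
    ((N g = P g ∧ (N f).2 ≠ (0, 0) ∧ nodeLevel (N f) = nodeLevel (P f) ∧ causalTop (P f) < causalTop (N f)) ∨
      ((N g).2 ≠ (0, 0) ∧ (N f = P f ∨ ((N f).2 ≠ (0, 0) ∧ nodeLevel (N f) = nodeLevel (P f) ∧ causalTop (P f) < causalTop (N f))))) →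
    False

/-- **EDGE (Aa), informative form.** -/
theorem edge_Aa_info {h : ℤ} {C : MConfig} (hU : C.InDiamond h) {P : MCell} (hP : P ∈ C.upper) (hD : RuleDMu4P C P) {f g : Fin 4}
    (hfc : (P f).2 ≠ (0, 0)) (hg0 : (P g).2 = (0, 0)) (hne : causalTop (P f) ≠ (P g).1) (hK : KillAboveAa C P f g) : False := by
  have hfg : f ≠ g := fun e => hfc (by rw [e]; exact hg0)
  have hap : isApex (P g) := (isApex_iff_snd _).2 hg0
  obtain ⟨k, hk, hk0⟩ := exists_top_dir (hU.2 P hP f).1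
  have hne' : coord (P f) k ≠ coord (P g) k := by rw [hk0, coord_of_isApex hap]; unfold causalTop at hne; exact hne
  rcases hD f g hfg k k hk (adapted_of_isApex hap k) hne' with ⟨r, hr, N, hN, hag, hlt, hray⟩ | ⟨r, -, N, hN, hag, hlt, hray⟩ |
      ⟨a, b, ha, -, N, hN, hag2, hlt1, hray1, hlt2, hray2⟩
  · have hrk : r = k :=
      (ray_dir_of_adapted (hU.2 P hP f).1 (not_isApex_of_snd_ne hfc) hk (by omega) hray (hU.1 N hN f).1).resolve_right hr
    rw [hrk] at hray
    obtain ⟨hc, hn, hq⟩ := topRaise_of_ray (hU.2 P hP f).1 hfc hk hk0 (by omega) hray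
    refine hK N hN (fun i hi _ => (hag i hi).symm) (Or.inl ⟨(hag g hfg.symm).symm, hc, hn, ?_⟩)
    unfold causalTop; rw [hq]; omega
  · obtain ⟨d, hd⟩ : ∃ d : ℤ, d = (N g).1 - (P g).1 := ⟨_, rfl⟩
    rw [← hd] at hray
    rw [eq_of_isApex hap] at hray
    have hc : (N g).2 ≠ (0, 0) := by rw [hray]; exact snd_ne_ray_apex _ _ (by omega)
    exact hK N hN (fun i _ hi => (hag i hi).symm) (Or.inr ⟨hc, Or.inl (hag f hfg).symm⟩)
  · have ha' : a = k := ha.elim id fun h' => absurd h'.1 (not_isApex_of_snd_ne hfc)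
    rw [ha'] at hray1
    obtain ⟨hc1, hn1, hq1⟩ := topRaise_of_ray (hU.2 P hP f).1 hfc hk hk0 (by omega) hray1
    obtain ⟨d, hd⟩ : ∃ d : ℤ, d = (N g).1 - (P g).1 := ⟨_, rfl⟩
    rw [← hd] at hray2
    rw [eq_of_isApex hap] at hray2
    have hc2 : (N g).2 ≠ (0, 0) := by rw [hray2]; exact snd_ne_ray_apex _ _ (by omega)
    refine hK N hN (fun i hi hi' => hag2 i hi hi') (Or.inr ⟨hc2, Or.inr ⟨hc1, hn1, ?_⟩⟩)
    unfold causalTop; rw [hq1]; omega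

/-! ### (R2) the 2-charged floor -/

/-- **(R2) the 2-charged FLOOR closes** (ordered form: `|c_σ| ≤ |c_τ|`).  `floorChain` at `σ` + `edge_Aa_info` above the forced floor `P`-cell at
(an apex, the top of the `τ`-letter): the outcome is a non-level `N`-cell with three charged letters or with larger max top. -/
theorem floorTwo_absent_ord {h : ℤ} {C : MConfig} (hU : C.InDiamond h) (hD : RuleDMu4Closed C) (hA : A2IMinusClosed C)
    (hPl : PermClosed C.lower) {Z : MCell} (hZ : Z ∈ C.lower) (hF : FloorCell Z) (h2 : chargeCount Z = 2) {σ τ : Fin 4} (hστ : σ ≠ τ)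
    (hσc : (Z σ).2 ≠ (0, 0)) (hτc : (Z τ).2 ≠ (0, 0)) (hle : absCharge (Z σ) ≤ absCharge (Z τ))
    (h3 : ∀ N ∈ C.lower, 3 ≤ chargeCount N → LevelCell N)
    (hup : ∀ N ∈ C.lower, 2 ≤ chargeCount N → maxTop Z < maxTop N → LevelCell N) : False := by
  have hZD := hU.1 Z hZ
  -- the two other letters are floor apexes `O`
  have hapx : ∀ f, f ≠ σ → f ≠ τ → Z f = (0, 0, 0) := by
    intro f hfσ hfτ
    have hf0 : (Z f).2 = (0, 0) := by
      by_contra hfc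
      have := three_le_chargeCount hστ (Ne.symm hfσ) (Ne.symm hfτ) hσc hτc hfc
      omega
    exact floor_apex_eq (hZD f) (hF f) hf0
  -- the max top of `Z` is the top of `τ`
  have hmax : maxTop Z = causalTop (Z τ) := by
    refine le_antisymm (maxTop_le fun f => ?_) (causalTop_le_maxTop Z τ)
    by_cases hfτ : f = τ
    · rw [hfτ]
    by_cases hfσ : f = σ
    · rw [hfσ]; have h1 := hF σ; have h2 := hF τ; unfold nodeLevel at h1 h2; unfold causalTop; omega
    · rw [hapx f hfσ hfτ, causalTop_origin]; exact causalTop_nonneg_of_inDiamond (hZD τ)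
  have hτtop : 0 < causalTop (Z τ) := by
    have := absCharge_pos_of_not_isApex (hZD τ).1 (not_isApex_of_snd_ne hτc); have := (hZD τ).2.1; unfold causalTop; omega
  -- an apex `f' ≠ σ`
  obtain ⟨f', hf'σ, hf'0⟩ := exists_uncharged_ne (le_of_eq h2) σ
  have hf'τ : f' ≠ τ := fun e => hτc (by rw [← e]; exact hf'0)
  -- the common kill of a floor `P`-cell carrying `Z τ`, one more charged floor letter `i` of charge `≤ |c_τ|`, and two `O`'s at `g`, `g₂`
  have hkill : ∀ P ∈ C.upper, ∀ i g g₂ : Fin 4, i ≠ τ → g ≠ τ → g₂ ≠ τ → g ≠ i → g₂ ≠ i → g ≠ g₂ →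
      P τ = Z τ → (P i).2 ≠ (0, 0) → P g = (0, 0, 0) → P g₂ = (0, 0, 0) → False := by
    intro P hP i g g₂ hiτ hgτ hg₂τ hgi hg₂i hgg₂ hPτ hic hg hg₂
    have hg0 : (P g).2 = (0, 0) := by rw [hg]
    refine edge_Aa_info hU hP (hD.2 P hP) (f := τ) (g := g) (by rw [hPτ]; exact hτc) hg0 (by rw [hPτ, hg]; exact ne_of_gt hτtop) ?_
    intro N hN hNag hor
    have hND := hU.1 N hN
    have hNg₂ : N g₂ = (0, 0, 0) := by rw [hNag g₂ hg₂τ (Ne.symm hgg₂), hg₂]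
    have hnl_of : (N τ).2 ≠ (0, 0) → ¬ LevelCell N := by
      intro hc hL
      have h1 := hL τ g₂
      rw [hNg₂, causalTop_origin] at h1
      have := absCharge_pos_of_not_isApex (hND τ).1 (not_isApex_of_snd_ne hc)
      have := (hND τ).2.1
      unfold causalTop at h1; omega
    have hNi : (N i).2 ≠ (0, 0) := by rw [hNag i hiτ (Ne.symm hgi)]; exact hic
    rcases hor with ⟨-, hc, -, htop⟩ | ⟨hgc, hrest⟩
    · refine hnl_of hc (hup N hN (two_le_chargeCount hiτ hNi hc) ?_)
      rw [hmax, ← hPτ]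
      exact lt_of_lt_of_le htop (causalTop_le_maxTop N τ)
    · have hc : (N τ).2 ≠ (0, 0) := by
        rcases hrest with hτ' | ⟨hc, -, -⟩
        · rw [hτ', hPτ]; exact hτc
        · exact hc
      exact hnl_of hc (h3 N hN (three_le_chargeCount hiτ (Ne.symm hgi) (Ne.symm hgτ) hNi hc hgc))
  -- the floor chain at `σ` with the apex `f'`
  rcases floorChain hU hA hPl hZ (hD.1 Z hZ) hF (Ne.symm hf'σ) hσc hf'0 with ⟨P, hP, hag, -, hpos, -⟩ | ⟨P, hP, hg, hs, -, hpos, -⟩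
  · -- the partial descent: charged letter at `σ`, apexes `f'` and the fourth letter
    obtain ⟨f'', hf''σ, hf''τ, hf''f'⟩ := exists_ne_three σ τ f'
    exact hkill P hP σ f' f'' hστ hf'τ hf''τ hf'σ hf''σ (Ne.symm hf''f') (hag τ (Ne.symm hστ))
      (fun h0 => by have := absCharge_of_uncharged h0; omega) (by rw [hag f' hf'σ]; exact hapx f' hf'σ hf'τ)
      (by rw [hag f'' hf''σ]; exact hapx f'' hf''σ hf''τ)
  · -- the polluter: charged letter at `f'`, apexes `σ` (`P σ = Z f' = O`) and the fourth letter
    obtain ⟨f'', hf''σ, hf''τ, hf''f'⟩ := exists_ne_three σ τ f'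
    exact hkill P hP f' σ f'' hf'τ hστ hf''τ (Ne.symm hf'σ) hf''f' (Ne.symm hf''σ) (hg τ (Ne.symm hστ) (Ne.symm hf'τ))
      (fun h0 => by have := absCharge_of_uncharged h0; omega) (by rw [hs]; exact hapx f' hf'σ hf'τ)
      (by rw [hg f'' hf''σ hf''f']; exact hapx f'' hf''σ hf''τ)

/-- **(R2) the 2-charged FLOOR closes.** -/
theorem floorTwo_absent {h : ℤ} {C : MConfig} (hU : C.InDiamond h) (hD : RuleDMu4Closed C) (hA : A2IMinusClosed C) (hPl : PermClosed C.lower)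
    {Z : MCell} (hZ : Z ∈ C.lower) (hF : FloorCell Z) (h2 : chargeCount Z = 2) (h3 : ∀ N ∈ C.lower, 3 ≤ chargeCount N → LevelCell N)
    (hup : ∀ N ∈ C.lower, 2 ≤ chargeCount N → maxTop Z < maxTop N → LevelCell N) : False := by
  obtain ⟨σ, -, hσc⟩ := exists_charged_ne (le_of_eq h2.symm) 0
  obtain ⟨τ, hτσ, hτc⟩ := exists_charged_ne (le_of_eq h2.symm) σ
  rcases le_total (absCharge (Z σ)) (absCharge (Z τ)) with hle | hle
  · exact floorTwo_absent_ord hU hD hA hPl hZ hF h2 (Ne.symm hτσ) hσc hτc hle h3 hup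
  · exact floorTwo_absent_ord hU hD hA hPl hZ hF h2 hτσ hτc hσc hle h3 hup

/-! ### (R2)+(R3) every floor cell with an apex closes (v7) -/

theorem fin4_fourth : ∀ a b c d f : Fin 4, d ≠ a → d ≠ b → d ≠ c → a ≠ b → a ≠ c → b ≠ c → f ≠ a → f ≠ b → f ≠ c → f = d := by decide

theorem exists_max_absCharge (Z : MCell) : ∃ τ, ∀ f, absCharge (Z f) ≤ absCharge (Z τ) := by
  obtain ⟨τ, -, hτ⟩ := Finset.exists_max_image Finset.univ (fun f => absCharge (Z f)) Finset.univ_nonempty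
  exact ⟨τ, fun f => hτ f (Finset.mem_univ f)⟩

/-- **(R2)+(R3) THE FLOOR WITH AN APEX CLOSES.**  `Z` a floor `N`-cell with at least two charged letters and an apex `f'`; `τ` a letter of maximal
charge, `σ ≠ τ` charged.  `floorChain` at `σ` yields a floor `P`-cell carrying `Z τ`, one more charged floor letter, `Z`'s fourth letter and an `O`;
`edge_Aa_info` above it at (that `O`, the top of `Z τ`) yields an `N`-cell that is non-level with at least as many charged letters and a larger max
top (`hup`), or has MORE charged letters than `Z` and a charged FLOOR letter at `τ` (`hbig` — level by the outer stratum and then killed by (CD-N),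
or non-level and absent). -/
theorem floorApex_absent {h : ℤ} {C : MConfig} (hU : C.InDiamond h) (hD : RuleDMu4Closed C) (hA : A2IMinusClosed C) (hPl : PermClosed C.lower)
    {Z : MCell} (hZ : Z ∈ C.lower) (hF : FloorCell Z) {σ τ f' : Fin 4} (hστ : σ ≠ τ) (hσc : (Z σ).2 ≠ (0, 0)) (hτc : (Z τ).2 ≠ (0, 0))
    (hmaxτ : ∀ f, absCharge (Z f) ≤ absCharge (Z τ)) (hf'0 : (Z f').2 = (0, 0))
    (hbig : ∀ N ∈ C.lower, (N τ).2 ≠ (0, 0) → nodeLevel (N τ) = 0 → chargeCount Z + 1 ≤ chargeCount N → False)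
    (hup : ∀ N ∈ C.lower, chargeCount Z ≤ chargeCount N → maxTop Z < maxTop N → LevelCell N) : False := by
  have hZD := hU.1 Z hZ
  have hf'σ : f' ≠ σ := fun e => hσc (by rw [← e]; exact hf'0)
  have hf'τ : f' ≠ τ := fun e => hτc (by rw [← e]; exact hf'0)
  have hZf' : Z f' = (0, 0, 0) := floor_apex_eq (hZD f') (hF f') hf'0
  -- the max top of `Z` is the top of `τ`
  have hmax : maxTop Z = causalTop (Z τ) := by
    refine le_antisymm (maxTop_le fun f => ?_) (causalTop_le_maxTop Z τ)
    have h1 := hF f; have h2 := hF τ; have h3 := hmaxτ f; unfold nodeLevel at h1 h2; unfold causalTop; omega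
  have hτtop : 0 < causalTop (Z τ) := by
    have := absCharge_pos_of_not_isApex (hZD τ).1 (not_isApex_of_snd_ne hτc); have := (hZD τ).2.1; unfold causalTop; omega
  have hZ3 : chargeCount Z ≤ 3 := chargeCount_le_three hf'0
  -- the fourth letter
  obtain ⟨ρ, hρσ, hρτ, hρf'⟩ := exists_ne_three σ τ f'
  have hZ2 : (Z ρ).2 = (0, 0) → chargeCount Z ≤ 2 := by
    intro hρ0; by_contra h3; exact charged_of_three (by omega) hf'0 hρf' hρ0
  -- the common kill of a floor `P`-cell carrying `Z τ` at `τ`, `Z ρ` at `ρ`, a charged letter at `i` and `O` at `g`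
  have hkill : ∀ P ∈ C.upper, ∀ i g : Fin 4, i ≠ τ → g ≠ τ → g ≠ i → ρ ≠ i → ρ ≠ g →
      P τ = Z τ → P ρ = Z ρ → (P i).2 ≠ (0, 0) → P g = (0, 0, 0) → False := by
    intro P hP i g hiτ hgτ hgi hρi hρg hPτ hPρ hic hg
    have hg0 : (P g).2 = (0, 0) := by rw [hg]
    refine edge_Aa_info hU hP (hD.2 P hP) (f := τ) (g := g) (by rw [hPτ]; exact hτc) hg0 (by rw [hPτ, hg]; exact ne_of_gt hτtop) ?_
    intro N hN hNag hor
    have hND := hU.1 N hN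
    have hNi : (N i).2 ≠ (0, 0) := by rw [hNag i hiτ (Ne.symm hgi)]; exact hic
    have hNρ : N ρ = Z ρ := by rw [hNag ρ hρτ hρg, hPρ]
    rcases hor with ⟨hNg, hc, -, htop⟩ | ⟨hgc, hrest⟩
    · -- `g` kept: non-level, at least as many charged letters, larger max top
      have hnl : ¬ LevelCell N := by
        intro hL
        have h1 := hL τ g
        rw [hNg, hg, causalTop_origin] at h1
        have := absCharge_pos_of_not_isApex (hND τ).1 (not_isApex_of_snd_ne hc)
        have := (hND τ).2.1
        unfold causalTop at h1; omega
      have hcnt : chargeCount Z ≤ chargeCount N := by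
        by_cases hρ0 : (Z ρ).2 = (0, 0)
        · exact (hZ2 hρ0).trans (two_le_chargeCount hiτ hNi hc)
        · exact hZ3.trans (three_le_chargeCount hiτ (Ne.symm hρi) (Ne.symm hρτ) hNi hc (by rw [hNρ]; exact hρ0))
      refine hnl (hup N hN hcnt ?_)
      rw [hmax, ← hPτ]
      exact lt_of_lt_of_le htop (causalTop_le_maxTop N τ)
    · -- `g` charged: one more charged letter, `τ` a charged floor letter
      have hc : (N τ).2 ≠ (0, 0) ∧ nodeLevel (N τ) = 0 := by
        rcases hrest with hτ' | ⟨hc, hn, -⟩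
        · rw [hτ', hPτ]; exact ⟨hτc, hF τ⟩
        · rw [hn, hPτ]; exact ⟨hc, hF τ⟩
      refine hbig N hN hc.1 hc.2 ?_
      by_cases hρ0 : (Z ρ).2 = (0, 0)
      · exact (Nat.add_le_add_right (hZ2 hρ0) 1).trans (three_le_chargeCount hiτ (Ne.symm hgi) (Ne.symm hgτ) hNi hc.1 hgc)
      · have h4 : chargeCount N = 4 := by
          refine chargeCount_eq_four fun f => ?_
          by_cases e1 : f = i
          · rw [e1]; exact hNi
          by_cases e2 : f = τ
          · rw [e2]; exact hc.1
          by_cases e3 : f = g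
          · rw [e3]; exact hgc
          rw [fin4_fourth i τ g ρ f hρi hρτ hρg hiτ (Ne.symm hgi) (Ne.symm hgτ) e1 e2 e3, hNρ]; exact hρ0
        omega
  -- the floor chain at `σ` with the apex `f'`
  rcases floorChain hU hA hPl hZ (hD.1 Z hZ) hF (Ne.symm hf'σ) hσc hf'0 with ⟨P, hP, hag, -, hpos, -⟩ | ⟨P, hP, hg, hs, -, hpos, -⟩
  · -- the partial descent: charged at `σ`, `O` at `f'`
    exact hkill P hP σ f' hστ hf'τ hf'σ hρσ hρf' (hag τ (Ne.symm hστ)) (hag ρ hρσ) (fun h0 => by have := absCharge_of_uncharged h0; omega)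
      (by rw [hag f' hf'σ]; exact hZf')
  · -- the polluter: charged at `f'`, `O` at `σ` (`P σ = Z f'`)
    exact hkill P hP f' σ hf'τ hστ (Ne.symm hf'σ) hρf' hρσ (hg τ (Ne.symm hστ) (Ne.symm hf'τ)) (hg ρ hρσ hρf')
      (fun h0 => by have := absCharge_of_uncharged h0; omega) (by rw [hs]; exact hZf')

/-! ### (SN4) and the stratified induction -/

/-- the `N`-seed of the stratified induction: node-flat cells that are neither floor cells with a unit letter and an apex nor 2-charged floor
cells; and high twins. -/
def SeedShapeN4 (Z : MCell) : Prop := (NodeFlat Z ∧ ¬ FloorUnitApex Z ∧ ¬ (FloorCell Z ∧ chargeCount Z = 2)) ∨ HighTwin Z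

/-- **(SN4)**, locally. -/
def SeedN4Local (C : MConfig) : Prop := ∀ Z ∈ C.lower, 2 ≤ chargeCount Z → SeedShapeN4 Z → LevelCell Z

/-- **(SN4) `SeedN4Law h`** (CONJECTURE ∕ census UP-fact; ◇₈: (SN3₈) minus the 2-charged floor orbits). -/
def SeedN4Law (h : ℤ) : Prop := ∀ C : MConfig, C.InDiamond h → C.G1Closed → C.StaticH1 → SeedN4Local C

theorem seedN4Local_of_seedN3Local {C : MConfig} (hS : SeedN3Local C) : SeedN4Local C :=
  fun Z hZ h2 hsh => hS Z hZ h2 (hsh.elim (fun h' => Or.inl ⟨h'.1, h'.2.1⟩) Or.inr)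

theorem seedN4Law_of_seedN3Law {h : ℤ} (hS : SeedN3Law h) : SeedN4Law h := fun C hU hG hS' => seedN4Local_of_seedN3Local (hS C hU hG hS')

theorem seedN4Law_antitone {h h' : ℤ} (hh : h ≤ h') (H : SeedN4Law h') : SeedN4Law h :=
  fun C hU hG hS => H C (inDiamond_config_mono hh hU) hG hS

/-- the `N`-seed of the stratified induction (v7): node-flat cells that are NOT floor cells with an apex; and high twins. -/
def SeedShapeN5 (Z : MCell) : Prop := (NodeFlat Z ∧ ¬ (FloorCell Z ∧ ∃ f, (Z f).2 = (0, 0))) ∨ HighTwin Z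

/-- **(SN5)**, locally. -/
def SeedN5Local (C : MConfig) : Prop := ∀ Z ∈ C.lower, 2 ≤ chargeCount Z → SeedShapeN5 Z → LevelCell Z

/-- **(SN5) `SeedN5Law h`** (CONJECTURE ∕ census UP-fact; ◇₈: the node-flat non-level `N`-orbits off the floor-with-apex, 1 484 + 17). -/
def SeedN5Law (h : ℤ) : Prop := ∀ C : MConfig, C.InDiamond h → C.G1Closed → C.StaticH1 → SeedN5Local C

theorem seedShapeN4_of_seedShapeN5 {Z : MCell} (h2 : 2 ≤ chargeCount Z) (hsh : SeedShapeN5 Z) : SeedShapeN4 Z := by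
  have _h := h2
  rcases hsh with ⟨hF, hFA⟩ | hH
  · refine Or.inl ⟨hF, fun hfu => hFA ⟨hfu.1, ?_⟩, fun hF2 => hFA ⟨hF2.1, ?_⟩⟩
    · obtain ⟨f', hf'⟩ := hfu.2.2; exact ⟨f', hf'⟩
    · obtain ⟨g, -, hg⟩ := exists_uncharged_ne (le_of_eq hF2.2) 0; exact ⟨g, hg⟩
  · exact Or.inr hH

theorem seedN5Local_of_seedN4Local {C : MConfig} (hS : SeedN4Local C) : SeedN5Local C :=
  fun Z hZ h2 hsh => hS Z hZ h2 (seedShapeN4_of_seedShapeN5 h2 hsh)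

theorem seedN5Law_of_seedN4Law {h : ℤ} (hS : SeedN4Law h) : SeedN5Law h := fun C hU hG hS' => seedN5Local_of_seedN4Local (hS C hU hG hS')

theorem seedN5Law_of_seedN3Law {h : ℤ} (hS : SeedN3Law h) : SeedN5Law h := seedN5Law_of_seedN4Law (seedN4Law_of_seedN3Law hS)

theorem seedN5Law_antitone {h h' : ℤ} (hh : h ≤ h') (H : SeedN5Law h') : SeedN5Law h :=
  fun C hU hG hS => H C (inDiamond_config_mono hh hU) hG hS

/-- **THE STRATIFIED CHARGE INDUCTION** (KERNEL, h-uniform): stratum `k ≤ chargeCount` (the cells with more than `k` charged letters being level by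
the outer hypothesis `hk3`, used only at `k = 2`), inner induction downward in the measure `(2h+1)·maxTop + Q`. -/
theorem levelLocal_induction4 {h : ℤ} {C : MConfig} (hU : C.InDiamond h) (hD : RuleDMu4Closed C) (hA : A2IMinusClosed C) (hPl : PermClosed C.lower)
    (hCD : CDIneq C) (hSN : SeedN5Local C) (hSP : SeedPLocal C) (k : ℕ)
    (hk3 : ∀ N ∈ C.lower, k + 1 ≤ chargeCount N → 2 ≤ chargeCount N → LevelCell N) (n : ℕ) :
    (∀ Z ∈ C.lower, (2 * h + 1) * h + 2 * h - lexMeasure h Z ≤ n → k ≤ chargeCount Z → 2 ≤ chargeCount Z → LevelCell Z) ∧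
      (∀ P ∈ C.upper, (2 * h + 1) * h + 2 * h - lexMeasure h P ≤ n → k ≤ chargeCount P → 2 ≤ chargeCount P →
        (3 ≤ chargeCount P ∨ ¬ HighP P) → LevelCell P) := by
  induction n using Nat.strong_induction_on with
  | _ n IH =>
  have hPn : ∀ P ∈ C.upper, (2 * h + 1) * h + 2 * h - lexMeasure h P ≤ n → k ≤ chargeCount P → 2 ≤ chargeCount P →
      (3 ≤ chargeCount P ∨ ¬ HighP P) → LevelCell P := by
    intro P hP hμ hk h2 h23
    by_contra hnl
    by_cases hHi : HighP P
    · exact h23.elim (fun h3 => hnl (hSP P hP h3 hHi)) fun hnh => hnh hHi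
    obtain ⟨f₀, hf₀c, hlt₀⟩ : ∃ f₀, (P f₀).2 ≠ (0, 0) ∧ nodeLevel (P f₀) < 2 * (chargeCount P : ℤ) := by
      by_contra hall; push Not at hall; exact hHi hall
    have hK : KillAbove2 C P := by
      intro N hN hcnt hnodes hQ htops
      by_cases hNl : LevelCell N
      · have h1 := hCD.2 N hN hNl f₀ (hnodes f₀ hf₀c).1
        rw [(hnodes f₀ hf₀c).2] at h1
        have h2' : (chargeCount P : ℤ) ≤ chargeCount N := by exact_mod_cast hcnt
        omega
      · have hlex := lexMeasure_lt (hU.2 P hP) (hU.1 N hN) (Or.inr ⟨maxTop_mono htops, hQ⟩)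
        have hB := lexMeasure_le (hU.1 N hN)
        have hn1 : n - 1 < n := by omega
        exact hNl ((IH (n - 1) hn1).1 N hN (by omega) (hk.trans hcnt) (h2.trans hcnt))
    by_cases hAA : ∃ f g, (P f).2 ≠ (0, 0) ∧ (P g).2 ≠ (0, 0) ∧ causalTop (P f) ≠ causalTop (P g)
    · obtain ⟨f, g, hfc, hgc, hne⟩ := hAA
      exact edge_AA2 hU hP (hD.2 P hP) (fun e => hne (by rw [e])) hfc hgc hne hK
    · push Not at hAA
      obtain ⟨g, hg⟩ : ∃ g, causalTop (P g) ≠ causalTop (P f₀) := by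
        by_contra hall; push Not at hall; exact hnl fun f f' => by rw [hall f, hall f']
      have hg0 : (P g).2 = (0, 0) := by
        by_contra hgc; exact hg (hAA g f₀ hgc hf₀c)
      exact edge_Aa2 hU hP (hD.2 P hP) hf₀c hg0 (by rw [← causalTop_of_uncharged hg0]; exact fun e => hg e.symm) hK
  refine ⟨fun Z hZ hμ hk h2 => ?_, hPn⟩
  · by_contra hnl
    have hZD := hU.1 Z hZ
    -- node-flat cells: a floor cell with an apex closes ((R2)+(R3), `floorApex_absent`); the rest are seeds
    have hNF : ¬ NodeFlat Z := by
      intro hF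
      by_cases hFA : FloorCell Z ∧ ∃ f, (Z f).2 = (0, 0)
      · obtain ⟨hFl, f', hf'0⟩ := hFA
        obtain ⟨τ, hmaxτ⟩ := exists_max_absCharge Z
        obtain ⟨σ₀, -, hσ₀c⟩ := exists_charged_ne h2 0
        have hτc : (Z τ).2 ≠ (0, 0) := fun h0 => by
          have h1 := absCharge_of_uncharged h0
          have h3 := absCharge_pos_of_not_isApex (hZD σ₀).1 (not_isApex_of_snd_ne hσ₀c)
          have h4 := hmaxτ σ₀
          omega
        obtain ⟨σ, hστ, hσc⟩ := exists_charged_ne h2 τ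
        refine floorApex_absent hU hD hA hPl hZ hFl hστ hσc hτc hmaxτ hf'0 (fun N hN hNτc hn0 hcnt => ?_) (fun N hN hcnt hlt => ?_)
        · have hL : LevelCell N := hk3 N hN (by omega) (by omega)
          have h1 := hCD.2 N hN hL τ hNτc
          rw [hn0] at h1
          have : (1 : ℤ) ≤ chargeCount N := by exact_mod_cast (show 1 ≤ chargeCount N by omega)
          omega
        · have hlex := lexMeasure_lt hZD (hU.1 N hN) (Or.inl hlt)
          have hB := lexMeasure_le (hU.1 N hN)
          have hn1 : n - 1 < n := by omega
          exact (IH (n - 1) hn1).1 N hN (by omega) (hk.trans hcnt) (h2.trans hcnt)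
      · exact hnl (hSN Z hZ h2 (Or.inl ⟨hF, hFA⟩))
    -- the induction hypothesis kills every same-tops `P`-child of larger `Q` with ≥ 3 charged letters, or with 2 and not high
    have hKillP : ∀ P ∈ C.upper, 2 ≤ chargeCount P → k ≤ chargeCount P → (3 ≤ chargeCount P ∨ ¬ HighP P) →
        (∀ f, causalTop (P f) = causalTop (Z f)) → totalCharge Z < totalCharge P → False := by
      intro P hP hP2 hPk hP3 htops hQ
      have hlex := lexMeasure_lt hZD (hU.2 P hP) (Or.inr ⟨(maxTop_congr htops).ge, hQ⟩)
      have hB := lexMeasure_le (hU.2 P hP)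
      have hn1 : n - 1 < n := by omega
      have hPl : LevelCell P := (IH (n - 1) hn1).2 P hP (by omega) hPk hP2 hP3
      exact hnl fun f f' => by rw [← htops f, ← htops f']; exact hPl f f'
    have hK1 : KillBelow C Z (chargeCount Z + 1) := fun P hP hcnt htops hQ =>
      hKillP P hP (by omega) (by omega) (Or.inl (by omega)) htops hQ
    rcases Nat.lt_or_ge 2 (chargeCount Z) with h3 | hle2
    · have hK : KillBelow C Z (chargeCount Z) := fun P hP hcnt htops hQ => hKillP P hP (by omega) (by omega) (Or.inl (by omega)) htops hQ
      have hnf : ¬ NodeFlat Z := hNF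
      obtain ⟨f, g, hfg'⟩ : ∃ f g, nodeLevel (Z f) ≠ nodeLevel (Z g) := by
        by_contra hall; push Not at hall; exact hnf hall
      have hfg : f ≠ g := fun e => hfg' (by rw [e])
      by_cases hf0 : (Z f).2 = (0, 0)
      · by_cases hg0 : (Z g).2 = (0, 0)
        · exact charged_of_three h3 hg0 hfg hf0
        · exact edge_at hU hZ (hD.1 Z hZ) hf0 hg0 (by rw [← nodeLevel_of_uncharged hf0]; exact hfg') hK
      · by_cases hg0 : (Z g).2 = (0, 0)
        · exact edge_at hU hZ (hD.1 Z hZ) hg0 hf0 (by rw [← nodeLevel_of_uncharged hg0]; exact fun e => hfg' e.symm) hK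
        · exact edge_tt hU hZ (hD.1 Z hZ) hfg hf0 hg0 hfg' hK
    · have h2e : chargeCount Z = 2 := le_antisymm hle2 h2
      have hnf : ¬ NodeFlat Z := hNF
      by_cases hT : TwinApex2 Z
      · have hnh : ¬ HighTwin Z := fun hH => hnl (hSN Z hZ h2 (Or.inr hH))
        have hKat : ∀ j, (Z j).2 ≠ (0, 0) → nodeLevel (Z j) ≤ 4 → KillBelowAt C Z j := by
          intro j hjc hj4 P hP htops hQ hPj hor
          rcases hor with hcnt | ⟨hcnt, hnd⟩
          · exact hKillP P hP (by omega) (by omega) (Or.inl (by omega)) htops hQ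
          · refine hKillP P hP (by omega) (by omega) (Or.inr fun hH => ?_) htops hQ
            have := hH j hPj
            rw [hcnt, h2e] at this
            push_cast at this
            omega
        have hKtt : ∀ g, (Z g).2 ≠ (0, 0) → nodeLevel (Z g) < 4 → KillBelowTT C Z g := by
          intro g hgc hg4 P hP htops hQ hcnt hPg hnd
          refine hKillP P hP (by omega) (by omega) (Or.inr fun hH => ?_) htops hQ
          have := hH g hPg
          rw [hcnt, h2e] at this
          push_cast at this
          omega
        by_cases hlow : ∃ f, (Z f).2 ≠ (0, 0) ∧ nodeLevel (Z f) < 4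
        · obtain ⟨f, hfc, hf4⟩ := hlow
          by_cases hapx : ∃ g, (Z g).2 = (0, 0) ∧ (Z g).1 ≠ nodeLevel (Z f)
          · obtain ⟨g, hg0, hne⟩ := hapx
            exact edge_at_info hU hZ (hD.1 Z hZ) hg0 hfc hne (hKat f hfc (by omega))
          · push Not at hapx
            obtain ⟨j, hj⟩ : ∃ j, nodeLevel (Z j) ≠ nodeLevel (Z f) := by
              by_contra hall; push Not at hall; exact hnf fun a b => by rw [hall a, hall b]
            have hjc : (Z j).2 ≠ (0, 0) := fun hj0 => hj (by rw [nodeLevel_of_uncharged hj0]; exact hapx j hj0)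
            have hfj : f ≠ j := fun e => hj (by rw [e])
            exact edge_tt_info hU hZ (hD.1 Z hZ) hfj hfc hjc (fun e => hj e.symm) (hKtt f hfc hf4)
        · push Not at hlow
          have hC : ¬ ∀ f g, (Z f).2 ≠ (0, 0) → nodeLevel (Z f) = 4 → (Z g).2 = (0, 0) → (Z g).1 = 4 := fun hC => hnh ⟨hT, hlow, hC⟩
          push Not at hC
          obtain ⟨f, g, hfc, hf4, hg0, hg4⟩ := hC
          exact edge_at_info hU hZ (hD.1 Z hZ) hg0 hfc (by rw [hf4]; exact hg4) (hKat f hfc (le_of_eq hf4))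
      · by_cases hB : ∀ f g, (Z f).2 = (0, 0) → (Z g).2 = (0, 0) → (Z f).1 = (Z g).1
        · have hC : ¬ ∀ f g, (Z f).2 = (0, 0) → (Z g).2 ≠ (0, 0) → nodeLevel (Z g) = 0 → (Z f).1 = 0 := fun hC => hT ⟨hle2, hB, hC⟩
          push Not at hC
          obtain ⟨f, g, hf0, hgc, hg0n, hfne⟩ := hC
          exact edge_at_floor hU hZ (hD.1 Z hZ) hf0 hgc hg0n hfne hK1
        · push Not at hB
          obtain ⟨f, g, hf0, hg0, hne⟩ := hB
          have hfg : f ≠ g := fun e => hne (by rw [e])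
          exact edge_aa hU hZ (hD.1 Z hZ) hfg hf0 hg0 hne hK1

/-- **(CD) ∧ (SN5) ∧ (SP) ⇒ (LVN) ∧ (LVP3) ∧ (LVP2⁻), locally** (KERNEL, every `h`; v7 seed (SN5)): the strata `k = 4, 3, 2` in turn. -/
theorem levelLocal_of_cd_seeds4 {h : ℤ} {C : MConfig} (hU : C.InDiamond h) (hD : RuleDMu4Closed C) (hA : A2IMinusClosed C) (hPl : PermClosed C.lower)
    (hCD : CDIneq C) (hSN : SeedN5Local C) (hSP : SeedPLocal C) :
    (∀ Z ∈ C.lower, 2 ≤ chargeCount Z → LevelCell Z) ∧ (∀ P ∈ C.upper, 3 ≤ chargeCount P → LevelCell P) ∧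
      (∀ P ∈ C.upper, 2 ≤ chargeCount P → ¬ HighP P → LevelCell P) := by
  have stage : ∀ k : ℕ, (∀ N ∈ C.lower, k + 1 ≤ chargeCount N → 2 ≤ chargeCount N → LevelCell N) →
      (∀ Z ∈ C.lower, k ≤ chargeCount Z → 2 ≤ chargeCount Z → LevelCell Z) ∧
      (∀ P ∈ C.upper, k ≤ chargeCount P → 2 ≤ chargeCount P → (3 ≤ chargeCount P ∨ ¬ HighP P) → LevelCell P) := by
    intro k hk3
    refine ⟨fun Z hZ hk h2 => ?_, fun P hP hk h2 h23 => ?_⟩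
    · exact (levelLocal_induction4 hU hD hA hPl hCD hSN hSP k hk3 ((2 * h + 1) * h + 2 * h - lexMeasure h Z).toNat).1 Z hZ
        (Int.self_le_toNat _) hk h2
    · exact (levelLocal_induction4 hU hD hA hPl hCD hSN hSP k hk3 ((2 * h + 1) * h + 2 * h - lexMeasure h P).toNat).2 P hP
        (Int.self_le_toNat _) hk h2 h23
  have s4 := stage 4 fun N hN h5 _ => absurd (chargeCount_le_four N) (by omega)
  have s3 := stage 3 fun N hN h4 h2 => s4.1 N hN h4 h2
  have s2 := stage 2 fun N hN h3 h2 => s3.1 N hN h3 h2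
  exact ⟨fun Z hZ h2 => s2.1 Z hZ h2 h2, fun P hP h3 => s2.2 P hP (by omega) (by omega) (Or.inl h3),
    fun P hP h2 hnh => s2.2 P hP h2 h2 (Or.inr hnh)⟩

theorem levelNLaw_of_cd_seeds5 {h : ℤ} (hCD : ChargeDepthLaw h) (hSN : SeedN5Law h) (hSP : SeedPLaw h) : LevelNLaw h :=
  fun C hU hG hS => (levelLocal_of_cd_seeds4 hU hS.1 hS.2.2 hG.1 (hCD C hU hG hS) (hSN C hU hG hS) (hSP C hU hG hS)).1

theorem levelP3Law_of_cd_seeds5 {h : ℤ} (hCD : ChargeDepthLaw h) (hSN : SeedN5Law h) (hSP : SeedPLaw h) : LevelP3Law h :=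
  fun C hU hG hS => (levelLocal_of_cd_seeds4 hU hS.1 hS.2.2 hG.1 (hCD C hU hG hS) (hSN C hU hG hS) (hSP C hU hG hS)).2.1

theorem levelP2LowLaw_of_cd_seeds5 {h : ℤ} (hCD : ChargeDepthLaw h) (hSN : SeedN5Law h) (hSP : SeedPLaw h) : LevelP2LowLaw h :=
  fun C hU hG hS => (levelLocal_of_cd_seeds4 hU hS.1 hS.2.2 hG.1 (hCD C hU hG hS) (hSN C hU hG hS) (hSP C hU hG hS)).2.2

theorem levelNLaw_of_cd_seeds4 {h : ℤ} (hCD : ChargeDepthLaw h) (hSN : SeedN4Law h) (hSP : SeedPLaw h) : LevelNLaw h :=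
  levelNLaw_of_cd_seeds5 hCD (seedN5Law_of_seedN4Law hSN) hSP

theorem levelP3Law_of_cd_seeds4 {h : ℤ} (hCD : ChargeDepthLaw h) (hSN : SeedN4Law h) (hSP : SeedPLaw h) : LevelP3Law h :=
  levelP3Law_of_cd_seeds5 hCD (seedN5Law_of_seedN4Law hSN) hSP

theorem levelP2LowLaw_of_cd_seeds4 {h : ℤ} (hCD : ChargeDepthLaw h) (hSN : SeedN4Law h) (hSP : SeedPLaw h) : LevelP2LowLaw h :=
  levelP2LowLaw_of_cd_seeds5 hCD (seedN5Law_of_seedN4Law hSN) hSP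

/-- **(T₈) ⟸ (CD-P₈) ∧ (CDN4₈) ∧ (SN5₈) ∧ (SP₈)** (KERNEL glue, v7: every floor-with-apex `N`-cell is derived).  NOT a proof of (T₈); HC ∕ HC_CM ∕
HC_AV ∕ H2 NOT proved. -/
theorem seedB1Odd_eight_of_cdP_seeds5 (hP : ChargeDepthPLaw 8) (hS4 : CDNSeedLaw 8) (hSN : SeedN5Law 8) (hSP : SeedPLaw 8) :
    SeedB1OddDiamondG1H1 8 :=
  have hCD := chargeDepthLaw_of_cdP_seed hP hS4
  seedB1Odd_eight_of_partial_cd hCD (levelNLaw_of_cd_seeds5 hCD hSN hSP) (levelP3Law_of_cd_seeds5 hCD hSN hSP) oddLineFree_eight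

/-- **(T_h) ⟸ (CD-P_h) ∧ (CDN4_h) ∧ (SN5_h) ∧ (SP_h) ∧ (NS_h) for every `h ≤ 10`** (KERNEL glue, v7).  NOT a proof of (T₁₀). -/
theorem seedB1Odd_of_cdP_seeds5_nest_le_ten {h : ℤ} (hh : h ≤ 10) (hP : ChargeDepthPLaw h) (hS4 : CDNSeedLaw h) (hSN : SeedN5Law h)
    (hSP : SeedPLaw h) (hNS : NestLaw h) : SeedB1OddDiamondG1H1 h := by
  have hCD := chargeDepthLaw_of_cdP_seed hP hS4
  refine seedB1Odd_of_level_nest_downLine (levelLaw_of_partial (levelNLaw_of_cd_seeds5 hCD hSN hSP) (levelP3Law_of_cd_seeds5 hCD hSN hSP)) hNS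
    (fun h' hh' => ?_) (oddLineFree_all_le (by omega))
  have hCD' := chargeDepthLaw_antitone hh' hCD
  exact downLineLaw_of_partial_cd_le_ten (hh'.trans hh) hCD' (levelNLaw_of_cd_seeds5 hCD' (seedN5Law_antitone hh' hSN) (seedPLaw_antitone hh' hSP))
    (levelP3Law_of_cd_seeds5 hCD' (seedN5Law_antitone hh' hSN) (seedPLaw_antitone hh' hSP))

theorem seedB1Odd_ten_of_cdP_seeds5_nest (hP : ChargeDepthPLaw 10) (hS4 : CDNSeedLaw 10) (hSN : SeedN5Law 10) (hSP : SeedPLaw 10)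
    (hNS : NestLaw 10) : SeedB1OddDiamondG1H1 10 :=
  seedB1Odd_of_cdP_seeds5_nest_le_ten le_rfl hP hS4 hSN hSP hNS

/-- **(T₈) ⟸ (CD-P₈) ∧ (CDN4₈) ∧ (SN4₈) ∧ (SP₈)** (KERNEL glue, v6).  NOT a proof of (T₈); HC ∕ HC_CM ∕ HC_AV ∕ H2 NOT proved. -/
theorem seedB1Odd_eight_of_cdP_seeds4 (hP : ChargeDepthPLaw 8) (hS4 : CDNSeedLaw 8) (hSN : SeedN4Law 8) (hSP : SeedPLaw 8) :
    SeedB1OddDiamondG1H1 8 :=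
  have hCD := chargeDepthLaw_of_cdP_seed hP hS4
  seedB1Odd_eight_of_partial_cd hCD (levelNLaw_of_cd_seeds4 hCD hSN hSP) (levelP3Law_of_cd_seeds4 hCD hSN hSP) oddLineFree_eight

/-- **(T_h) ⟸ (CD-P_h) ∧ (CDN4_h) ∧ (SN4_h) ∧ (SP_h) ∧ (NS_h) for every `h ≤ 10`** (KERNEL glue, v6).  NOT a proof of (T₁₀); HC ∕ HC_CM ∕ HC_AV ∕ H2
NOT proved. -/
theorem seedB1Odd_of_cdP_seeds4_nest_le_ten {h : ℤ} (hh : h ≤ 10) (hP : ChargeDepthPLaw h) (hS4 : CDNSeedLaw h) (hSN : SeedN4Law h)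
    (hSP : SeedPLaw h) (hNS : NestLaw h) : SeedB1OddDiamondG1H1 h := by
  have hCD := chargeDepthLaw_of_cdP_seed hP hS4
  refine seedB1Odd_of_level_nest_downLine (levelLaw_of_partial (levelNLaw_of_cd_seeds4 hCD hSN hSP) (levelP3Law_of_cd_seeds4 hCD hSN hSP)) hNS
    (fun h' hh' => ?_) (oddLineFree_all_le (by omega))
  have hCD' := chargeDepthLaw_antitone hh' hCD
  exact downLineLaw_of_partial_cd_le_ten (hh'.trans hh) hCD' (levelNLaw_of_cd_seeds4 hCD' (seedN4Law_antitone hh' hSN) (seedPLaw_antitone hh' hSP))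
    (levelP3Law_of_cd_seeds4 hCD' (seedN4Law_antitone hh' hSN) (seedPLaw_antitone hh' hSP))

theorem seedB1Odd_ten_of_cdP_seeds4_nest (hP : ChargeDepthPLaw 10) (hS4 : CDNSeedLaw 10) (hSN : SeedN4Law 10) (hSP : SeedPLaw 10)
    (hNS : NestLaw 10) : SeedB1OddDiamondG1H1 10 :=
  seedB1Odd_of_cdP_seeds4_nest_le_ten le_rfl hP hS4 hSN hSP hNS

/-! ## §13 (v8, g13) The fifth move: the LINE RAISE above a floor `P`-letter (the `P`-dual of (F1)), and the (R4) boundary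

§2 lists the four `Q`-RAISING moves the kernel edges use (line child ∕ top raise ∕ apex lowering ∕ apex raise).  The census kills of the (R4) class
(non-level four-charged floor `N`-orbits) run through the one `Q`-LOWERING move on the `P` side: RULE D above a floor `P`-cell at the pair
(node coordinate `0` of a charged floor letter `g`, a nonzero coordinate of another letter `j`) is served either at `j` (raised along that frame) or by
the LINE RAISE of `g` — `cℓ_φ ↦ 2d·I + (c−d)ℓ_φ` (`0 < d ≤ c`: same causal top, node `+2d`, charge `−d`) or, past the apex `2c·I`, `↦ 2c·I + (d−c)ℓ_{−φ}`
(node `2c`, top `2d`).  `lineRaise_of_ray` is the letter geometry, `floorAscent` the served form (KERNEL, every `h`, law-free); `fullDescent_of_unit` records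
that below a UNIT floor letter (F1) leaves only the full descent `σ ↦ O`.  See the memo §13 for why these do not yet close (R4): the census chains
`Z ↦ Z(σ ↦ O) ↦ line raises ↦ X⁺∕A2I⁻ conflicts among two-apex cells` DESCEND in `Q` at fixed `maxTop`, against the grain of `lexMeasure`. -/

/-- **the LINE RAISE**: `d > 0` null steps from a charged μ₄ letter `x` in its NODE direction `m` (adapted, `coord x m = node`) give, while `d ≤ |c|`,
a letter on the line of `x` (same causal top, node `+2d`, charge `−d`), and past the apex (`|c| < d`) a letter of node `= top x`, top `= node x + 2d`. -/
theorem lineRaise_of_ray {x y : BPoint} {m : Fin 4} {d : ℤ} (hxax : x.2 = (0, 0) ∨ AxisPt x) (hna : x.2 ≠ (0, 0)) (hm : Adapted x m)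
    (hm0 : coord x m = x.1 - absCharge x) (hd : 0 < d) (hy : y = ray x m d) :
    (d ≤ absCharge x → causalTop y = causalTop x ∧ nodeLevel y = nodeLevel x + 2 * d ∧ absCharge y + d = absCharge x) ∧
      (absCharge x < d → nodeLevel y = causalTop x ∧ causalTop y = nodeLevel x + 2 * d ∧ absCharge y = d - absCharge x) := by
  obtain ⟨α, a, b⟩ := x
  subst hy
  simp only [causalTop, nodeLevel, absCharge, chargeOf, coord, AxisPt, Adapted, Prod.mk.injEq, ne_eq] at *
  fin_cases m <;> simp at hxax hna hm hm0 ⊢ <;> (simp only [abs_eq_max_neg, max_def] at *; split_ifs at * <;> omega)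

/-- **(F1ᴾ) FLOOR ASCENT** (KERNEL, every `h`, law-free; the `P`-dual of `floorDescent`): above a `P`-cell whose charged letter `g` is on the floor, RULE D at
(node of `g`, a nonzero adapted coordinate `k` of a charged `j ≠ g`) is served — if no `N ∈ C.lower` agreeing with `P` off `{g, j}` raises `j` along `k` (alone or
in a cover) — by a LINE RAISE of `g`: an `N ∈ C.lower` agreeing with `P` off `g` whose `g`-letter is `d > 0` null steps up the node direction of `P g`
(letter geometry: `lineRaise_of_ray`). -/
theorem floorAscent {h : ℤ} {C : MConfig} (hU : C.InDiamond h) {P : MCell} (hP : P ∈ C.upper) (hD : RuleDMu4P C P) {g j : Fin 4} (hgj : g ≠ j)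
    (hgc : (P g).2 ≠ (0, 0)) (hFg : nodeLevel (P g) = 0) (hjc : (P j).2 ≠ (0, 0)) {k : Fin 4} (hk : Adapted (P j) k) (hk0 : coord (P j) k ≠ 0)
    (hKj : ∀ N ∈ C.lower, (∀ f, f ≠ g → f ≠ j → N f = P f) → (P j).1 < (N j).1 → N j = ray (P j) k ((N j).1 - (P j).1) → False) :
    ∃ N ∈ C.lower, ∃ m : Fin 4, ∃ d : ℤ, 0 < d ∧ Adapted (P g) m ∧ coord (P g) m = (P g).1 - absCharge (P g) ∧ MAgree P N g ∧
      N g = ray (P g) m d := by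
  obtain ⟨m, hm, hm0⟩ := exists_node_dir (hU.2 P hP g).1
  have hm00 : coord (P g) m = 0 := by rw [hm0]; unfold nodeLevel at hFg; omega
  have hne : coord (P g) m ≠ coord (P j) k := by rw [hm00]; exact Ne.symm hk0
  have hng : ¬ isApex (P g) := not_isApex_of_snd_ne hgc
  have hnj : ¬ isApex (P j) := not_isApex_of_snd_ne hjc
  -- a raise of `g` off its top direction `m + 2` is the line raise (direction `m`)
  have graise : ∀ N ∈ C.lower, ∀ r : Fin 4, r ≠ m + 2 → (P g).1 < (N g).1 → N g = ray (P g) r ((N g).1 - (P g).1) →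
      N g = ray (P g) m ((N g).1 - (P g).1) := by
    intro N hN r hr hlt hray
    rcases ray_dir_of_adapted (hU.2 P hP g).1 hng hm (by omega) hray (hU.1 N hN g).1 with rfl | rfl
    · exact hray
    · exact absurd rfl hr
  -- a raise of the charged `j` off direction `k + 2` is along `k`
  have jraise : ∀ N ∈ C.lower, ∀ r : Fin 4, r ≠ k + 2 → (P j).1 < (N j).1 → N j = ray (P j) r ((N j).1 - (P j).1) →
      N j = ray (P j) k ((N j).1 - (P j).1) := by
    intro N hN r hr hlt hray
    rcases ray_dir_of_adapted (hU.2 P hP j).1 hnj hk (by omega) hray (hU.1 N hN j).1 with rfl | rfl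
    · exact hray
    · exact absurd rfl hr
  rcases hD g j hgj m k hm hk hne with ⟨r, hr, N, hN, hag, hlt, hray⟩ | ⟨r, hr, N, hN, hag, hlt, hray⟩ |
      ⟨a, b, ha, hb, N, hN, hag2, hlt1, hray1, hlt2, hray2⟩
  · exact ⟨N, hN, m, (N g).1 - (P g).1, by omega, hm, hm0, hag, graise N hN r hr hlt hray⟩
  · exact (hKj N hN (fun f _ hfj => (hag f hfj).symm) hlt (jraise N hN r hr hlt hray)).elim
  · have hb' : b = k := hb.elim id fun h' => absurd h'.1 hnj
    rw [hb'] at hray2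
    exact (hKj N hN (fun f hfg hfj => hag2 f hfg hfj) hlt2 hray2).elim

/-- **full descent under a UNIT floor letter**: below a floor `N`-cell, (F1) at a unit letter `σ` (and any other letter) is served by `Z(σ ↦ O)`:
a `P ∈ C.upper` agreeing with `Z` off `σ` with `P σ = O`. -/
theorem fullDescent_of_unit {h : ℤ} {C : MConfig} (hU : C.InDiamond h) {Z : MCell} (hZ : Z ∈ C.lower) (hD : RuleDMu4N C Z) (hF : FloorCell Z)
    {σ j : Fin 4} (hσj : σ ≠ j) (hσc : (Z σ).2 ≠ (0, 0)) (h1 : absCharge (Z σ) = 1) :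
    ∃ P ∈ C.upper, MAgree P Z σ ∧ P σ = (0, 0, 0) := by
  obtain ⟨P, hP, e, he, hag, hn, -, hq⟩ := floorDescent hU hZ hD hF hσj hσc
  have h0 := absCharge_nonneg (P σ)
  have hq0 : absCharge (P σ) = 0 := by omega
  exact ⟨P, hP, hag, floor_apex_eq (hU.2 P hP σ) hn (snd_eq_zero_of_absCharge (hU.2 P hP σ).1 hq0)⟩

/-! ## §14 (v9, g14) GROUND CELLS: (F1) + the swap clause need only ONE floor letter and ONE `O` — spectators arbitrary

The census chains that kill the (R4) floor `N`-orbits (memo `CHARGE-INDUCTION-g14.md` §14, census j318002 ◇₈ `a459e02921a60310` ∕ ◇₁₀ `74004db439790926`)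
leave the floor at their second step: archetype (a) runs `N[O|2ℓ|2ℓ|2ℓ] ↦ P[O|O|2ℓ|2ℓ] ↦ N[O|4I|2ℓ|2ℓ] ↦ P[O|4I|O|2ℓ] ↦ X⁺`, and at the head
`N[O|4I|2ℓ|2ℓ]` (a floor letter `2ℓ`, an `O`, and the INTERIOR apex `4I` as spectator) the §10 lemmas `floorDescent` ∕ `floorSwap` ∕ `floorChain` do not
apply as typed (`FloorCell Z` asks every letter to have node level `0`).  Their proofs never used the spectators: (F1) needs node level `0` at the served
letter `g` and at the compared letter `j` only (`groundDescent`), the swap clause needs the floor letter `σ` and `Z f′ = O` only (`groundSwap`), and so does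
the chain (`groundChain`).  KERNEL, every `h`, law-free; §10's three theorems are the special case `FloorCell Z`. -/

/-- **(F1) GROUND DESCENT** (KERNEL, every `h`; `floorDescent` with spectators freed): below an `N`-cell `Z ∈ C.lower`, RULE-D closed at `Z`, with a charged
FLOOR letter at `g` (node level `0`) and a GROUND letter at `j ≠ g` (node level `0`: a floor letter or `O`), RULE D at (top of `g`, node of `j`) is served by a
`P ∈ C.upper` agreeing with `Z` off `g` whose `g`-letter is the floor letter `e > 0` charges lower on the same ray (top `− 2e`); the other two letters are free. -/
theorem groundDescent {h : ℤ} {C : MConfig} (hU : C.InDiamond h) {Z : MCell} (hZ : Z ∈ C.lower) (hD : RuleDMu4N C Z) {g j : Fin 4}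
    (hgj : g ≠ j) (hgc : (Z g).2 ≠ (0, 0)) (hF0g : nodeLevel (Z g) = 0) (hF0j : nodeLevel (Z j) = 0) :
    ∃ P ∈ C.upper, ∃ e : ℤ, 0 < e ∧ MAgree P Z g ∧ nodeLevel (P g) = 0 ∧ causalTop (P g) + 2 * e = causalTop (Z g) ∧
      absCharge (P g) + e = absCharge (Z g) := by
  obtain ⟨k, hk, hk0⟩ := exists_top_dir (hU.1 Z hZ g).1
  obtain ⟨m', hm', hm0'⟩ := exists_node_dir (hU.1 Z hZ j).1
  have hcg : 0 < absCharge (Z g) := absCharge_pos_of_not_isApex (hU.1 Z hZ g).1 (fun ha => hgc ((isApex_iff_snd _).1 ha))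
  have hFg := hF0g
  have hFj := hF0j
  unfold nodeLevel at hFg hFj
  have hne' : coord (Z g) k ≠ coord (Z j) m' := by rw [hk0, hm0']; omega
  -- the `j`-options leave the diamond: an apex `O` cannot be lowered, a floor letter has no line child
  have hjapex : (Z j).2 = (0, 0) → ∀ P ∈ C.upper, (P j).1 < (Z j).1 → False := by
    intro hj0 P hP hlt
    have hPj := (hU.2 P hP j).2.1
    have := absCharge_of_uncharged hj0
    have h0 := absCharge_nonneg (P j)
    omega
  have hjline : (Z j).2 ≠ (0, 0) → ∀ P ∈ C.upper, ∀ r : Fin 4, r ≠ m' + 2 → (P j).1 < (Z j).1 →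
      Z j = ray (P j) r ((Z j).1 - (P j).1) → False := by
    intro hjc P hP r hr hlt hray
    obtain ⟨-, -, hnd⟩ := lineChild_of_ray (hU.1 Z hZ j).1 hjc hm' hm0' hr (by omega) hray (hU.2 P hP j).1 (hU.2 P hP j).2.1
    have h0 := nodeLevel_nonneg_of_inDiamond (hU.2 P hP j)
    have := hF0j
    omega
  rcases hD g j hgj k m' hk hm' hne' with ⟨r, hr, P, hP, hag, hlt, hray⟩ | ⟨r, hr, P, hP, hag, hlt, hray⟩ |
      ⟨a, b, ha, hb, P, hP, hag2, hlt1, hray1, hlt2, hray2⟩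
  · obtain ⟨hle, hline⟩ := topChild_of_ray (hU.1 Z hZ g).1 hgc hk hk0 hr (by omega) hray (hU.2 P hP g).1 (hU.2 P hP g).2.1
    have h0 := nodeLevel_nonneg_of_inDiamond (hU.2 P hP g)
    have hn : nodeLevel (P g) = nodeLevel (Z g) := by have := hF0g; omega
    obtain ⟨ht, hq⟩ := hline hn
    exact ⟨P, hP, (Z g).1 - (P g).1, by omega, hag, by rw [hn]; exact hF0g, ht, hq⟩
  · by_cases hj0 : (Z j).2 = (0, 0)
    · exact (hjapex hj0 P hP hlt).elim
    · exact (hjline hj0 P hP r hr hlt hray).elim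
  · by_cases hj0 : (Z j).2 = (0, 0)
    · exact (hjapex hj0 P hP hlt2).elim
    · have hb' : b = m' := hb.elim id fun h' => absurd h'.1 (not_isApex_of_snd_ne hj0)
      rw [hb'] at hray2
      exact (hjline hj0 P hP m' (fin4_ne_add_two m') hlt2 hray2).elim


/-- **THE GROUND SWAP CLAUSE** (KERNEL, every `h`; `floorSwap` with spectators freed): an `N`-cell `Z ∈ C.lower` with a charged floor letter at `σ`
(encoder direction `u`), `Z f′ = O` at `f′ ≠ σ`, any letters elsewhere, whose FULL descent `q = Z(σ ↦ O) ∈ C.upper` is present, in an A2I⁻-closed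
configuration with `S₄`-closed lower level in the diamond, has present EITHER a shallower `u`-partner `Z − e·σ` (`0 < e < |c_σ|`) OR a polluter
`Z(σ ↦ O, f′ ↦ c′ℓ_u)` (`0 < c′ ≤ |c_σ|`).  (A2I⁻ at head `Z`, `s = σ`, `q`, `N₂ = Z ∘ swap(σ, f′)` present by `PermClosed`.) -/
theorem groundSwap {h : ℤ} {C : MConfig} (hU : C.InDiamond h) (hA : A2IMinusClosed C) (hPl : PermClosed C.lower)
    {Z : MCell} (hZ : Z ∈ C.lower) {σ f' u : Fin 4} (hσf : σ ≠ f') (hσc : (Z σ).2 ≠ (0, 0)) (hσ0 : nodeLevel (Z σ) = 0) (hu : EncDir (Z σ) u)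
    (hO : Z f' = (0, 0, 0)) {q : MCell} (hq : q ∈ C.upper) (hqa : MAgree q Z σ) (hqσ : q σ = Z f') :
    (∃ P ∈ C.upper, MAgree P Z σ ∧ 0 < (P σ).1 ∧ (P σ).1 < (Z σ).1 ∧ Z σ = ray (P σ) u ((Z σ).1 - (P σ).1)) ∨
      ∃ P ∈ C.upper, (∀ g, g ≠ σ → g ≠ f' → P g = Z g) ∧ P σ = Z f' ∧ 0 < (P f').1 ∧ (P f').1 ≤ (Z σ).1 ∧
        P f' = ray (Z f') u (P f').1 := by
  have hZσD := hU.1 Z hZ σ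
  have hZf'D := hU.1 Z hZ f'
  obtain ⟨hray, hlev, hcabs⟩ := floor_letter_ray hZσD hσ0 hu
  have hcpos : 0 < (Z σ).1 := by
    have := absCharge_pos_of_not_isApex hZσD.1 (fun ha => hσc ((isApex_iff_snd _).1 ha)); omega
  have hN' : Z.perm (Equiv.swap σ f') ∈ C.lower := hPl _ Z hZ
  have hN'σ : Z.perm (Equiv.swap σ f') σ = Z f' := by simp [MCell.perm_apply, Equiv.swap_apply_left]
  have hN'f : Z.perm (Equiv.swap σ f') f' = Z σ := by simp [MCell.perm_apply, Equiv.swap_apply_right]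
  have hN'g : ∀ g, g ≠ σ → g ≠ f' → Z.perm (Equiv.swap σ f') g = Z g := fun g h1 h2 => by
    simp [MCell.perm_apply, Equiv.swap_apply_of_ne_of_ne h1 h2]
  by_contra hno
  push Not at hno
  obtain ⟨hno1, hno2⟩ := hno
  apply hA Z hZ q hq _ hN' σ u f' u
  refine ⟨not_isApex_of_snd_ne hσc, hu, ⟨hqa, ?_, ?_⟩, ?_, hσf.symm, ⟨?_, ?_, ?_⟩, ?_, ?_, ?_, ?_, ?_⟩
  · rw [hqσ, hO]; simpa using hcpos
  · rw [hqσ, hO]; simpa using hray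
  · intro _; rw [hqσ, hO, hcabs]; simp
  · intro g hg
    by_cases hgs : g = σ
    · rw [hgs, hqσ, hN'σ]
    · rw [hqa g hgs, hN'g g hgs hg]
  · rw [hqa f' hσf.symm, hN'f, hO]; simpa using hcpos
  · rw [hqa f' hσf.symm, hN'f, hO]; simpa using hray
  · rintro P hP w hw ⟨-, hlt, hrayw⟩
    exact floor_noOtherDir hZσD hσ0 hu (hU.2 P hP σ) hw (by omega) hrayw
  · -- a shallower u-partner with σ-letter above level 0 is the first alternative
    rintro P hP ⟨hag, hlt, hr⟩
    rw [hqσ, hO]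
    by_contra hpos
    exact hno1 P hP hag (by simp at hpos; omega) hlt hr
  · rintro P hP ⟨-, hlt, -⟩
    rw [hqσ, hO] at hlt
    have := (hU.2 P hP σ).2.1
    have := absCharge_nonneg (P σ)
    simp at hlt; omega
  · intro P hP hnb
    exfalso
    rw [hO] at hnb
    have h1 : (P f').1 < 0 := by simpa using hnb.1
    have h2 := (hU.2 P hP f').2.1
    have h3 := absCharge_nonneg (P f')
    omega
  · intro P hP hPg hline
    have hPσD := hU.2 P hP σ
    have hPσ : P σ = Z f' := by
      obtain ⟨hle, hr⟩ := hline
      rw [hqσ, hO] at hle hr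
      have h0 : (P σ).1 = 0 := by have := hPσD.2.1; have := absCharge_nonneg (P σ); simp at hle; omega
      rw [h0, sub_zero, ray_zero'] at hr
      rw [hO]; exact hr.symm
    refine ⟨?_, ?_⟩
    · rintro ⟨h1, h2, h3⟩
      rw [hN'f] at h2
      rw [hO] at h1 h3
      have h1' : 0 < (P f').1 := by simpa using h1
      refine hno2 P hP hPg hPσ h1' h2 ?_
      rw [hO]; simpa using h3
    · rintro ⟨-, hsp⟩
      rw [hO] at hsp
      exact floor_notSpacelike (hU.2 P hP f') hsp


/-- **THE GROUND CHAIN** (KERNEL, every `h`; `floorChain` with spectators freed): an `N`-cell `Z ∈ C.lower`, RULE-D closed at `Z`, with a charged floor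
letter at `σ` and `Z f′ = O` (`f′ ≠ σ`), in an A2I⁻-closed configuration with `S₄`-closed lower level in the diamond, has present EITHER a `P`-cell agreeing
with `Z` off `σ` whose `σ`-letter is a floor letter of smaller positive charge (a partial descent) OR a polluter `Z(σ ↦ O, f′ ↦ c′ℓ)`, `0 < c′ ≤ |c_σ|`.
At the archetype-(a) head `N[O|4I|2ℓ_φ|2ℓ_ψ]` (`σ ↦ 2ℓ_φ`, `f′ ↦ O`): `P[O|4I|ℓ_φ|2ℓ_ψ]` or `P[c′ℓ_φ|4I|O|2ℓ_ψ]` (`c′ = 1, 2`) is present — verbatim the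
census supports of that orbit (memo §14.2). -/
theorem groundChain {h : ℤ} {C : MConfig} (hU : C.InDiamond h) (hA : A2IMinusClosed C) (hPl : PermClosed C.lower)
    {Z : MCell} (hZ : Z ∈ C.lower) (hD : RuleDMu4N C Z) {σ f' : Fin 4} (hσf : σ ≠ f') (hσc : (Z σ).2 ≠ (0, 0)) (hσ0 : nodeLevel (Z σ) = 0)
    (hO : Z f' = (0, 0, 0)) :
    (∃ P ∈ C.upper, MAgree P Z σ ∧ nodeLevel (P σ) = 0 ∧ 0 < absCharge (P σ) ∧ absCharge (P σ) < absCharge (Z σ)) ∨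
      ∃ P ∈ C.upper, (∀ g, g ≠ σ → g ≠ f' → P g = Z g) ∧ P σ = Z f' ∧ nodeLevel (P f') = 0 ∧ 0 < absCharge (P f') ∧
        absCharge (P f') ≤ absCharge (Z σ) := by
  have hZσD := hU.1 Z hZ σ
  obtain ⟨u, hk, hk0⟩ := exists_top_dir hZσD.1
  have hu : EncDir (Z σ) u := encDir_of_top_dir hZσD.1 hσc hZσD.2.1 hk hk0
  obtain ⟨-, hlev, -⟩ := floor_letter_ray hZσD hσ0 hu
  have hf'0 : nodeLevel (Z f') = 0 := by rw [hO]; rfl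
  obtain ⟨P₀, hP₀, e, he, hag, hn, -, hqc⟩ := groundDescent hU hZ hD hσf hσc hσ0 hf'0
  by_cases h0 : absCharge (P₀ σ) = 0
  · -- the full descent is present: apply the swap clause
    have hqσ : P₀ σ = Z f' := by
      rw [hO]
      exact floor_apex_eq (hU.2 P₀ hP₀ σ) hn (snd_eq_zero_of_absCharge (hU.2 P₀ hP₀ σ).1 h0)
    rcases groundSwap hU hA hPl hZ hσf hσc hσ0 hu hO hP₀ hag hqσ with ⟨P, hP, hagP, hpos, hlt, hr⟩ | ⟨P, hP, hg, hs, hpos, hle, hr⟩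
    · left
      obtain ⟨hnP, hcP⟩ := floor_of_uPartner hZσD hσ0 hu (hU.2 P hP σ) hlt hr
      exact ⟨P, hP, hagP, hnP, by omega, by omega⟩
    · right
      rw [hO] at hr
      obtain ⟨hnP, hcP, -⟩ := floor_of_ray_origin (le_of_lt hpos) hr
      exact ⟨P, hP, hg, hs, hnP, by omega, by omega⟩
  · left
    have := absCharge_nonneg (P₀ σ)
    exact ⟨P₀, hP₀, hag, hn, by omega, by omega⟩



/-- **THE (R4) STEP OF THE SPREAD ORDER** (memo `CHARGE-INDUCTION-g14.md` §14.5–§14.6; census j318002 ◇₈ `a459e02921a60310`).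
Under the spread order σ′ = (node spread ↓, top spread ↓, `N` before `P`, …) every sampled (R4) floor head of the census-FREE
induction (470 ∕ 470 ◇₈ heads; supports 166 ∕ 166 of this one shape) is refuted by RULE D from the absence of ONE kind of cell: the
FLOOR DESCENT of a charged floor letter `g` (the head with `Z g` replaced by a floor letter of strictly smaller top, all other letters
kept) — a `P`-cell with the same node spread and, when `g` is not the unique top letter, strictly larger top spread, i.e. σ′-EARLIER,
and with at least three charged letters when `Z` has four, i.e. inside the (LVP3) class the induction has already emptied.  This is
`groundDescent` read as an absence statement: law-free, every `h`, no seed input.  (The well-founded assembly along σ′ is not typed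
here; see the memo's §14.8.) -/
theorem floorN_absent_of_floorDescents_absent {h : ℤ} {C : MConfig} (hU : C.InDiamond h)
    (hDc : ∀ Z ∈ C.lower, RuleDMu4N C Z) {Z : MCell} {g j : Fin 4} (hgj : g ≠ j) (hgc : (Z g).2 ≠ (0, 0))
    (hF0g : nodeLevel (Z g) = 0) (hF0j : nodeLevel (Z j) = 0)
    (hIH : ∀ P ∈ C.upper, MAgree P Z g → nodeLevel (P g) = 0 → causalTop (P g) < causalTop (Z g) → False) :
    Z ∉ C.lower := fun hZ => by
  obtain ⟨P, hP, e, he, hag, hF, htop, -⟩ := groundDescent hU hZ (hDc Z hZ) hgj hgc hF0g hF0j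
  exact hIH P hP hag hF (by omega)

/-- The same with the descended cell's CHARGE COUNT made explicit (the form the induction hypothesis «every non-level `P`-cell with
≥ 3 charged letters and larger spread is absent» consumes): the floor descent of `Z` at `g` keeps the three letters off `g`, so it
has at least as many charged letters as `Z` has off `g`. -/
theorem floorN_absent_of_floorDescents_absent' {h : ℤ} {C : MConfig} (hU : C.InDiamond h)
    (hDc : ∀ Z ∈ C.lower, RuleDMu4N C Z) {Z : MCell} {g j : Fin 4} (hgj : g ≠ j) (hgc : (Z g).2 ≠ (0, 0))
    (hF0g : nodeLevel (Z g) = 0) (hF0j : nodeLevel (Z j) = 0)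
    (hIH : ∀ P ∈ C.upper, MAgree P Z g → (∀ f, f ≠ g → P f = Z f) → nodeLevel (P g) = 0 →
      causalTop (P g) < causalTop (Z g) → False) :
    Z ∉ C.lower :=
  floorN_absent_of_floorDescents_absent hU hDc hgj hgc hF0g hF0j
    (fun P hP hag hF hlt => hIH P hP hag (fun f hf => hag f hf) hF hlt)


/-! ### §14b (v11, g14) THE CEILING DUAL — the (SP) step of σ′
Under σ′ the (SP) heads `P[2I|6I+ℓ|6I+ℓ|6I+ℓ_ψ]` (20 ◇₈ ∕ 511 ◇₁₀ orbits) die by ONE RULE-D-`P` clause whose single realisable alternative is the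
node-raise of a ceiling letter to `hI` (memo g14 §14.6; 10 ∕ 10 sampled, support 1).  That is `groundDescent` in `C.dual h` (floor ↔ ceiling,
`N` ↔ `P`), transported by the `Pad4TowerRuleDMu4Dual` dictionary; `◇_h` is self-dual for even `h`. -/

set_option linter.unusedSimpArgs false in
theorem absCharge_dualPt (h : ℤ) (x : BPoint) : absCharge (dualPt h x) = absCharge x := by
  obtain ⟨a, b₁, b₂⟩ := x
  simp only [absCharge, chargeOf, dualPt]
  rw [show -b₁ - -b₂ = -(b₁ - b₂) by ring, abs_neg]

set_option linter.unusedSimpArgs false in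
theorem causalTop_dualPt (h : ℤ) (x : BPoint) : causalTop (dualPt h x) = h - nodeLevel x := by
  unfold causalTop nodeLevel; rw [absCharge_dualPt]; simp only [dualPt]; ring

set_option linter.unusedSimpArgs false in
theorem nodeLevel_dualPt (h : ℤ) (x : BPoint) : nodeLevel (dualPt h x) = h - causalTop x := by
  unfold causalTop nodeLevel; rw [absCharge_dualPt]; simp only [dualPt]; ring

set_option linter.unusedSimpArgs false in
theorem snd_dualPt_ne {h : ℤ} {x : BPoint} (hx : x.2 ≠ (0, 0)) : (dualPt h x).2 ≠ (0, 0) := by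
  obtain ⟨a, b₁, b₂⟩ := x
  simp only [dualPt, ne_eq, Prod.mk.injEq, neg_eq_zero] at hx ⊢
  exact hx

set_option linter.unusedSimpArgs false in
/-- the dual of a `◇_h` letter is a `◇_h` letter (`h` even). -/
theorem inDiamond_dualPt {h : ℤ} (hh : h % 2 = 0) {x : BPoint} (hx : InDiamond h x) : InDiamond h (dualPt h x) := by
  obtain ⟨a, b₁, b₂⟩ := x
  have hq : absCharge (dualPt h (a, b₁, b₂)) = absCharge (a, b₁, b₂) := absCharge_dualPt h _
  obtain ⟨hax, h1, h2, h3⟩ := hx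
  refine ⟨?_, ?_, ?_, ?_⟩
  · rcases hax with h0 | hA
    · left; simp only [Prod.mk.injEq] at h0; simp [dualPt, h0.1, h0.2]
    · right; simp only [AxisPt, dualPt, ne_eq, neg_eq_zero] at hA ⊢; exact hA
  · rw [hq]; simp only [dualPt]; simp only at h3; omega
  · rw [hq]; simp only [dualPt]; simp only at h1 h2 h3; omega
  · rw [hq]; simp only [dualPt]; simp only at h1; omega

/-- the dual of a `◇_h` configuration is a `◇_h` configuration (`h` even). -/
theorem inDiamond_dual {h : ℤ} (hh : h % 2 = 0) {C : MConfig} (hU : C.InDiamond h) : (C.dual h).InDiamond h := by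
  refine ⟨fun Z hZ f => ?_, fun P hP f => ?_⟩
  · have hP := mem_dual_lower.1 hZ
    have := inDiamond_dualPt hh (hU.2 _ hP f)
    simpa [dualCell, dualPt_dualPt] using this
  · have hZ := mem_dual_upper.1 hP
    have := inDiamond_dualPt hh (hU.1 _ hZ f)
    simpa [dualCell, dualPt_dualPt] using this

/-- **CEILING ASCENT** = the dual of `groundDescent` (law-free, every even `h`): a `P`-cell with two ceiling letters `g ≠ j`, `P g` charged,
is served ABOVE at `g` ALONG THE CEILING — some `N ∈ C.lower` agrees with `P` off `g` and has at `g` a ceiling letter of larger node level. -/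
theorem ceilingAscent {h : ℤ} (hh : h % 2 = 0) {C : MConfig} (hU : C.InDiamond h) {P : MCell} (hP : P ∈ C.upper) (hD : RuleDMu4P C P)
    {g j : Fin 4} (hgj : g ≠ j) (hgc : (P g).2 ≠ (0, 0)) (hTg : causalTop (P g) = h) (hTj : causalTop (P j) = h) :
    ∃ N ∈ C.lower, ∃ e : ℤ, 0 < e ∧ MAgree N P g ∧ causalTop (N g) = h ∧ nodeLevel (N g) = nodeLevel (P g) + 2 * e ∧
      absCharge (N g) + e = absCharge (P g) := by
  have hU' := inDiamond_dual hh hU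
  have hZ' : dualCell h P ∈ (C.dual h).lower := dualCell_mem_dual_lower hP
  have hD' : RuleDMu4N (C.dual h) (dualCell h P) := (ruleDMu4P_dual h C P).2 hD
  have hgc' : (dualCell h P g).2 ≠ (0, 0) := snd_dualPt_ne hgc
  have hF0g : nodeLevel (dualCell h P g) = 0 := by
    show nodeLevel (dualPt h (P g)) = 0; rw [nodeLevel_dualPt]; omega
  have hF0j : nodeLevel (dualCell h P j) = 0 := by
    show nodeLevel (dualPt h (P j)) = 0; rw [nodeLevel_dualPt]; omega
  obtain ⟨P', hP', e, he, hag, hn, ht, hq⟩ := groundDescent hU' hZ' hD' hgj hgc' hF0g hF0j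
  have hN : dualCell h P' ∈ C.lower := mem_dual_upper.1 hP'
  refine ⟨dualCell h P', hN, e, he, ?_, ?_, ?_, ?_⟩
  · -- agreement off `g`
    intro f hf
    have := hag f hf            -- P' f = dualCell h P f
    show dualPt h (P' f) = P f
    rw [this]; exact dualPt_dualPt h (P f)
  · show causalTop (dualPt h (P' g)) = h
    rw [causalTop_dualPt]; omega
  · show nodeLevel (dualPt h (P' g)) = nodeLevel (P g) + 2 * e
    rw [nodeLevel_dualPt]
    have : causalTop (dualCell h P g) = h - nodeLevel (P g) := causalTop_dualPt h (P g)
    omega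
  · show absCharge (dualPt h (P' g)) + e = absCharge (P g)
    rw [absCharge_dualPt]
    have : absCharge (dualCell h P g) = absCharge (P g) := absCharge_dualPt h (P g)
    omega

/-- **THE (SP) STEP OF THE SPREAD ORDER** (`ceilingAscent` as an absence statement): the absent cells are the one-letter ceiling
node-raises (for (SP): `N[2I|6I+ℓ|6I+ℓ_ψ|8I]`, 2-charged non-level, larger node spread = σ′-earlier (LVN) cells). -/
theorem ceilingP_absent_of_ceilingAscents_absent {h : ℤ} (hh : h % 2 = 0) {C : MConfig} (hU : C.InDiamond h)
    (hDc : ∀ P ∈ C.upper, RuleDMu4P C P) {P : MCell} {g j : Fin 4} (hgj : g ≠ j) (hgc : (P g).2 ≠ (0, 0))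
    (hTg : causalTop (P g) = h) (hTj : causalTop (P j) = h)
    (hIH : ∀ N ∈ C.lower, MAgree N P g → causalTop (N g) = h → nodeLevel (P g) < nodeLevel (N g) → False) :
    P ∉ C.upper := fun hP => by
  obtain ⟨N, hN, e, he, hag, ht, hn, -⟩ := ceilingAscent hh hU hP (hDc P hP) hgj hgc hTg hTj
  exact hIH N hN hag ht (by omega)

end Summit.HodgeConjecture.HodgeConjecture.Cruxes.BlochSeedDiscOne.ChargeInduction
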